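import Literature.MathematicalPhysics.QuantumFieldTheory.Balaban1983to89.B3Op116OrderedPairs
import Literature.MathematicalPhysics.QuantumFieldTheory.Balaban1983to89.B3Op116LeibnizRows

/-!
# Bałaban, *(Higgs)₂,₃ quantum fields in a finite volume III. Renormalization* [B3] — the kernel of the operator (1.16) p. 414: THE
MIXED SEED.  The difference `W = G_k(T_ε,A+B) − G_k(T_ε,B) = G_k(T_ε,B)V_k(A,B)G_k(T_ε,A+B)` ((I.3.44)) applied to a DIPOLE source
`dip^B_{b′}Y` and read through ONE covariant derivative `D^ε_B` at a row bond `b₀` — the configuration of the chains of (1.16) with a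
dipole at both ends, where in the plain kernel bookkeeping one twice-differentiated propagator of exponent `0` always meets a scale sum
(p35 `DESIGN-FILE4.md` §9(d)) — obeys the single-exponent majorant bound of a ONCE-differentiated column times the small factor
`|e|s·K₁ + L^k|e|δ_A·K₂` (`K₁, K₂` depending on `d, L, N, δ₁, C, C_M, a` only): the seed (state `J = 0`) of p35's induction over (1.16)
(`B3Op116DKernelRegularTorus.step_state`), in its currency `𝔪_k(c,a;δ)`.

statement-level skeleton of published theorems with citation tags; proofs where landed; nothing here is a claim about the Yang–Mills mass gap

T. Bałaban, Commun. Math. Phys. **88** (1983) 411–445 [cite: Balaban1983Higgs3]; part I, Commun. Math. Phys. **85** (1982) 603–636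
[cite: Balaban1982Higgs1].  PDFs held: `paper:balaban1983-higgs-2-3-quantum-fields-finite-volume` (journal page = PDF page + 410;
p. 414 = `p0004.txt`, p. 424 = `p0014.txt`, p. 426 = `p0016.txt`), `paper:balaban1982-cmp85-higgs23-i` (journal page = PDF page + 602;
p. 605 = `p0003.txt`, p. 610 = `p0008.txt`, pp. 614–615 = `p0012.txt`–`p0013.txt`, p. 619 = `p0017.txt`).

CITATION HEADER (lean-in-tree rule).  Cell `lit-balaban` (HOME `run/shared/lean/pub/lit-balaban/`), Phase-2 proof seat **p40** gen 73
(unit `lit-balaban-p40`); TAKING line HOME/STATUS 2026-08-23T05:31Z («FILE 4M» = the mixed seed of the (1.16) programme, p35 g22's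
offer of 05:13:21Z; designs `lit-balaban-p35/DESIGN-FILE4.md` §9(d), `lit-balaban-r14/DESIGN-B3-116-analytic.md`).  SKELETON rows
**B3.Eq1.16** / **B3.Eq2.5** (fold owner r15; decl of record `B3Sect2StatementsPart2.ScaledKernels.Ineq25At`, clause (ii), the `hM` slot of
p40's `B3Ineq25Op116Smooth.ineq25At_op116_smooth_torus_of_bounds`) — a located member (no head claim).  Programme files USED BY NAME, never
restated: the engine `B3Op116OrderedPairs` (p40, FILE 4M engine: `pair_bond_le`, `sum_sq_le_of_cases`, `sum_lower_pair_le`, `majorant_succ_le`,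
`norm_pieceR_dip_apply_le`, `pcol/pdcol/pmix` with `pcol_le/pdcol_le/pmix_le`, `covDeriv_propagatorK_eq_sum_pieces`, `propagatorK_apply_eq_sum_pieces`,
`block_avg_majorant_le`, `bump_shift_le(')`, `norm_fOne_apply_le_of_abs_le`), p35's `B3Op116LeibnizRows` (THEOREM A′ `inv_smul_sum_srcDM_eq`,
A″ `sum_srcMD_eq`, `nMul`, `norm_nMul_apply_le`, `reg_neg`, `norm_fOne_neg_apply_le`) and `B3Op116MajorantStep.maj`, r14's
`B3Op116SourceForm` (THEOREM A `opV_apply_eq_srcV`, `map_srcV`, `srcMD/srcDM/srcMM/avgSrc/srcV`, `covDerivAt`, `norm_mapE_single_le`,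
`norm_mapE_dip_le`, `norm_mapE_srcMM_le`, `inner_propagatorK_dip_apply`), `B3Op116KernelRegularTorus` (`dcol_le`, `norm_mapE_avgSrc_le_block`,
`norm_covDeriv_le_add_split`, `majorant_mono`), `B3Ineq210RegularRegion` (`pieceR`, `regRegionKernels`), `B3Op116ScaleChains` (`mesh_rpow_add`),
`B3Eq116TwoSidedExpansion.eq344_model`, p33's `B3Op116MajorantConvolution` (`sum_kernel_mul_le`, `sum_bond_kernel_mul_le`, `bump_mono_rate`) and
`B3Ineq210MixedRegularRegion.mixedTermR`, p40's `B3Op116Pieces` (`fOne`, `U_apply_eq_add_smul_fOne`, `norm_U_apply`) and `B3Ineq210MixedRegularTorus`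
(`dip`, `onb`, `norm_covDeriv_apply_single_le`), r15's carrier predicate `B3Sect2StatementsPart2.ScaledKernels.Ineq210`, the typer's `B1.aSeq_pos/aSeq_le`.

## What is printed

[B3] p. 414 [PDF 4] (verbatim): *"for n, n′ sufficiently large, a kernel of the operator (1.16) is a sufficiently regular function of
both variables. More exactly the Hölder norms of the covariant derivatives of this kernel, the norms defined for example in the
inequalities (I.2.24) and (I.2.25) of Proposition I.2.1, are exponentially decaying with the distance of the arguments and are uniformly
bounded by O(1)(e(L^kε)^{1−α})^{n+n′}, where α > 0 but can be arbitrarily small. This estimate follows easily from the properties of the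
propagators G_k(Ω, A) proved in the next paper."*  [B3] p. 424 [PDF 14], (2.6): `G^η_k(B̃) = Σ_{j=0}^{k−1}G^η_{(j)}(B̃)`; p. 426 [PDF 16],
(2.10) (verbatim): *"For the propagators G^η_{(j)} we apply the inequality |G^η_{(j)}(Ω, B̃; x, x′)| ≤ O(1)(L^jη)^{−d+2}e^{−δ₁(L^jη)^{−1}|x−x′|},
(2.10) and if the propagator is differentiated, then for each differentiation, there is an additional factor (L^jη)^{−1} on the right
side."*  [B1] p. 615 [PDF 13], (3.16): the expansion of the covariant Laplacian with the bracket `V_k` (`F_{1,k}(A)^*D^η_B + D^{η*}_BF_{1,k}(A) + …`,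
r14's THEOREM A); p. 619 [PDF 17], (3.44): `G_k(Ω,A+B) = G_k(Ω,B) + G_k(Ω,B)V_kG_k(Ω,A+B)`.  The mixed (dipole–dipole) entry of the
(1.32)/(2.5) norm of (1.16) is part of what the print calls "follows easily"; this file supplies the one step of it that is NOT plain (2.10)
bookkeeping.

## What this file proves, and how

§1 the sources of THEOREM A are additive in the field (`map_srcV_univ`: `T(V_kw)` for `w = Σ_j w_j` separates into the four source kinds).
§2 **ONE PAIR OF SCALES** `(j₁, j₂)` = (scale of the field piece `w_{j₁}`, scale of the row piece `Φ_{j₂} = D^ε_B(·)(b₀)∘G^η_{(j₂)}(T_ε,B)`):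
four bounds — `md_direct_le` (the `M^*D` source directly: `Φ_{j₂}`'s differentiated column, exponent 1, against `D^ε_Bw_{j₁}`, exponent
`a_w − 1`), `md_parts_le` (the same source through p35's A″: `Φ_{j₂}`'s differentiated column against the `F₁`-difference `ε⁻¹|e|δ_A‖w_{j₁}‖` and
`Φ_{j₂}`'s TWICE-differentiated kernel, exponent 0, against `|e|s‖w_{j₁}‖`, exponent `a_w`), `dm_direct_le`, `dm_parts_le` (mirror, A′) — each a
single two-scale bump `(L^{j₂}ε)^{e₂}(L^{j₁}ε)^{e₁}((L^{max}ε)^d)^{−1}e^{−(δ₁/2)|b₀₋−x′|/L^{max}}` by the engine's `pair_bond_le`.  §3 **THE ORDER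
DECIDES** (`md_sum_le`, `dm_sum_le`): for `j₂ ≤ j₁` the exponent-0 kernel sits on the COARSER piece and the pair is used directly, for
`j₁ < j₂` the Leibniz form moves the second derivative onto the (coarser) row piece; the finer index is summed geometrically
(`sum_sq_le_of_cases`, `sum_lower_pair_le`): no logarithm of the number of scales.  §4 the `M^*M` and averaging sources through r14's totals
(`mm_le`, `avg_le`; `block_avg_majorant_le`).  §5 exponent/rate conversions.  §6 **THE ROW THEOREM `phi_row_srcV_le`**: for every field
`w = Σ_{j<k}w_j` with `‖w_j(y)‖ ≤ c_w(L^jε)^{a_w−d}e_j(y,x′)`, `‖D^ε_Bw_j(b)‖ ≤ c_w′(L^jε)^{a_w−1−d}e_j(b₋,x′)` (`a_w > 0`),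
`‖(D^ε_BG_k(T_ε,B)V_k(A,B)w)(b₀)‖ ≤ (|e|s·seedK1 + L^k|e|δ_A·seedK2)·Σ_{j<k}(L^jε)^{a_w−d}exp(−(δ₁/(4L))(L^jε)^{−1}ε|b₀₋−x′|)` with the explicit
constants `seedK1`, `seedK2` (§6.1 does the real-number bookkeeping in four lemmas).  §7 **THE INSTANCES**: `W = G_BV_kG_{A+B}` (`eq344_model` +
THEOREM A), the pieces of `w = G_{A+B}dip^B_{b′}Y` obey the hypotheses with `a_w = 1` (`norm_pieceR_dipB_le`: piece symmetry + the split
`D^ε_B = D^ε_{A+B} − M`; `norm_covDeriv_pieceR_dipB_le`: `dip^B = dip^{A+B} + δ_{b′₊}v`, `‖v‖ ≤ ε|e|s‖Y‖`, p33's mixed (2.10) for the piece in its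
own background), hence **`mixed_seed_le`** (the row side), **`deriv_W_single_le`** (`W` on a point source, `a_w = 2`), **`value_W_dip_le`** (the
value of `W` on the dipole, by the symmetry of `W`: `norm_W_dip_apply_le`), and **`mixed_seed_state`**: `φ = Wdip^B_{b′}Y` satisfies
`‖φ(x)‖ ≤ 𝔪_k(cv₀,2;δ₁/(4L))(x,b′₋)`, `‖D^ε_Bφ(b₀)‖ ≤ 𝔪_k(cd₀,1;δ₁/(4L))(b₀₋,b′₋)` — p35's state `J = 0` with explicit `cv₀, cd₀ = O(ε^{d+1}‖Y‖)·(|e|s + L^k|e|δ_A)`.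

## Honest scope

Torus `Ω = T_ε` only (THEOREM A′/A″ are torus identities); the (2.10) bounds of `G_k(T_ε,B)` and `G_k(T_ε,A+B)` and the twice-differentiated
(2.10) of their pieces are HYPOTHESES in r15's shape `Ineq210 δ₁ C` on r14's torus carrier and in the shape of the conclusion of p33's
`ineq210_mixed_regularRegion_univ` with a constant `C_M` (discharged on `T_ε` by r14's `ineq210_regularRegion_univ_small` and p33's theorem for
small regular backgrounds — not re-proved here); `A` small (`|A_b| ≤ s`) and (I.2.23)-regular (`|A_{⟨z+εe_ν,μ⟩} − A_{⟨z,μ⟩}| ≤ δ_A`), `(L^kε)|e|s ≤ 1`,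
`m² > 0`, `a > 0`, `1 ≤ k ≤ K`, `0 < δ₁ ≤ 1`; every `d ≥ 1`, `L ≥ 2`, `N`.  Constants explicit but not optimized (rate `δ₁/(4L)`; `seedK1/seedK2`
polynomial in `d`, `N(8d/δ₁)^d`, `L^{a_w}/(L^{a_w}−1)`, `C`, `C_M`, `a`); the factor `#Ix = N`-many components in `value_W_dip_le` is crude.  Nothing of
(1.16) for general `(n,n′)`, no Hölder quotient, no region other than the torus, no statement about print's `α`: those are p35's 4β/4γ and
p40's FILE 5(b).  Four concrete `def`s (`kC`, `gE`, `seedK1`, `seedK2`: real constants); no `def … : Prop`, no new named fact; no `sorry`;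
axioms standard.  Value = the located non-bookkeeping step of a by-reference estimate of B3, NOT summit progress.
-/


noncomputable section

open scoped BigOperators InnerProductSpace

namespace Literature.MathematicalPhysics.QuantumFieldTheory.Balaban1983to89.B3Op116MixedSeed

open HiggsLattice (ChargeData ScalarField siteInner covDeriv)
open HiggsCovariance (propagatorK E)
open B1Eq230FluctCov (Ix cb)
open B1Ineq234Concrete (nCol)
open B1Ineq234LevelZero (tdist_comm)
open B3Ineq210RegularRegion (regRegionKernels Interior sum_pieceR scaleR_eq interior_univ pieceR)
open B3Op116Pieces (mulM fOne norm_U_apply)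
open B3Op116ScaleChains (rate_eq mesh_rpow_add)
open B3Op116MajorantConvolution (majorant_nonneg majorant_rate_mono bump_mono_rate bump_mono_scale sum_kernel_mul_le
  sum_bond_kernel_mul_le)
open B3Op116SourceForm (mulMT srcMD srcDM srcMM avgSrc srcV covDerivAt covDerivAt_apply norm_mapE_srcMD_le norm_mapE_srcDM_le
  norm_mapE_srcMM_le norm_mapE_single_le norm_mapE_dip_le map_srcV)
open B3Op116KernelRegularTorus (col dcol col_le dcol_le dcol_nonneg majorant_shift_le majorant_shift_le' majorant_mono top_bump_le_majorant_succ
  norm_mapE_avgSrc_le_block)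
open B3Op116OrderedPairs
open HiggsCovariancePos (Inside sum_site_dir)
open B3Ineq210MixedRegularTorus (dip onb)
open HiggsAveraging (blockIter blockK)

variable {P : HiggsLattice.Params} {N : ℕ}

/-! ## §1 The sources of THEOREM A are linear in the field; the row functional `Φ_j = D^ε_B(·)(b₀) ∘ G^η_{(j)}(T_ε,B)` -/

section Linear

variable (C : ChargeData N) (A B : HiggsLattice.VecField P 0)

/-- A one-site field `δ_y v` depends additively on its value `v`. [cite: Balaban1982Higgs1, (1.5) p.604] -/
theorem single_sum {ι : Type*} (s : Finset ι) (y : HiggsLattice.Site P 0) (v : ι → E N) :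
    (Pi.single y (∑ i ∈ s, v i) : ScalarField P 0 N) = ∑ i ∈ s, (Pi.single y (v i) : ScalarField P 0 N) := by
  classical
  induction s using Finset.induction_on with
  | empty => simp
  | insert i s hi ih => rw [Finset.sum_insert hi, Finset.sum_insert hi, Pi.single_add, ih]

/-- The dipole depends additively on its charge (p40's `dip_add`). [cite: Balaban1982Higgs1, (1.7) p.605] -/
theorem dip_sum {ι : Type*} (s : Finset ι) (b : HiggsLattice.PBond P 0) (v : ι → E N) :
    dip C B b (∑ i ∈ s, v i) = ∑ i ∈ s, dip C B b (v i) := by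
  classical
  induction s using Finset.induction_on with
  | empty => simp [B3Ineq210MixedRegularTorus.dip_zero]
  | insert i s hi ih => rw [Finset.sum_insert hi, Finset.sum_insert hi, B3Ineq210MixedRegularTorus.dip_add, ih]

/-- `srcMD_b` is additive in the field. [cite: Balaban1982Higgs1, (3.16) p.615] -/
theorem srcMD_sum {ι : Type*} (s : Finset ι) (w : ι → ScalarField P 0 N) (b : HiggsLattice.PBond P 0) :
    srcMD C A B b (∑ i ∈ s, w i) = ∑ i ∈ s, srcMD C A B b (w i) := by
  unfold srcMD
  rw [B3Ineq210RegularTorus.covDeriv_sum'', map_sum, single_sum]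

/-- `srcDM_b` is additive in the field. [cite: Balaban1982Higgs1, (3.16) p.615] -/
theorem srcDM_sum {ι : Type*} (s : Finset ι) (w : ι → ScalarField P 0 N) (b : HiggsLattice.PBond P 0) :
    srcDM C A B b (∑ i ∈ s, w i) = ∑ i ∈ s, srcDM C A B b (w i) := by
  unfold srcDM
  rw [Finset.sum_apply, map_sum, dip_sum]

/-- `srcMM_b` is additive in the field. [cite: Balaban1982Higgs1, (3.16) p.615] -/
theorem srcMM_sum {ι : Type*} (s : Finset ι) (w : ι → ScalarField P 0 N) (b : HiggsLattice.PBond P 0) :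
    srcMM C A B b (∑ i ∈ s, w i) = ∑ i ∈ s, srcMM C A B b (w i) := by
  unfold srcMM
  rw [Finset.sum_apply, map_sum, map_sum, single_sum]

/-- On the full torus every bond is inside. [cite: Balaban1982Higgs1, (2.17) p.610] -/
theorem inside_univ (b : HiggsLattice.PBond P 0) : Inside (Finset.univ : Finset (HiggsLattice.Site P 0)) b :=
  ⟨Finset.mem_univ _, Finset.mem_univ _⟩

variable (k : ℕ) (a : ℝ)

/-- **THEOREM A on the torus through a linear map, the three bond sources separated and summed**:
`Φ(V_kw) = −[Φ(Σ_b srcMD_b w) + Φ(ε⁻¹Σ_b srcDM_b w) + Σ_bΦ(srcMM_b w)] − a_k(L^kε)^{−2}Φ(avgSrc w)` (r14's `map_srcV`, every bond inside).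
[cite: Balaban1982Higgs1, (3.16) p.615] [cite: Balaban1983Higgs3, (1.16) p.414] -/
theorem map_srcV_univ {M' : Type*} [AddCommGroup M'] [Module ℝ M'] (T : ScalarField P 0 N →ₗ[ℝ] M') (w : ScalarField P 0 N) :
    T (srcV C A B k Finset.univ a w)
      = -(T (∑ b : HiggsLattice.PBond P 0, srcMD C A B b w) + T ((P.mesh 0)⁻¹ • ∑ b : HiggsLattice.PBond P 0, srcDM C A B b w)
          + ∑ b : HiggsLattice.PBond P 0, T (srcMM C A B b w))
        - (B1.aSeq a P.L k * ((P.mesh k)⁻¹ ^ 2)) • T (avgSrc C A B k w) := by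
  rw [map_srcV]
  congr 2
  rw [map_sum, map_smul, map_sum, Finset.smul_sum, ← Finset.sum_add_distrib, ← Finset.sum_add_distrib]
  refine Finset.sum_congr rfl fun b _ => ?_
  rw [if_pos (inside_univ b)]

end Linear

/-! ## §2 ONE PAIR OF SCALES: the `M^*D` and `D^*M` sources of a scale-`j₁` field through the row functional of the scale-`j₂` piece,
directly and in Leibniz form (four bounds, valid for every pair; the ORDER of the scales decides which one is summable) -/

section Pairs

variable {C : ChargeData N} {A B : HiggsLattice.VecField P 0} {msq a : ℝ} {k K₀ : ℕ} {hL1 : 1 < P.L} {δ₁ Cst CM s δA : ℝ}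

/-- The row functional of a piece on a one-site source / a dipole, unfolded. [cite: Balaban1983Higgs3, (2.6) p.424] -/
theorem phi_apply (b₀ : HiggsLattice.PBond P 0) (j : ℕ) (f : ScalarField P 0 N) :
    (covDerivAt C B b₀ ∘ₗ pieceR C Finset.univ B msq a k j) f = covDeriv C B (pieceR C Finset.univ B msq a k j f) b₀ := rfl

/-- **PAIR BOUND 1 — the `M^*D` source, directly** (the piece `j₂` once differentiated, exponent `1`; the field's derivative, exponent `a_w − 1`):
`‖(D^ε_BG^η_{(j₂)}Σ_b srcMD_b u)(b₀)‖ ≤ d·[e·ε^dC·|e|s·c_u′·K]·(L^{j₂}ε)^1(L^{j₁}ε)^{a_w−1}((L^{max}ε)^d)^{−1}e^{−(δ₁/2)|b₀₋−x′|/L^{max}}` — summable over `j₂ ≤ j₁`.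
[cite: Balaban1983Higgs3, (1.16) p.414, (2.6) p.424, (2.10) p.426] [cite: Balaban1982Higgs1, (3.16) p.615] -/
theorem md_direct_le (hδ₁ : 0 < δ₁) (hδ₁1 : δ₁ ≤ 1) (hCst : 0 ≤ Cst) (hs : 0 ≤ s)
    (h210B : (regRegionKernels hL1 C Finset.univ B msq a k K₀).Ineq210 δ₁ Cst)
    (hA : ∀ b : HiggsLattice.PBond P 0, |A b| ≤ s) (i₀ : Ix N) (b₀ : HiggsLattice.PBond P 0) (x' : HiggsLattice.Site P 0)
    (j₁ j₂ : ℕ) (u : ScalarField P 0 N) {aw cu' : ℝ} (hcu' : 0 ≤ cu')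
    (hud : ∀ b : HiggsLattice.PBond P 0, ‖covDeriv C B u b‖ ≤ cu' * P.mesh j₁ ^ (aw - 1 - (P.d : ℝ)) *
      Real.exp (-(δ₁ * (P.mesh j₁)⁻¹ * (P.mesh 0 * (HiggsLattice.Site.tdist b.src x' : ℝ))))) :
    ‖covDeriv C B (pieceR C Finset.univ B msq a k j₂ (∑ b : HiggsLattice.PBond P 0, srcMD C A B b u)) b₀‖
      ≤ (P.d : ℝ) * ((Real.exp 1 * (P.mesh 0 ^ P.d * Cst)) * (|C.e| * s * cu') *
            ((nCol N : ℝ) * (8 * P.d / δ₁) ^ P.d * (P.mesh 0 ^ P.d)⁻¹)) *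
          (P.mesh j₂ ^ (1 : ℝ) * P.mesh j₁ ^ (aw - 1) * (P.mesh (max j₂ j₁) ^ P.d)⁻¹) *
          Real.exp (-(δ₁ / 2 * (P.mesh (max j₂ j₁))⁻¹ * (P.mesh 0 * (HiggsLattice.Site.tdist b₀.src x' : ℝ)))) := by
  have hes : 0 ≤ |C.e| * s := mul_nonneg (abs_nonneg _) hs
  have hc : 0 ≤ P.mesh 0 ^ P.d * Cst := mul_nonneg (pow_nonneg (P.mesh_pos 0).le _) hCst
  -- separate the bonds
  have step1 : ‖covDeriv C B (pieceR C Finset.univ B msq a k j₂ (∑ b : HiggsLattice.PBond P 0, srcMD C A B b u)) b₀‖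
      ≤ ∑ b : HiggsLattice.PBond P 0, pdcol C msq a k j₂ B B b₀ b.tgt * (|C.e| * s * ‖covDeriv C B u b‖) := by
    rw [map_sum, B3Ineq210RegularTorus.covDeriv_sum'']
    refine (norm_sum_le _ _).trans (Finset.sum_le_sum fun b _ => ?_)
    have h := norm_mapE_srcMD_le C A B (covDerivAt C B b₀ ∘ₗ pieceR C Finset.univ B msq a k j₂) (hA b) u
    simp only [phi_apply] at h
    refine h.trans (le_of_eq ?_)
    rw [pdcol]; ring
  refine step1.trans ?_
  refine pair_bond_le hδ₁ hδ₁1 j₂ j₁ (mul_nonneg (Real.exp_nonneg _) hc) (mul_nonneg hes hcu') i₀ b₀.src x'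
    (fun b => pdcol C msq a k j₂ B B b₀ b.tgt) (fun b => |C.e| * s * ‖covDeriv C B u b‖)
    (fun b => pdcol_nonneg _ _ _ _) (fun b => mul_nonneg hes (norm_nonneg _)) (fun b => ?_) (fun b => ?_)
  · -- the differentiated column of the piece, shifted from `b₊` to `b₋`
    refine (pdcol_le h210B b₀ b.tgt).trans ?_
    have hsh := bump_shift_le hδ₁.le hδ₁1 j₂ b₀.src b.src b.dir
    have hm : 0 ≤ (P.mesh 0 ^ P.d * Cst) * P.mesh j₂ ^ ((1 : ℝ) - (P.d : ℝ)) := mul_nonneg hc (Real.rpow_nonneg (P.mesh_pos _).le _)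
    calc (P.mesh 0 ^ P.d * Cst) * P.mesh j₂ ^ ((1 : ℝ) - (P.d : ℝ)) *
          Real.exp (-(δ₁ * (P.mesh j₂)⁻¹ * (P.mesh 0 * (HiggsLattice.Site.tdist b₀.src b.tgt : ℝ))))
        ≤ (P.mesh 0 ^ P.d * Cst) * P.mesh j₂ ^ ((1 : ℝ) - (P.d : ℝ)) *
          (Real.exp 1 * Real.exp (-(δ₁ * (P.mesh j₂)⁻¹ * (P.mesh 0 * (HiggsLattice.Site.tdist b₀.src b.src : ℝ))))) :=
          mul_le_mul_of_nonneg_left hsh hm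
      _ = _ := by ring
  · exact (mul_le_mul_of_nonneg_left (hud b) hes).trans (le_of_eq (by ring))

/-- **PAIR BOUND 2 — the `M^*D` source in Leibniz form** (THEOREM A″: the field's VALUE, exponent `a_w`, against the piece's differentiated
column with the `N`-term `ε⁻¹|e|δ_A`, and against the piece's TWICE-DIFFERENTIATED kernel, exponent `0`, with `|e|s`):
`‖(D^ε_BG^η_{(j₂)}Σ_b srcMD_b u)(b₀)‖ ≤ d·K·[(ε^dC)(ε⁻¹|e|δ_Ac_u)(L^{j₂}ε)^1 + (ε^dC_M)(|e|sc_u)(L^{j₂}ε)^0](L^{j₁}ε)^{a_w}((L^{max}ε)^d)^{−1}e^{−(δ₁/2)|b₀₋−x′|/L^{max}}`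
— summable over `j₁ ≤ j₂`. [cite: Balaban1983Higgs3, (1.16) p.414, (2.6) p.424, (2.10) p.426] [cite: Balaban1982Higgs1, (2.23) p.610, (3.16) p.615] -/
theorem md_parts_le (hδ₁ : 0 < δ₁) (hδ₁1 : δ₁ ≤ 1) (hCst : 0 ≤ Cst) (hCM : 0 ≤ CM) (hs : 0 ≤ s) (hδA : 0 ≤ δA)
    (h210B : (regRegionKernels hL1 C Finset.univ B msq a k K₀).Ineq210 δ₁ Cst)
    (hmixB : ∀ (j : ℕ) (μ ν : Fin P.d) (x x' : HiggsLattice.Site P 0),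
      B3Ineq210MixedRegularRegion.mixedTermR C Finset.univ B msq a k j μ ν x x'
        ≤ CM * (P.mesh j ^ P.d)⁻¹ * Real.exp (-(δ₁ * ((HiggsLattice.Site.tdist x x' : ℝ) / (P.L : ℝ) ^ j))))
    (hA : ∀ b : HiggsLattice.PBond P 0, |A b| ≤ s)
    (hreg : ∀ (z : HiggsLattice.Site P 0) (μ ν : Fin P.d), |A ⟨z.shift ν, μ⟩ - A ⟨z, μ⟩| ≤ δA)
    (i₀ : Ix N) (b₀ : HiggsLattice.PBond P 0) (x' : HiggsLattice.Site P 0) (j₁ j₂ : ℕ) (u : ScalarField P 0 N) {aw cu : ℝ} (hcu : 0 ≤ cu)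
    (huv : ∀ y : HiggsLattice.Site P 0, ‖u y‖ ≤ cu * P.mesh j₁ ^ (aw - (P.d : ℝ)) *
      Real.exp (-(δ₁ * (P.mesh j₁)⁻¹ * (P.mesh 0 * (HiggsLattice.Site.tdist y x' : ℝ))))) :
    ‖covDeriv C B (pieceR C Finset.univ B msq a k j₂ (∑ b : HiggsLattice.PBond P 0, srcMD C A B b u)) b₀‖
      ≤ (P.d : ℝ) * ((P.mesh 0 ^ P.d * Cst) * ((P.mesh 0)⁻¹ * (|C.e| * δA) * cu) *
            ((nCol N : ℝ) * (8 * P.d / δ₁) ^ P.d * (P.mesh 0 ^ P.d)⁻¹)) *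
          (P.mesh j₂ ^ (1 : ℝ) * P.mesh j₁ ^ aw * (P.mesh (max j₂ j₁) ^ P.d)⁻¹) *
          Real.exp (-(δ₁ / 2 * (P.mesh (max j₂ j₁))⁻¹ * (P.mesh 0 * (HiggsLattice.Site.tdist b₀.src x' : ℝ))))
        + (P.d : ℝ) * ((P.mesh 0 ^ P.d * CM) * (|C.e| * s * cu) *
            ((nCol N : ℝ) * (8 * P.d / δ₁) ^ P.d * (P.mesh 0 ^ P.d)⁻¹)) *
          (P.mesh j₂ ^ (0 : ℝ) * P.mesh j₁ ^ aw * (P.mesh (max j₂ j₁) ^ P.d)⁻¹) *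
          Real.exp (-(δ₁ / 2 * (P.mesh (max j₂ j₁))⁻¹ * (P.mesh 0 * (HiggsLattice.Site.tdist b₀.src x' : ℝ)))) := by
  have hε := P.mesh_pos 0
  have hes : 0 ≤ |C.e| * s := mul_nonneg (abs_nonneg _) hs
  have hN : 0 ≤ (P.mesh 0)⁻¹ * (|C.e| * δA) := mul_nonneg (inv_nonneg.mpr hε.le) (mul_nonneg (abs_nonneg _) hδA)
  have hc : 0 ≤ P.mesh 0 ^ P.d * Cst := mul_nonneg (pow_nonneg hε.le _) hCst
  have hcM : 0 ≤ P.mesh 0 ^ P.d * CM := mul_nonneg (pow_nonneg hε.le _) hCM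
  -- THEOREM A″ and the two resulting bond sums
  have step1 : ‖covDeriv C B (pieceR C Finset.univ B msq a k j₂ (∑ b : HiggsLattice.PBond P 0, srcMD C A B b u)) b₀‖
      ≤ (∑ b : HiggsLattice.PBond P 0, pdcol C msq a k j₂ B B b₀ b.src * ((P.mesh 0)⁻¹ * (|C.e| * δA) * ‖u b.src‖))
        + ∑ b : HiggsLattice.PBond P 0, pmix C msq a k j₂ B B b₀ b * (|C.e| * s * ‖u b.src‖) := by
    rw [← phi_apply, B3Op116LeibnizRows.sum_srcMD_eq, map_add, map_neg, map_smul, map_sum, map_sum, Finset.smul_sum]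
    simp only [phi_apply]
    refine (norm_add_le _ _).trans ?_
    rw [norm_neg, add_comm]
    refine add_le_add ?_ ?_
    · refine (norm_sum_le _ _).trans (Finset.sum_le_sum fun b _ => ?_)
      have h := norm_mapE_single_le (covDerivAt C B b₀ ∘ₗ pieceR C Finset.univ B msq a k j₂) b.src
        (B3Op116LeibnizRows.nMul C (-A) b (u b.src))
      simp only [phi_apply] at h
      refine h.trans ?_
      rw [← pdcol, mul_comm]
      exact mul_le_mul_of_nonneg_left
        (B3Op116LeibnizRows.norm_nMul_apply_le C (-A) (B3Op116LeibnizRows.reg_neg A hreg) b _) (pdcol_nonneg _ _ _ _)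
    · refine (norm_sum_le _ _).trans (Finset.sum_le_sum fun b _ => ?_)
      rw [norm_smul, Real.norm_eq_abs, abs_of_pos (inv_pos.mpr hε)]
      have h := norm_mapE_dip_le C B (covDerivAt C B b₀ ∘ₗ pieceR C Finset.univ B msq a k j₂) b
        (fOne C (P.mesh 0) (-(A b)) (u b.src))
      simp only [phi_apply] at h
      calc (P.mesh 0)⁻¹ * ‖covDeriv C B (pieceR C Finset.univ B msq a k j₂ (dip C B b (fOne C (P.mesh 0) (-(A b)) (u b.src)))) b₀‖
          ≤ (P.mesh 0)⁻¹ * (‖fOne C (P.mesh 0) (-(A b)) (u b.src)‖ *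
              ∑ i : Ix N, ‖covDeriv C B (pieceR C Finset.univ B msq a k j₂ (dip C B b (onb N i))) b₀‖) :=
            mul_le_mul_of_nonneg_left h (inv_nonneg.mpr hε.le)
        _ = pmix C msq a k j₂ B B b₀ b * ‖fOne C (P.mesh 0) (-(A b)) (u b.src)‖ := by rw [pmix]; ring
        _ ≤ pmix C msq a k j₂ B B b₀ b * (|C.e| * s * ‖u b.src‖) :=
            mul_le_mul_of_nonneg_left (B3Op116LeibnizRows.norm_fOne_neg_apply_le C A (hA b) _) (pmix_nonneg _ _ _ _)
  refine step1.trans (add_le_add ?_ ?_)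
  · refine pair_bond_le hδ₁ hδ₁1 j₂ j₁ hc (mul_nonneg hN hcu) i₀ b₀.src x' _ _ (fun b => pdcol_nonneg _ _ _ _)
      (fun b => mul_nonneg hN (norm_nonneg _)) (fun b => pdcol_le h210B b₀ b.src) (fun b => ?_)
    exact (mul_le_mul_of_nonneg_left (huv b.src) hN).trans (le_of_eq (by ring))
  · refine pair_bond_le hδ₁ hδ₁1 j₂ j₁ hcM (mul_nonneg hes hcu) i₀ b₀.src x' _ _ (fun b => pmix_nonneg _ _ _ _)
      (fun b => mul_nonneg hes (norm_nonneg _)) (fun b => pmix_le hmixB b₀ b) (fun b => ?_)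
    exact (mul_le_mul_of_nonneg_left (huv b.src) hes).trans (le_of_eq (by ring))

/-- **PAIR BOUND 3 — the `D^*M` source, directly** (the piece's twice-differentiated kernel, exponent `0`; the field's VALUE at `b₊`, exponent
`a_w`): `‖(D^ε_BG^η_{(j₂)}ε⁻¹Σ_b srcDM_b u)(b₀)‖ ≤ d·[(ε^dC_M)(e|e|sc_u)K]·(L^{j₂}ε)^0(L^{j₁}ε)^{a_w}((L^{max}ε)^d)^{−1}e^{−(δ₁/2)|b₀₋−x′|/L^{max}}` —
summable over `j₁ ≤ j₂`. [cite: Balaban1983Higgs3, (1.16) p.414, (2.6) p.424, (2.10) p.426] [cite: Balaban1982Higgs1, (3.16) p.615] -/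
theorem dm_direct_le (hδ₁ : 0 < δ₁) (hδ₁1 : δ₁ ≤ 1) (hCM : 0 ≤ CM) (hs : 0 ≤ s)
    (hmixB : ∀ (j : ℕ) (μ ν : Fin P.d) (x x' : HiggsLattice.Site P 0),
      B3Ineq210MixedRegularRegion.mixedTermR C Finset.univ B msq a k j μ ν x x'
        ≤ CM * (P.mesh j ^ P.d)⁻¹ * Real.exp (-(δ₁ * ((HiggsLattice.Site.tdist x x' : ℝ) / (P.L : ℝ) ^ j))))
    (hA : ∀ b : HiggsLattice.PBond P 0, |A b| ≤ s) (i₀ : Ix N) (b₀ : HiggsLattice.PBond P 0) (x' : HiggsLattice.Site P 0)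
    (j₁ j₂ : ℕ) (u : ScalarField P 0 N) {aw cu : ℝ} (hcu : 0 ≤ cu)
    (huv : ∀ y : HiggsLattice.Site P 0, ‖u y‖ ≤ cu * P.mesh j₁ ^ (aw - (P.d : ℝ)) *
      Real.exp (-(δ₁ * (P.mesh j₁)⁻¹ * (P.mesh 0 * (HiggsLattice.Site.tdist y x' : ℝ))))) :
    ‖covDeriv C B (pieceR C Finset.univ B msq a k j₂ ((P.mesh 0)⁻¹ • ∑ b : HiggsLattice.PBond P 0, srcDM C A B b u)) b₀‖
      ≤ (P.d : ℝ) * ((P.mesh 0 ^ P.d * CM) * (Real.exp 1 * (|C.e| * s * cu)) *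
            ((nCol N : ℝ) * (8 * P.d / δ₁) ^ P.d * (P.mesh 0 ^ P.d)⁻¹)) *
          (P.mesh j₂ ^ (0 : ℝ) * P.mesh j₁ ^ aw * (P.mesh (max j₂ j₁) ^ P.d)⁻¹) *
          Real.exp (-(δ₁ / 2 * (P.mesh (max j₂ j₁))⁻¹ * (P.mesh 0 * (HiggsLattice.Site.tdist b₀.src x' : ℝ)))) := by
  have hε := P.mesh_pos 0
  have hes : 0 ≤ |C.e| * s := mul_nonneg (abs_nonneg _) hs
  have hcM : 0 ≤ P.mesh 0 ^ P.d * CM := mul_nonneg (pow_nonneg hε.le _) hCM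
  have step1 : ‖covDeriv C B (pieceR C Finset.univ B msq a k j₂ ((P.mesh 0)⁻¹ • ∑ b : HiggsLattice.PBond P 0, srcDM C A B b u)) b₀‖
      ≤ ∑ b : HiggsLattice.PBond P 0, pmix C msq a k j₂ B B b₀ b * (|C.e| * s * ‖u b.tgt‖) := by
    rw [map_smul, B3Ineq210RegularTorus.covDeriv_smul'', map_sum, B3Ineq210RegularTorus.covDeriv_sum'', norm_smul, Real.norm_eq_abs,
      abs_of_pos (inv_pos.mpr hε)]
    refine (mul_le_mul_of_nonneg_left (norm_sum_le _ _) (inv_nonneg.mpr hε.le)).trans ?_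
    rw [Finset.mul_sum]
    refine Finset.sum_le_sum fun b _ => ?_
    have h := norm_mapE_srcDM_le C A B (covDerivAt C B b₀ ∘ₗ pieceR C Finset.univ B msq a k j₂) (hA b) u
    simp only [phi_apply] at h
    refine (mul_le_mul_of_nonneg_left h (inv_nonneg.mpr hε.le)).trans (le_of_eq ?_)
    rw [pmix]; ring
  refine step1.trans ?_
  refine pair_bond_le hδ₁ hδ₁1 j₂ j₁ hcM (mul_nonneg (Real.exp_nonneg _) (mul_nonneg hes hcu)) i₀ b₀.src x' _ _
    (fun b => pmix_nonneg _ _ _ _) (fun b => mul_nonneg hes (norm_nonneg _)) (fun b => pmix_le hmixB b₀ b) (fun b => ?_)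
  have hsh := bump_shift_le' hδ₁.le hδ₁1 j₁ b.src x' b.dir
  have hm : 0 ≤ |C.e| * s * (cu * P.mesh j₁ ^ (aw - (P.d : ℝ))) := mul_nonneg hes (mul_nonneg hcu (Real.rpow_nonneg (P.mesh_pos _).le _))
  calc |C.e| * s * ‖u b.tgt‖
      ≤ |C.e| * s * (cu * P.mesh j₁ ^ (aw - (P.d : ℝ)) *
          Real.exp (-(δ₁ * (P.mesh j₁)⁻¹ * (P.mesh 0 * (HiggsLattice.Site.tdist (b.src.shift b.dir) x' : ℝ))))) :=
        mul_le_mul_of_nonneg_left (huv b.tgt) hes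
    _ ≤ |C.e| * s * (cu * P.mesh j₁ ^ (aw - (P.d : ℝ))) *
          (Real.exp 1 * Real.exp (-(δ₁ * (P.mesh j₁)⁻¹ * (P.mesh 0 * (HiggsLattice.Site.tdist b.src x' : ℝ))))) := by
        rw [← mul_assoc]; exact mul_le_mul_of_nonneg_left hsh hm
    _ = _ := by ring

/-- **PAIR BOUND 4 — the `D^*M` source in Leibniz form** (THEOREM A′: the field's value with the `N`-term `ε⁻¹|e|δ_A`, and the field's
derivative, exponent `a_w − 1`, with `|e|s`, both against the piece's differentiated column, exponent `1`):
`‖(D^ε_BG^η_{(j₂)}ε⁻¹Σ_b srcDM_b u)(b₀)‖ ≤ d·K·(ε^dC)(L^{j₂}ε)^1[(ε⁻¹|e|δ_Ac_u)(L^{j₁}ε)^{a_w} + (|e|sc_u′)(L^{j₁}ε)^{a_w−1}]((L^{max}ε)^d)^{−1}e^{−(δ₁/2)|b₀₋−x′|/L^{max}}`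
— summable over `j₂ ≤ j₁`. [cite: Balaban1983Higgs3, (1.16) p.414, (2.6) p.424, (2.10) p.426] [cite: Balaban1982Higgs1, (2.23) p.610, (3.16) p.615] -/
theorem dm_parts_le (hδ₁ : 0 < δ₁) (hδ₁1 : δ₁ ≤ 1) (hCst : 0 ≤ Cst) (hs : 0 ≤ s) (hδA : 0 ≤ δA)
    (h210B : (regRegionKernels hL1 C Finset.univ B msq a k K₀).Ineq210 δ₁ Cst)
    (hA : ∀ b : HiggsLattice.PBond P 0, |A b| ≤ s)
    (hreg : ∀ (z : HiggsLattice.Site P 0) (μ ν : Fin P.d), |A ⟨z.shift ν, μ⟩ - A ⟨z, μ⟩| ≤ δA)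
    (i₀ : Ix N) (b₀ : HiggsLattice.PBond P 0) (x' : HiggsLattice.Site P 0) (j₁ j₂ : ℕ) (u : ScalarField P 0 N) {aw cu cu' : ℝ}
    (hcu : 0 ≤ cu) (hcu' : 0 ≤ cu')
    (huv : ∀ y : HiggsLattice.Site P 0, ‖u y‖ ≤ cu * P.mesh j₁ ^ (aw - (P.d : ℝ)) *
      Real.exp (-(δ₁ * (P.mesh j₁)⁻¹ * (P.mesh 0 * (HiggsLattice.Site.tdist y x' : ℝ)))))
    (hud : ∀ b : HiggsLattice.PBond P 0, ‖covDeriv C B u b‖ ≤ cu' * P.mesh j₁ ^ (aw - 1 - (P.d : ℝ)) *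
      Real.exp (-(δ₁ * (P.mesh j₁)⁻¹ * (P.mesh 0 * (HiggsLattice.Site.tdist b.src x' : ℝ))))) :
    ‖covDeriv C B (pieceR C Finset.univ B msq a k j₂ ((P.mesh 0)⁻¹ • ∑ b : HiggsLattice.PBond P 0, srcDM C A B b u)) b₀‖
      ≤ (P.d : ℝ) * ((P.mesh 0 ^ P.d * Cst) * ((P.mesh 0)⁻¹ * (|C.e| * δA) * cu) *
            ((nCol N : ℝ) * (8 * P.d / δ₁) ^ P.d * (P.mesh 0 ^ P.d)⁻¹)) *
          (P.mesh j₂ ^ (1 : ℝ) * P.mesh j₁ ^ aw * (P.mesh (max j₂ j₁) ^ P.d)⁻¹) *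
          Real.exp (-(δ₁ / 2 * (P.mesh (max j₂ j₁))⁻¹ * (P.mesh 0 * (HiggsLattice.Site.tdist b₀.src x' : ℝ))))
        + (P.d : ℝ) * ((P.mesh 0 ^ P.d * Cst) * (|C.e| * s * cu') *
            ((nCol N : ℝ) * (8 * P.d / δ₁) ^ P.d * (P.mesh 0 ^ P.d)⁻¹)) *
          (P.mesh j₂ ^ (1 : ℝ) * P.mesh j₁ ^ (aw - 1) * (P.mesh (max j₂ j₁) ^ P.d)⁻¹) *
          Real.exp (-(δ₁ / 2 * (P.mesh (max j₂ j₁))⁻¹ * (P.mesh 0 * (HiggsLattice.Site.tdist b₀.src x' : ℝ)))) := by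
  have hε := P.mesh_pos 0
  have hes : 0 ≤ |C.e| * s := mul_nonneg (abs_nonneg _) hs
  have hN : 0 ≤ (P.mesh 0)⁻¹ * (|C.e| * δA) := mul_nonneg (inv_nonneg.mpr hε.le) (mul_nonneg (abs_nonneg _) hδA)
  have hc : 0 ≤ P.mesh 0 ^ P.d * Cst := mul_nonneg (pow_nonneg hε.le _) hCst
  -- THEOREM A′ and the two resulting bond sums
  have step1 : ‖covDeriv C B (pieceR C Finset.univ B msq a k j₂ ((P.mesh 0)⁻¹ • ∑ b : HiggsLattice.PBond P 0, srcDM C A B b u)) b₀‖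
      ≤ (∑ b : HiggsLattice.PBond P 0, pdcol C msq a k j₂ B B b₀ b.src * ((P.mesh 0)⁻¹ * (|C.e| * δA) * ‖u b.src‖))
        + ∑ b : HiggsLattice.PBond P 0, pdcol C msq a k j₂ B B b₀ b.src * (|C.e| * s * ‖covDeriv C B u b‖) := by
    rw [B3Op116LeibnizRows.inv_smul_sum_srcDM_eq, map_sum, B3Ineq210RegularTorus.covDeriv_sum'', ← Finset.sum_add_distrib]
    refine (norm_sum_le _ _).trans (Finset.sum_le_sum fun b _ => ?_)
    have h := norm_mapE_single_le (covDerivAt C B b₀ ∘ₗ pieceR C Finset.univ B msq a k j₂) b.src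
      (B3Op116LeibnizRows.nMul C A b (u b.src) - fOne C (P.mesh 0) (A b) (covDeriv C B u b))
    simp only [phi_apply] at h
    refine h.trans ?_
    rw [← pdcol, ← mul_add, mul_comm]
    refine mul_le_mul_of_nonneg_left ((norm_sub_le _ _).trans (add_le_add ?_ ?_)) (pdcol_nonneg _ _ _ _)
    · exact B3Op116LeibnizRows.norm_nMul_apply_le C A hreg b _
    · exact norm_fOne_apply_le_of_abs_le (hA b) _
  refine step1.trans (add_le_add ?_ ?_)
  · refine pair_bond_le hδ₁ hδ₁1 j₂ j₁ hc (mul_nonneg hN hcu) i₀ b₀.src x' _ _ (fun b => pdcol_nonneg _ _ _ _)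
      (fun b => mul_nonneg hN (norm_nonneg _)) (fun b => pdcol_le h210B b₀ b.src) (fun b => ?_)
    exact (mul_le_mul_of_nonneg_left (huv b.src) hN).trans (le_of_eq (by ring))
  · refine pair_bond_le hδ₁ hδ₁1 j₂ j₁ hc (mul_nonneg hes hcu') i₀ b₀.src x' _ _ (fun b => pdcol_nonneg _ _ _ _)
      (fun b => mul_nonneg hes (norm_nonneg _)) (fun b => pdcol_le h210B b₀ b.src) (fun b => ?_)
    exact (mul_le_mul_of_nonneg_left (hud b) hes).trans (le_of_eq (by ring))

end Pairs

/-! ## §3 THE SCALE-PAIR SUMS: each pair filed under its coarser index, the finer index summed geometrically -/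

section PairSums

variable {C : ChargeData N} {A B : HiggsLattice.VecField P 0} {msq a : ℝ} {k K₀ : ℕ} {hL1 : 1 < P.L} {δ₁ Cst CM s δA : ℝ}

/-- `(L^jε)^1·(L^jε)^{e}·((L^jε)^d)^{−1} = (L^jε)^{1+e−d}`. [cite: Balaban1983Higgs3, (2.10) p.426] -/
theorem mesh_one_mul_rpow_mul_inv (j : ℕ) (e : ℝ) :
    P.mesh j ^ (1 : ℝ) * P.mesh j ^ e * (P.mesh j ^ P.d)⁻¹ = P.mesh j ^ (1 + e - (P.d : ℝ)) := by
  rw [mesh_rpow_add, mesh_rpow_mul_inv_pow_eq]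

/-- `(L^jε)^e·(L^jε)^{1}·((L^jε)^d)^{−1} = (L^jε)^{e+1−d}`. [cite: Balaban1983Higgs3, (2.10) p.426] -/
theorem mesh_rpow_mul_one_mul_inv (j : ℕ) (e : ℝ) :
    P.mesh j ^ e * P.mesh j ^ (1 : ℝ) * (P.mesh j ^ P.d)⁻¹ = P.mesh j ^ (e + 1 - (P.d : ℝ)) := by
  rw [mesh_rpow_add, mesh_rpow_mul_inv_pow_eq]

/-- `(L^jε)^e·(L^jε)^{0}·((L^jε)^d)^{−1} = (L^jε)^{e−d}`. [cite: Balaban1983Higgs3, (2.10) p.426] -/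
theorem mesh_rpow_mul_zero_mul_inv (j : ℕ) (e : ℝ) :
    P.mesh j ^ e * P.mesh j ^ (0 : ℝ) * (P.mesh j ^ P.d)⁻¹ = P.mesh j ^ (e - (P.d : ℝ)) := by
  rw [Real.rpow_zero, mul_one, mesh_rpow_mul_inv_pow_eq]

/-- **THE `M^*D` SOURCES OF A MULTI-SCALE FIELD THROUGH `D^ε_BG_k(T_ε,B)`, summed over all scale pairs.**  For `w = Σ_{j<k}w_j` with
`‖w_j(y)‖ ≤ c_w(L^jε)^{a_w−d}e_j(y,x′)`, `‖(D^ε_Bw_j)(b)‖ ≤ c_w′(L^jε)^{a_w−1−d}e_j(b₋,x′)` (`a_w > 0`):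
`‖(D^ε_BG_k(T,B)Σ_b srcMD_b w)(b₀)‖ ≤ [G₁K_A + G_{a_w}K_{B2}]·Σ_{j<k}(L^jε)^{a_w−d}e^{δ₁/2}_j(b₀₋,x′) + G_{a_w}K_{B1}·Σ_{j<k}(L^jε)^{a_w+1−d}e^{δ₁/2}_j(b₀₋,x′)`
(`G_e = L^e/(L^e−1)`; pairs `j₂ ≤ j₁` by PAIR BOUND 1, pairs `j₁ < j₂` by PAIR BOUND 2 — the exponent-`0` factor always on the coarser piece).
[cite: Balaban1983Higgs3, (1.16) p.414, (2.6) p.424, (2.10) p.426] [cite: Balaban1982Higgs1, (3.16) p.615] -/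
theorem md_sum_le (hmsq : 0 < msq) (ha : 0 < a) (hk : 1 ≤ k) (hkK : k ≤ P.K) (hδ₁ : 0 < δ₁) (hδ₁1 : δ₁ ≤ 1) (hCst : 0 ≤ Cst)
    (hCM : 0 ≤ CM) (hs : 0 ≤ s) (hδA : 0 ≤ δA)
    (h210B : (regRegionKernels hL1 C Finset.univ B msq a k K₀).Ineq210 δ₁ Cst)
    (hmixB : ∀ (j : ℕ) (μ ν : Fin P.d) (x x' : HiggsLattice.Site P 0),
      B3Ineq210MixedRegularRegion.mixedTermR C Finset.univ B msq a k j μ ν x x'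
        ≤ CM * (P.mesh j ^ P.d)⁻¹ * Real.exp (-(δ₁ * ((HiggsLattice.Site.tdist x x' : ℝ) / (P.L : ℝ) ^ j))))
    (hA : ∀ b : HiggsLattice.PBond P 0, |A b| ≤ s)
    (hreg : ∀ (z : HiggsLattice.Site P 0) (μ ν : Fin P.d), |A ⟨z.shift ν, μ⟩ - A ⟨z, μ⟩| ≤ δA)
    (i₀ : Ix N) (b₀ : HiggsLattice.PBond P 0) (x' : HiggsLattice.Site P 0)
    (w : ScalarField P 0 N) (wp : ℕ → ScalarField P 0 N) (hw : ∑ j ∈ Finset.range k, wp j = w) {aw cw cw' : ℝ} (haw : 0 < aw)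
    (hcw : 0 ≤ cw) (hcw' : 0 ≤ cw')
    (hwv : ∀ (j : ℕ) (y : HiggsLattice.Site P 0), ‖wp j y‖ ≤ cw * P.mesh j ^ (aw - (P.d : ℝ)) *
      Real.exp (-(δ₁ * (P.mesh j)⁻¹ * (P.mesh 0 * (HiggsLattice.Site.tdist y x' : ℝ)))))
    (hwd : ∀ (j : ℕ) (b : HiggsLattice.PBond P 0), ‖covDeriv C B (wp j) b‖ ≤ cw' * P.mesh j ^ (aw - 1 - (P.d : ℝ)) *
      Real.exp (-(δ₁ * (P.mesh j)⁻¹ * (P.mesh 0 * (HiggsLattice.Site.tdist b.src x' : ℝ))))) :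
    ‖covDeriv C B (propagatorK C Finset.univ B msq a k (∑ b : HiggsLattice.PBond P 0, srcMD C A B b w)) b₀‖
      ≤ ((P.L : ℝ) ^ (1 : ℝ) / ((P.L : ℝ) ^ (1 : ℝ) - 1) *
            ((P.d : ℝ) * ((Real.exp 1 * (P.mesh 0 ^ P.d * Cst)) * (|C.e| * s * cw') *
              ((nCol N : ℝ) * (8 * P.d / δ₁) ^ P.d * (P.mesh 0 ^ P.d)⁻¹)))
          + (P.L : ℝ) ^ aw / ((P.L : ℝ) ^ aw - 1) *
            ((P.d : ℝ) * ((P.mesh 0 ^ P.d * CM) * (|C.e| * s * cw) *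
              ((nCol N : ℝ) * (8 * P.d / δ₁) ^ P.d * (P.mesh 0 ^ P.d)⁻¹)))) *
          ∑ j ∈ Finset.range k, P.mesh j ^ (aw - (P.d : ℝ)) *
            Real.exp (-(δ₁ / 2 * (P.mesh j)⁻¹ * (P.mesh 0 * (HiggsLattice.Site.tdist b₀.src x' : ℝ))))
        + (P.L : ℝ) ^ aw / ((P.L : ℝ) ^ aw - 1) *
            ((P.d : ℝ) * ((P.mesh 0 ^ P.d * Cst) * ((P.mesh 0)⁻¹ * (|C.e| * δA) * cw) *
              ((nCol N : ℝ) * (8 * P.d / δ₁) ^ P.d * (P.mesh 0 ^ P.d)⁻¹))) *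
          ∑ j ∈ Finset.range k, P.mesh j ^ (aw + 1 - (P.d : ℝ)) *
            Real.exp (-(δ₁ / 2 * (P.mesh j)⁻¹ * (P.mesh 0 * (HiggsLattice.Site.tdist b₀.src x' : ℝ)))) := by
  have hL1' : (1 : ℝ) < (P.L : ℝ) := by exact_mod_cast hL1
  have hε := P.mesh_pos 0
  -- names for the constants and the bumps
  set K' : ℝ := (nCol N : ℝ) * (8 * P.d / δ₁) ^ P.d * (P.mesh 0 ^ P.d)⁻¹ with hK'
  set KA : ℝ := (P.d : ℝ) * ((Real.exp 1 * (P.mesh 0 ^ P.d * Cst)) * (|C.e| * s * cw') * K') with hKA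
  set KB1 : ℝ := (P.d : ℝ) * ((P.mesh 0 ^ P.d * Cst) * ((P.mesh 0)⁻¹ * (|C.e| * δA) * cw) * K') with hKB1
  set KB2 : ℝ := (P.d : ℝ) * ((P.mesh 0 ^ P.d * CM) * (|C.e| * s * cw) * K') with hKB2
  have hKA0 : 0 ≤ KA := by rw [hKA, hK']; positivity
  have hKB10 : 0 ≤ KB1 := by rw [hKB1, hK']; positivity
  have hKB20 : 0 ≤ KB2 := by rw [hKB2, hK']; positivity
  set E2 : ℕ → ℝ := fun j => Real.exp (-(δ₁ / 2 * (P.mesh j)⁻¹ * (P.mesh 0 * (HiggsLattice.Site.tdist b₀.src x' : ℝ)))) with hE2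
  have hE20 : ∀ j, 0 ≤ E2 j := fun j => Real.exp_nonneg _
  set G1 : ℝ := (P.L : ℝ) ^ (1 : ℝ) / ((P.L : ℝ) ^ (1 : ℝ) - 1) with hG1
  set Ga : ℝ := (P.L : ℝ) ^ aw / ((P.L : ℝ) ^ aw - 1) with hGa
  have hGa0 : 0 ≤ Ga := by
    have := Real.one_lt_rpow hL1' haw; rw [hGa]; exact div_nonneg (by linarith) (by linarith)
  have hm : ∀ j (e : ℝ), 0 ≤ P.mesh j ^ e := fun j e => Real.rpow_nonneg (P.mesh_pos j).le e
  have hmi : ∀ j, 0 ≤ (P.mesh j ^ P.d)⁻¹ := fun j => inv_nonneg.mpr (pow_nonneg (P.mesh_pos j).le _)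
  -- the double sum over the pieces
  set T : ℕ → ℕ → ℝ := fun j₁ j₂ =>
    ‖covDeriv C B (pieceR C Finset.univ B msq a k j₂ (∑ b : HiggsLattice.PBond P 0, srcMD C A B b (wp j₁))) b₀‖ with hT
  have step1 : ‖covDeriv C B (propagatorK C Finset.univ B msq a k (∑ b : HiggsLattice.PBond P 0, srcMD C A B b w)) b₀‖
      ≤ ∑ j₁ ∈ Finset.range k, ∑ j₂ ∈ Finset.range k, T j₁ j₂ := by
    have hsrc : ∑ b : HiggsLattice.PBond P 0, srcMD C A B b w
        = ∑ j₁ ∈ Finset.range k, ∑ b : HiggsLattice.PBond P 0, srcMD C A B b (wp j₁) := by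
      rw [← hw, Finset.sum_comm]
      exact Finset.sum_congr rfl fun b _ => srcMD_sum C A B _ _ b
    rw [hsrc, map_sum, B3Ineq210RegularTorus.covDeriv_sum'']
    refine (norm_sum_le _ _).trans (Finset.sum_le_sum fun j₁ _ => ?_)
    rw [covDeriv_propagatorK_eq_sum_pieces C msq a k B B hmsq ha hL1 hk hkK]
    rw [hT]
    exact norm_sum_le (Finset.range k)
      (fun j₂ => covDeriv C B (pieceR C Finset.univ B msq a k j₂ (∑ b : HiggsLattice.PBond P 0, srcMD C A B b (wp j₁))) b₀)
  -- the two cases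
  set gA : ℕ → ℝ := fun j₁ => KA * (P.mesh j₁ ^ (aw - 1) * (P.mesh j₁ ^ P.d)⁻¹) * E2 j₁ with hgA
  set gB : ℕ → ℝ := fun j₂ => (KB1 * (P.mesh j₂ ^ (1 : ℝ) * (P.mesh j₂ ^ P.d)⁻¹) + KB2 * (P.mesh j₂ ^ (0 : ℝ) * (P.mesh j₂ ^ P.d)⁻¹))
    * E2 j₂ with hgB
  have hgA0 : ∀ j, 0 ≤ gA j := fun j => by
    rw [hgA]; exact mul_nonneg (mul_nonneg hKA0 (mul_nonneg (hm j _) (hmi j))) (hE20 j)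
  have hgB0 : ∀ j, 0 ≤ gB j := fun j => by
    rw [hgB]
    exact mul_nonneg (add_nonneg (mul_nonneg hKB10 (mul_nonneg (hm j _) (hmi j))) (mul_nonneg hKB20 (mul_nonneg (hm j _) (hmi j))))
      (hE20 j)
  have hle : ∀ j₁ j₂, j₂ ≤ j₁ → T j₁ j₂ ≤ P.mesh j₂ ^ (1 : ℝ) * gA j₁ := by
    intro j₁ j₂ hj
    have h := md_direct_le hδ₁ hδ₁1 hCst hs h210B hA i₀ b₀ x' j₁ j₂ (wp j₁) hcw' (hwd j₁)
    rw [max_eq_right hj] at h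
    refine h.trans (le_of_eq ?_)
    rw [hgA, hKA, hE2]; ring
  have hlt : ∀ j₁ j₂, j₁ < j₂ → T j₁ j₂ ≤ P.mesh j₁ ^ aw * gB j₂ := by
    intro j₁ j₂ hj
    have h := md_parts_le hδ₁ hδ₁1 hCst hCM hs hδA h210B hmixB hA hreg i₀ b₀ x' j₁ j₂ (wp j₁) hcw (hwv j₁)
    rw [max_eq_left hj.le] at h
    refine h.trans (le_of_eq ?_)
    rw [hgB, hKB1, hKB2, hE2]; ring
  have step2 := sum_sq_le_of_cases k T (fun j₁ j₂ => P.mesh j₂ ^ (1 : ℝ) * gA j₁) (fun j₁ j₂ => P.mesh j₁ ^ aw * gB j₂)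
    (fun i j => mul_nonneg (hm i _) (hgB0 j)) hle hlt
  -- the lower triangle: pairs `j₂ ≤ j₁` (PAIR BOUND 1), finer index `j₂` with exponent `1`
  have step3 : ∑ j₁ ∈ Finset.range k, ∑ j₂ ∈ Finset.range (j₁ + 1), P.mesh j₂ ^ (1 : ℝ) * gA j₁
      ≤ G1 * (KA * ∑ j ∈ Finset.range k, P.mesh j ^ (aw - (P.d : ℝ)) * E2 j) := by
    have hpt : ∀ j, P.mesh j ^ (1 : ℝ) * gA j = KA * (P.mesh j ^ (aw - (P.d : ℝ)) * E2 j) := by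
      intro j
      rw [hgA]
      calc P.mesh j ^ (1 : ℝ) * (KA * (P.mesh j ^ (aw - 1) * (P.mesh j ^ P.d)⁻¹) * E2 j)
          = KA * (P.mesh j ^ (1 : ℝ) * P.mesh j ^ (aw - 1) * (P.mesh j ^ P.d)⁻¹) * E2 j := by ring
        _ = KA * P.mesh j ^ (aw - (P.d : ℝ)) * E2 j := by
            rw [mesh_one_mul_rpow_mul_inv, show (1 : ℝ) + (aw - 1) - (P.d : ℝ) = aw - (P.d : ℝ) by ring]
        _ = _ := by ring
    have hsum : ∑ j ∈ Finset.range k, P.mesh j ^ (1 : ℝ) * gA j = KA * ∑ j ∈ Finset.range k, P.mesh j ^ (aw - (P.d : ℝ)) * E2 j := by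
      rw [Finset.mul_sum]; exact Finset.sum_congr rfl fun j _ => hpt j
    refine (sum_lower_pair_le hL1 one_pos k gA hgA0).trans (le_of_eq ?_)
    rw [hsum]
  -- the upper triangle: pairs `j₁ ≤ j₂` (PAIR BOUND 2), finer index `j₁` with exponent `a_w`
  have step4 : ∑ j₂ ∈ Finset.range k, ∑ j₁ ∈ Finset.range (j₂ + 1), P.mesh j₁ ^ aw * gB j₂
      ≤ Ga * (KB1 * ∑ j ∈ Finset.range k, P.mesh j ^ (aw + 1 - (P.d : ℝ)) * E2 j
          + KB2 * ∑ j ∈ Finset.range k, P.mesh j ^ (aw - (P.d : ℝ)) * E2 j) := by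
    have hpt : ∀ j, P.mesh j ^ aw * gB j
        = KB1 * (P.mesh j ^ (aw + 1 - (P.d : ℝ)) * E2 j) + KB2 * (P.mesh j ^ (aw - (P.d : ℝ)) * E2 j) := by
      intro j
      rw [hgB]
      calc P.mesh j ^ aw * ((KB1 * (P.mesh j ^ (1 : ℝ) * (P.mesh j ^ P.d)⁻¹) + KB2 * (P.mesh j ^ (0 : ℝ) * (P.mesh j ^ P.d)⁻¹)) * E2 j)
          = KB1 * (P.mesh j ^ aw * P.mesh j ^ (1 : ℝ) * (P.mesh j ^ P.d)⁻¹) * E2 j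
            + KB2 * (P.mesh j ^ aw * P.mesh j ^ (0 : ℝ) * (P.mesh j ^ P.d)⁻¹) * E2 j := by ring
        _ = KB1 * P.mesh j ^ (aw + 1 - (P.d : ℝ)) * E2 j + KB2 * P.mesh j ^ (aw - (P.d : ℝ)) * E2 j := by
            rw [mesh_rpow_mul_one_mul_inv, mesh_rpow_mul_zero_mul_inv]
        _ = _ := by ring
    have hsum : ∑ j ∈ Finset.range k, P.mesh j ^ aw * gB j
        = KB1 * ∑ j ∈ Finset.range k, P.mesh j ^ (aw + 1 - (P.d : ℝ)) * E2 j
          + KB2 * ∑ j ∈ Finset.range k, P.mesh j ^ (aw - (P.d : ℝ)) * E2 j := by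
      rw [Finset.mul_sum, Finset.mul_sum, ← Finset.sum_add_distrib]; exact Finset.sum_congr rfl fun j _ => hpt j
    refine (sum_lower_pair_le hL1 haw k gB hgB0).trans (le_of_eq ?_)
    rw [hsum]
  -- assemble
  have hsumA : 0 ≤ ∑ j ∈ Finset.range k, P.mesh j ^ (aw - (P.d : ℝ)) * E2 j :=
    Finset.sum_nonneg fun j _ => mul_nonneg (hm j _) (hE20 j)
  calc ‖covDeriv C B (propagatorK C Finset.univ B msq a k (∑ b : HiggsLattice.PBond P 0, srcMD C A B b w)) b₀‖
      ≤ ∑ j₁ ∈ Finset.range k, ∑ j₂ ∈ Finset.range k, T j₁ j₂ := step1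
    _ ≤ _ := step2
    _ ≤ G1 * (KA * ∑ j ∈ Finset.range k, P.mesh j ^ (aw - (P.d : ℝ)) * E2 j)
        + Ga * (KB1 * ∑ j ∈ Finset.range k, P.mesh j ^ (aw + 1 - (P.d : ℝ)) * E2 j
          + KB2 * ∑ j ∈ Finset.range k, P.mesh j ^ (aw - (P.d : ℝ)) * E2 j) := add_le_add step3 step4
    _ = _ := by rw [hG1, hGa, hKA, hKB1, hKB2, hK', hE2]; ring

/-- **THE `D^*M` SOURCES OF A MULTI-SCALE FIELD THROUGH `D^ε_BG_k(T_ε,B)`, summed over all scale pairs** (same hypotheses):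
`‖(D^ε_BG_k(T,B)ε⁻¹Σ_b srcDM_b w)(b₀)‖ ≤ [G_{a_w}K_D + G₁K_{P2}]·Σ_{j<k}(L^jε)^{a_w−d}e^{δ₁/2}_j(b₀₋,x′) + G₁K_{P1}·Σ_{j<k}(L^jε)^{a_w+1−d}e^{δ₁/2}_j(b₀₋,x′)`
(pairs `j₁ ≤ j₂` by PAIR BOUND 3, pairs `j₂ < j₁` by PAIR BOUND 4). [cite: Balaban1983Higgs3, (1.16) p.414, (2.6) p.424, (2.10) p.426] [cite: Balaban1982Higgs1, (3.16) p.615] -/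
theorem dm_sum_le (hmsq : 0 < msq) (ha : 0 < a) (hk : 1 ≤ k) (hkK : k ≤ P.K) (hδ₁ : 0 < δ₁) (hδ₁1 : δ₁ ≤ 1) (hCst : 0 ≤ Cst)
    (hCM : 0 ≤ CM) (hs : 0 ≤ s) (hδA : 0 ≤ δA)
    (h210B : (regRegionKernels hL1 C Finset.univ B msq a k K₀).Ineq210 δ₁ Cst)
    (hmixB : ∀ (j : ℕ) (μ ν : Fin P.d) (x x' : HiggsLattice.Site P 0),
      B3Ineq210MixedRegularRegion.mixedTermR C Finset.univ B msq a k j μ ν x x'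
        ≤ CM * (P.mesh j ^ P.d)⁻¹ * Real.exp (-(δ₁ * ((HiggsLattice.Site.tdist x x' : ℝ) / (P.L : ℝ) ^ j))))
    (hA : ∀ b : HiggsLattice.PBond P 0, |A b| ≤ s)
    (hreg : ∀ (z : HiggsLattice.Site P 0) (μ ν : Fin P.d), |A ⟨z.shift ν, μ⟩ - A ⟨z, μ⟩| ≤ δA)
    (i₀ : Ix N) (b₀ : HiggsLattice.PBond P 0) (x' : HiggsLattice.Site P 0)
    (w : ScalarField P 0 N) (wp : ℕ → ScalarField P 0 N) (hw : ∑ j ∈ Finset.range k, wp j = w) {aw cw cw' : ℝ} (haw : 0 < aw)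
    (hcw : 0 ≤ cw) (hcw' : 0 ≤ cw')
    (hwv : ∀ (j : ℕ) (y : HiggsLattice.Site P 0), ‖wp j y‖ ≤ cw * P.mesh j ^ (aw - (P.d : ℝ)) *
      Real.exp (-(δ₁ * (P.mesh j)⁻¹ * (P.mesh 0 * (HiggsLattice.Site.tdist y x' : ℝ)))))
    (hwd : ∀ (j : ℕ) (b : HiggsLattice.PBond P 0), ‖covDeriv C B (wp j) b‖ ≤ cw' * P.mesh j ^ (aw - 1 - (P.d : ℝ)) *
      Real.exp (-(δ₁ * (P.mesh j)⁻¹ * (P.mesh 0 * (HiggsLattice.Site.tdist b.src x' : ℝ))))) :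
    ‖covDeriv C B (propagatorK C Finset.univ B msq a k ((P.mesh 0)⁻¹ • ∑ b : HiggsLattice.PBond P 0, srcDM C A B b w)) b₀‖
      ≤ ((P.L : ℝ) ^ aw / ((P.L : ℝ) ^ aw - 1) *
            ((P.d : ℝ) * ((P.mesh 0 ^ P.d * CM) * (Real.exp 1 * (|C.e| * s * cw)) *
              ((nCol N : ℝ) * (8 * P.d / δ₁) ^ P.d * (P.mesh 0 ^ P.d)⁻¹)))
          + (P.L : ℝ) ^ (1 : ℝ) / ((P.L : ℝ) ^ (1 : ℝ) - 1) *
            ((P.d : ℝ) * ((P.mesh 0 ^ P.d * Cst) * (|C.e| * s * cw') *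
              ((nCol N : ℝ) * (8 * P.d / δ₁) ^ P.d * (P.mesh 0 ^ P.d)⁻¹)))) *
          ∑ j ∈ Finset.range k, P.mesh j ^ (aw - (P.d : ℝ)) *
            Real.exp (-(δ₁ / 2 * (P.mesh j)⁻¹ * (P.mesh 0 * (HiggsLattice.Site.tdist b₀.src x' : ℝ))))
        + (P.L : ℝ) ^ (1 : ℝ) / ((P.L : ℝ) ^ (1 : ℝ) - 1) *
            ((P.d : ℝ) * ((P.mesh 0 ^ P.d * Cst) * ((P.mesh 0)⁻¹ * (|C.e| * δA) * cw) *
              ((nCol N : ℝ) * (8 * P.d / δ₁) ^ P.d * (P.mesh 0 ^ P.d)⁻¹))) *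
          ∑ j ∈ Finset.range k, P.mesh j ^ (aw + 1 - (P.d : ℝ)) *
            Real.exp (-(δ₁ / 2 * (P.mesh j)⁻¹ * (P.mesh 0 * (HiggsLattice.Site.tdist b₀.src x' : ℝ)))) := by
  have hL1' : (1 : ℝ) < (P.L : ℝ) := by exact_mod_cast hL1
  have hε := P.mesh_pos 0
  set K' : ℝ := (nCol N : ℝ) * (8 * P.d / δ₁) ^ P.d * (P.mesh 0 ^ P.d)⁻¹ with hK'
  set KD : ℝ := (P.d : ℝ) * ((P.mesh 0 ^ P.d * CM) * (Real.exp 1 * (|C.e| * s * cw)) * K') with hKD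
  set KP1 : ℝ := (P.d : ℝ) * ((P.mesh 0 ^ P.d * Cst) * ((P.mesh 0)⁻¹ * (|C.e| * δA) * cw) * K') with hKP1
  set KP2 : ℝ := (P.d : ℝ) * ((P.mesh 0 ^ P.d * Cst) * (|C.e| * s * cw') * K') with hKP2
  have hKD0 : 0 ≤ KD := by rw [hKD, hK']; positivity
  have hKP10 : 0 ≤ KP1 := by rw [hKP1, hK']; positivity
  have hKP20 : 0 ≤ KP2 := by rw [hKP2, hK']; positivity
  set E2 : ℕ → ℝ := fun j => Real.exp (-(δ₁ / 2 * (P.mesh j)⁻¹ * (P.mesh 0 * (HiggsLattice.Site.tdist b₀.src x' : ℝ)))) with hE2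
  have hE20 : ∀ j, 0 ≤ E2 j := fun j => Real.exp_nonneg _
  set G1 : ℝ := (P.L : ℝ) ^ (1 : ℝ) / ((P.L : ℝ) ^ (1 : ℝ) - 1) with hG1
  set Ga : ℝ := (P.L : ℝ) ^ aw / ((P.L : ℝ) ^ aw - 1) with hGa
  have hm : ∀ j (e : ℝ), 0 ≤ P.mesh j ^ e := fun j e => Real.rpow_nonneg (P.mesh_pos j).le e
  have hmi : ∀ j, 0 ≤ (P.mesh j ^ P.d)⁻¹ := fun j => inv_nonneg.mpr (pow_nonneg (P.mesh_pos j).le _)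
  -- the double sum over the pieces, OUTER index = the piece `j₂` of `G_B`, inner = the piece `j₁` of `w`
  set T : ℕ → ℕ → ℝ := fun j₂ j₁ =>
    ‖covDeriv C B (pieceR C Finset.univ B msq a k j₂ ((P.mesh 0)⁻¹ • ∑ b : HiggsLattice.PBond P 0, srcDM C A B b (wp j₁))) b₀‖ with hT
  have step1 : ‖covDeriv C B (propagatorK C Finset.univ B msq a k ((P.mesh 0)⁻¹ • ∑ b : HiggsLattice.PBond P 0, srcDM C A B b w)) b₀‖
      ≤ ∑ j₂ ∈ Finset.range k, ∑ j₁ ∈ Finset.range k, T j₂ j₁ := by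
    have hsrc : (P.mesh 0)⁻¹ • ∑ b : HiggsLattice.PBond P 0, srcDM C A B b w
        = ∑ j₁ ∈ Finset.range k, (P.mesh 0)⁻¹ • ∑ b : HiggsLattice.PBond P 0, srcDM C A B b (wp j₁) := by
      rw [← hw, ← Finset.smul_sum, Finset.sum_comm]
      congr 1
      exact Finset.sum_congr rfl fun b _ => srcDM_sum C A B _ _ b
    rw [hsrc, map_sum, B3Ineq210RegularTorus.covDeriv_sum'']
    refine (norm_sum_le _ _).trans ?_
    rw [Finset.sum_comm]
    refine Finset.sum_le_sum fun j₁ _ => ?_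
    rw [covDeriv_propagatorK_eq_sum_pieces C msq a k B B hmsq ha hL1 hk hkK]
    rw [hT]
    exact norm_sum_le (Finset.range k)
      (fun j₂ => covDeriv C B (pieceR C Finset.univ B msq a k j₂
        ((P.mesh 0)⁻¹ • ∑ b : HiggsLattice.PBond P 0, srcDM C A B b (wp j₁))) b₀)
  -- the two cases
  set gD : ℕ → ℝ := fun j₂ => KD * (P.mesh j₂ ^ (0 : ℝ) * (P.mesh j₂ ^ P.d)⁻¹) * E2 j₂ with hgD
  set gP : ℕ → ℝ := fun j₁ => (KP1 * (P.mesh j₁ ^ aw * (P.mesh j₁ ^ P.d)⁻¹) + KP2 * (P.mesh j₁ ^ (aw - 1) * (P.mesh j₁ ^ P.d)⁻¹))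
    * E2 j₁ with hgP
  have hgD0 : ∀ j, 0 ≤ gD j := fun j => by
    rw [hgD]; exact mul_nonneg (mul_nonneg hKD0 (mul_nonneg (hm j _) (hmi j))) (hE20 j)
  have hgP0 : ∀ j, 0 ≤ gP j := fun j => by
    rw [hgP]
    exact mul_nonneg (add_nonneg (mul_nonneg hKP10 (mul_nonneg (hm j _) (hmi j))) (mul_nonneg hKP20 (mul_nonneg (hm j _) (hmi j))))
      (hE20 j)
  have hle : ∀ j₂ j₁, j₁ ≤ j₂ → T j₂ j₁ ≤ P.mesh j₁ ^ aw * gD j₂ := by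
    intro j₂ j₁ hj
    have h := dm_direct_le hδ₁ hδ₁1 hCM hs hmixB hA i₀ b₀ x' j₁ j₂ (wp j₁) hcw (hwv j₁)
    rw [max_eq_left hj] at h
    refine h.trans (le_of_eq ?_)
    rw [hgD, hKD, hE2]; ring
  have hlt : ∀ j₂ j₁, j₂ < j₁ → T j₂ j₁ ≤ P.mesh j₂ ^ (1 : ℝ) * gP j₁ := by
    intro j₂ j₁ hj
    have h := dm_parts_le hδ₁ hδ₁1 hCst hs hδA h210B hA hreg i₀ b₀ x' j₁ j₂ (wp j₁) hcw hcw' (hwv j₁) (hwd j₁)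
    rw [max_eq_right hj.le] at h
    refine h.trans (le_of_eq ?_)
    rw [hgP, hKP1, hKP2, hE2]; ring
  have step2 := sum_sq_le_of_cases k T (fun j₂ j₁ => P.mesh j₁ ^ aw * gD j₂) (fun j₂ j₁ => P.mesh j₂ ^ (1 : ℝ) * gP j₁)
    (fun i j => mul_nonneg (hm i _) (hgP0 j)) hle hlt
  -- pairs `j₁ ≤ j₂` (PAIR BOUND 3): finer index `j₁` with exponent `a_w`
  have step3 : ∑ j₂ ∈ Finset.range k, ∑ j₁ ∈ Finset.range (j₂ + 1), P.mesh j₁ ^ aw * gD j₂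
      ≤ Ga * (KD * ∑ j ∈ Finset.range k, P.mesh j ^ (aw - (P.d : ℝ)) * E2 j) := by
    have hpt : ∀ j, P.mesh j ^ aw * gD j = KD * (P.mesh j ^ (aw - (P.d : ℝ)) * E2 j) := by
      intro j
      rw [hgD]
      calc P.mesh j ^ aw * (KD * (P.mesh j ^ (0 : ℝ) * (P.mesh j ^ P.d)⁻¹) * E2 j)
          = KD * (P.mesh j ^ aw * P.mesh j ^ (0 : ℝ) * (P.mesh j ^ P.d)⁻¹) * E2 j := by ring
        _ = KD * P.mesh j ^ (aw - (P.d : ℝ)) * E2 j := by rw [mesh_rpow_mul_zero_mul_inv]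
        _ = _ := by ring
    have hsum : ∑ j ∈ Finset.range k, P.mesh j ^ aw * gD j = KD * ∑ j ∈ Finset.range k, P.mesh j ^ (aw - (P.d : ℝ)) * E2 j := by
      rw [Finset.mul_sum]; exact Finset.sum_congr rfl fun j _ => hpt j
    have hGa0 : 0 ≤ Ga := by
      have := Real.one_lt_rpow hL1' haw; rw [hGa]; exact div_nonneg (by linarith) (by linarith)
    refine (sum_lower_pair_le hL1 haw k gD hgD0).trans (le_of_eq ?_)
    rw [hsum]
  -- pairs `j₂ < j₁` (PAIR BOUND 4): finer index `j₂` with exponent `1`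
  have step4 : ∑ j₁ ∈ Finset.range k, ∑ j₂ ∈ Finset.range (j₁ + 1), P.mesh j₂ ^ (1 : ℝ) * gP j₁
      ≤ G1 * (KP1 * ∑ j ∈ Finset.range k, P.mesh j ^ (aw + 1 - (P.d : ℝ)) * E2 j
          + KP2 * ∑ j ∈ Finset.range k, P.mesh j ^ (aw - (P.d : ℝ)) * E2 j) := by
    have hpt : ∀ j, P.mesh j ^ (1 : ℝ) * gP j
        = KP1 * (P.mesh j ^ (aw + 1 - (P.d : ℝ)) * E2 j) + KP2 * (P.mesh j ^ (aw - (P.d : ℝ)) * E2 j) := by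
      intro j
      rw [hgP]
      calc P.mesh j ^ (1 : ℝ) * ((KP1 * (P.mesh j ^ aw * (P.mesh j ^ P.d)⁻¹) + KP2 * (P.mesh j ^ (aw - 1) * (P.mesh j ^ P.d)⁻¹)) * E2 j)
          = KP1 * (P.mesh j ^ (1 : ℝ) * P.mesh j ^ aw * (P.mesh j ^ P.d)⁻¹) * E2 j
            + KP2 * (P.mesh j ^ (1 : ℝ) * P.mesh j ^ (aw - 1) * (P.mesh j ^ P.d)⁻¹) * E2 j := by ring
        _ = KP1 * P.mesh j ^ (aw + 1 - (P.d : ℝ)) * E2 j + KP2 * P.mesh j ^ (aw - (P.d : ℝ)) * E2 j := by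
            rw [mesh_one_mul_rpow_mul_inv, mesh_one_mul_rpow_mul_inv, show (1 : ℝ) + aw - (P.d : ℝ) = aw + 1 - (P.d : ℝ) by ring,
              show (1 : ℝ) + (aw - 1) - (P.d : ℝ) = aw - (P.d : ℝ) by ring]
        _ = _ := by ring
    have hsum : ∑ j ∈ Finset.range k, P.mesh j ^ (1 : ℝ) * gP j
        = KP1 * ∑ j ∈ Finset.range k, P.mesh j ^ (aw + 1 - (P.d : ℝ)) * E2 j
          + KP2 * ∑ j ∈ Finset.range k, P.mesh j ^ (aw - (P.d : ℝ)) * E2 j := by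
      rw [Finset.mul_sum, Finset.mul_sum, ← Finset.sum_add_distrib]; exact Finset.sum_congr rfl fun j _ => hpt j
    refine (sum_lower_pair_le hL1 one_pos k gP hgP0).trans (le_of_eq ?_)
    rw [hsum]
  -- assemble
  calc ‖covDeriv C B (propagatorK C Finset.univ B msq a k ((P.mesh 0)⁻¹ • ∑ b : HiggsLattice.PBond P 0, srcDM C A B b w)) b₀‖
      ≤ ∑ j₂ ∈ Finset.range k, ∑ j₁ ∈ Finset.range k, T j₂ j₁ := step1
    _ ≤ _ := step2
    _ ≤ Ga * (KD * ∑ j ∈ Finset.range k, P.mesh j ^ (aw - (P.d : ℝ)) * E2 j)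
        + G1 * (KP1 * ∑ j ∈ Finset.range k, P.mesh j ^ (aw + 1 - (P.d : ℝ)) * E2 j
          + KP2 * ∑ j ∈ Finset.range k, P.mesh j ^ (aw - (P.d : ℝ)) * E2 j) := add_le_add step3 step4
    _ = _ := by rw [hG1, hGa, hKD, hKP1, hKP2, hK', hE2]; ring

end PairSums

/-! ## §4 The `M^*M` sources and the averaging sources (no second derivative: the totals suffice) -/

section Totals

variable {C : ChargeData N} {A B : HiggsLattice.VecField P 0} {msq a : ℝ} {k K₀ : ℕ} {hL1 : 1 < P.L} {δ₁ Cst s : ℝ}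

/-- The value of a multi-scale field is below its majorant (triangle inequality over the pieces). [cite: Balaban1983Higgs3, (2.6) p.424] -/
theorem norm_le_majorant_of_pieces (w : ScalarField P 0 N) (wp : ℕ → ScalarField P 0 N) (hw : ∑ j ∈ Finset.range k, wp j = w)
    (x' : HiggsLattice.Site P 0) {aw cw : ℝ}
    (hwv : ∀ (j : ℕ) (y : HiggsLattice.Site P 0), ‖wp j y‖ ≤ cw * P.mesh j ^ (aw - (P.d : ℝ)) *
      Real.exp (-(δ₁ * (P.mesh j)⁻¹ * (P.mesh 0 * (HiggsLattice.Site.tdist y x' : ℝ))))) (y : HiggsLattice.Site P 0) :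
    ‖w y‖ ≤ ∑ j ∈ Finset.range k, cw * P.mesh j ^ (aw - (P.d : ℝ)) *
      Real.exp (-(δ₁ * (P.mesh j)⁻¹ * (P.mesh 0 * (HiggsLattice.Site.tdist y x' : ℝ)))) := by
  rw [← hw, Finset.sum_apply]
  exact (norm_sum_le _ _).trans (Finset.sum_le_sum fun j _ => hwv j y)

/-- **THE `M^*M` SOURCES through `D^ε_BG_k(T_ε,B)`** (`|e|s`-squared, the differentiated column of `G_k(T,B)` against the value of `w`;
exponents `1 + a_w`, no cancellation needed):
`Σ_b‖(D^ε_BG_k(T,B)srcMM_b w)(b₀)‖ ≤ (|e|s)²·d·e²ε^dC·c_w·K(G₁+G_{a_w})·Σ_{j<k}(L^jε)^{a_w+1−d}e^{δ₁/2}_j(b₀₋,x′)` (p33's `sum_bond_kernel_mul_le`).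
[cite: Balaban1983Higgs3, (1.16) p.414, (2.6) p.424, (2.10) p.426] [cite: Balaban1982Higgs1, (3.16) p.615] -/
theorem mm_le (hmsq : 0 < msq) (ha : 0 < a) (hk : 1 ≤ k) (hkK : k ≤ P.K) (hδ₁ : 0 < δ₁) (hδ₁1 : δ₁ ≤ 1) (hCst : 0 ≤ Cst)
    (hs : 0 ≤ s) (h210B : (regRegionKernels hL1 C Finset.univ B msq a k K₀).Ineq210 δ₁ Cst)
    (hA : ∀ b : HiggsLattice.PBond P 0, |A b| ≤ s) (i₀ : Ix N) (b₀ : HiggsLattice.PBond P 0) (x' : HiggsLattice.Site P 0)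
    (w : ScalarField P 0 N) (wp : ℕ → ScalarField P 0 N) (hw : ∑ j ∈ Finset.range k, wp j = w) {aw cw : ℝ} (haw : 0 < aw)
    (hcw : 0 ≤ cw)
    (hwv : ∀ (j : ℕ) (y : HiggsLattice.Site P 0), ‖wp j y‖ ≤ cw * P.mesh j ^ (aw - (P.d : ℝ)) *
      Real.exp (-(δ₁ * (P.mesh j)⁻¹ * (P.mesh 0 * (HiggsLattice.Site.tdist y x' : ℝ))))) :
    ∑ b : HiggsLattice.PBond P 0, ‖covDeriv C B (propagatorK C Finset.univ B msq a k (srcMM C A B b w)) b₀‖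
      ≤ (P.d : ℝ) * ∑ j ∈ Finset.range k, ((Real.exp 1 * (P.mesh 0 ^ P.d * Cst)) * (Real.exp 1 * ((|C.e| * s) ^ 2 * cw)) *
            ((nCol N : ℝ) * (8 * P.d / δ₁) ^ P.d * (P.mesh 0 ^ P.d)⁻¹ *
              ((P.L : ℝ) ^ (1 : ℝ) / ((P.L : ℝ) ^ (1 : ℝ) - 1) + (P.L : ℝ) ^ aw / ((P.L : ℝ) ^ aw - 1)))) *
          P.mesh j ^ ((1 : ℝ) + aw - (P.d : ℝ)) *
          Real.exp (-(δ₁ / 2 * (P.mesh j)⁻¹ * (P.mesh 0 * (HiggsLattice.Site.tdist b₀.src x' : ℝ)))) := by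
  have hes : 0 ≤ (|C.e| * s) ^ 2 := pow_nonneg (mul_nonneg (abs_nonneg _) hs) 2
  have hc : 0 ≤ P.mesh 0 ^ P.d * Cst := mul_nonneg (pow_nonneg (P.mesh_pos 0).le _) hCst
  have step1 : ∑ b : HiggsLattice.PBond P 0, ‖covDeriv C B (propagatorK C Finset.univ B msq a k (srcMM C A B b w)) b₀‖
      ≤ ∑ b : HiggsLattice.PBond P 0, dcol C msq a k B B b₀ b.tgt * ((|C.e| * s) ^ 2 * ‖w b.tgt‖) := by
    refine Finset.sum_le_sum fun b _ => ?_
    have h := norm_mapE_srcMM_le C A B (covDerivAt C B b₀ ∘ₗ propagatorK C Finset.univ B msq a k) (hA b) w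
    simp only [LinearMap.coe_comp, Function.comp_apply, covDerivAt_apply] at h
    refine h.trans (le_of_eq ?_)
    rw [dcol]; ring
  refine step1.trans ?_
  refine sum_bond_kernel_mul_le hL1 hδ₁ hδ₁1 one_pos haw (mul_nonneg (Real.exp_nonneg _) hc)
    (mul_nonneg (Real.exp_nonneg _) (mul_nonneg hes hcw)) i₀ b₀.src x' _ _ (fun b => dcol_nonneg _ _ _ _)
    (fun b => mul_nonneg hes (norm_nonneg _)) (fun b => ?_) (fun b => ?_)
  · exact (dcol_le h210B hmsq ha hk hkK b₀ b.tgt).trans (majorant_shift_le hδ₁ hδ₁1 hc b₀.src b.src b.dir)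
  · have h1 := norm_le_majorant_of_pieces w wp hw x' hwv b.tgt
    have h2 := majorant_shift_le' (k := k) (a := aw - (P.d : ℝ)) hδ₁ hδ₁1 hcw b.src x' b.dir
    calc (|C.e| * s) ^ 2 * ‖w b.tgt‖
        ≤ (|C.e| * s) ^ 2 * ∑ j ∈ Finset.range k, (Real.exp 1 * cw) * P.mesh j ^ (aw - (P.d : ℝ)) *
            Real.exp (-(δ₁ * (P.mesh j)⁻¹ * (P.mesh 0 * (HiggsLattice.Site.tdist b.src x' : ℝ)))) :=
          mul_le_mul_of_nonneg_left (h1.trans h2) hes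
      _ = _ := by rw [Finset.mul_sum]; exact Finset.sum_congr rfl fun j _ => by ring

/-- **THE AVERAGING SOURCES through `D^ε_BG_k(T_ε,B)`**: the block average of `‖w‖` is a top-scale bump of exponent `a_w`
(`block_avg_majorant_le`), read against the differentiated column (p33's `sum_kernel_mul_le` at range `k + 1`, rate `δ₁/2`):
`‖(D^ε_BG_k(T,B)avgSrc w)(b₀)‖ ≤ m(2+m)·Σ_{j≤k} C_avg(L^jε)^{1+a_w−d}e^{δ₁/4}_j(b₀₋,x′)`, `m = |e|sεd(L^k−1)`.
[cite: Balaban1982Higgs1, (3.15) p.614, (3.16) p.615] [cite: Balaban1983Higgs3, (1.16) p.414, (2.10) p.426] -/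
theorem avg_le (hmsq : 0 < msq) (ha : 0 < a) (hk : 1 ≤ k) (hkK : k ≤ P.K) (hδ₁ : 0 < δ₁) (hδ₁1 : δ₁ ≤ 1) (hCst : 0 ≤ Cst)
    (hs : 0 ≤ s) (h210B : (regRegionKernels hL1 C Finset.univ B msq a k K₀).Ineq210 δ₁ Cst)
    (hA : ∀ b : HiggsLattice.PBond P 0, |A b| ≤ s) (i₀ : Ix N) (b₀ : HiggsLattice.PBond P 0) (x' : HiggsLattice.Site P 0)
    (w : ScalarField P 0 N) (wp : ℕ → ScalarField P 0 N) (hw : ∑ j ∈ Finset.range k, wp j = w) {aw cw : ℝ} (haw : 0 < aw)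
    (hcw : 0 ≤ cw)
    (hwv : ∀ (j : ℕ) (y : HiggsLattice.Site P 0), ‖wp j y‖ ≤ cw * P.mesh j ^ (aw - (P.d : ℝ)) *
      Real.exp (-(δ₁ * (P.mesh j)⁻¹ * (P.mesh 0 * (HiggsLattice.Site.tdist y x' : ℝ))))) :
    ‖covDeriv C B (propagatorK C Finset.univ B msq a k (avgSrc C A B k w)) b₀‖
      ≤ ((|C.e| * s * P.mesh 0 * (P.d * ((P.L : ℝ) ^ k - 1))) * (2 + |C.e| * s * P.mesh 0 * (P.d * ((P.L : ℝ) ^ k - 1)))) *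
        ∑ j ∈ Finset.range (k + 1), ((P.mesh 0 ^ P.d * Cst) *
            ((Real.exp (δ₁ / 2) * ((nCol N : ℝ) * (4 * P.d / (δ₁ / 2)) ^ P.d) / ((P.L : ℝ) ^ aw - 1)) * cw) *
            ((nCol N : ℝ) * (8 * P.d / (δ₁ / 2)) ^ P.d * (P.mesh 0 ^ P.d)⁻¹ *
              ((P.L : ℝ) ^ (1 : ℝ) / ((P.L : ℝ) ^ (1 : ℝ) - 1) + (P.L : ℝ) ^ aw / ((P.L : ℝ) ^ aw - 1)))) *
          P.mesh j ^ ((1 : ℝ) + aw - (P.d : ℝ)) *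
          Real.exp (-(δ₁ / 2 / 2 * (P.mesh j)⁻¹ * (P.mesh 0 * (HiggsLattice.Site.tdist b₀.src x' : ℝ)))) := by
  have hL1' : (1 : ℝ) < (P.L : ℝ) := by exact_mod_cast hL1
  have hε := P.mesh_pos 0
  have hc : 0 ≤ P.mesh 0 ^ P.d * Cst := mul_nonneg (pow_nonneg hε.le _) hCst
  set m : ℝ := |C.e| * s * P.mesh 0 * (P.d * ((P.L : ℝ) ^ k - 1)) with hm
  have hLk1 : (1 : ℝ) ≤ (P.L : ℝ) ^ k := one_le_pow₀ hL1'.le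
  have hm0 : 0 ≤ m := by
    have : (0 : ℝ) ≤ (P.L : ℝ) ^ k - 1 := by linarith
    rw [hm]; positivity
  set Cb : ℝ := (Real.exp (δ₁ / 2) * ((nCol N : ℝ) * (4 * P.d / (δ₁ / 2)) ^ P.d) / ((P.L : ℝ) ^ aw - 1)) * cw with hCb
  have hCb0 : 0 ≤ Cb := by
    have h1 : 0 < (P.L : ℝ) ^ aw - 1 := by have := Real.one_lt_rpow hL1' haw; linarith
    have h2 : 0 ≤ (4 * (P.d : ℝ) / (δ₁ / 2)) ^ P.d := pow_nonneg (by positivity) _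
    rw [hCb]; positivity
  -- the averaging sources through the functional: block averages of `‖w‖` against the differentiated column
  have step1 := norm_mapE_avgSrc_le_block (C := C) (A := A) (B := B) (k := k)
    (covDerivAt C B b₀ ∘ₗ propagatorK C Finset.univ B msq a k) hkK hs hA w
  simp only [LinearMap.coe_comp, Function.comp_apply, covDerivAt_apply] at step1
  -- each block average is a top bump of exponent `a_w`
  have hblk : ∀ y : HiggsLattice.Site P 0,
      ((P.L : ℝ) ^ (k * P.d))⁻¹ * ∑ x ∈ blockK k (blockIter k y), ‖w x‖
        ≤ Cb * (P.mesh k ^ aw * (P.mesh k ^ P.d)⁻¹) *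
          Real.exp (-(δ₁ / 2 * (P.mesh k)⁻¹ * (P.mesh 0 * (HiggsLattice.Site.tdist y x' : ℝ)))) := by
    intro y
    have h := block_avg_majorant_le (N := N) hL1 hk hkK hδ₁ hδ₁1 hcw haw i₀ (fun x => ‖w x‖) y x'
      (fun x _ => norm_le_majorant_of_pieces w wp hw x' hwv x)
    refine h.trans (le_of_eq ?_)
    rw [hCb]
  -- the column against the bump: two kernels at range `k + 1`, rate `δ₁/2`
  have hδ2 : 0 < δ₁ / 2 := half_pos hδ₁
  have hδ21 : δ₁ / 2 ≤ 1 := by linarith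
  have step2 : ∑ y : HiggsLattice.Site P 0, dcol C msq a k B B b₀ y *
        (((P.L : ℝ) ^ (k * P.d))⁻¹ * ∑ x ∈ blockK k (blockIter k y), ‖w x‖)
      ≤ ∑ j ∈ Finset.range (k + 1), ((P.mesh 0 ^ P.d * Cst) * Cb *
            ((nCol N : ℝ) * (8 * P.d / (δ₁ / 2)) ^ P.d * (P.mesh 0 ^ P.d)⁻¹ *
              ((P.L : ℝ) ^ (1 : ℝ) / ((P.L : ℝ) ^ (1 : ℝ) - 1) + (P.L : ℝ) ^ aw / ((P.L : ℝ) ^ aw - 1)))) *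
          P.mesh j ^ ((1 : ℝ) + aw - (P.d : ℝ)) *
          Real.exp (-(δ₁ / 2 / 2 * (P.mesh j)⁻¹ * (P.mesh 0 * (HiggsLattice.Site.tdist b₀.src x' : ℝ)))) := by
    refine sum_kernel_mul_le hL1 hδ2 hδ21 one_pos haw hc hCb0 i₀ b₀.src x' _ _ (fun y => dcol_nonneg _ _ _ _)
      (fun y => mul_nonneg (inv_nonneg.mpr (pow_nonneg (Nat.cast_nonneg _) _)) (Finset.sum_nonneg fun _ _ => norm_nonneg _))
      (fun y => ?_) (fun y => ?_)
    · exact (dcol_le h210B hmsq ha hk hkK b₀ y).trans (majorant_mono hc (by linarith) (Nat.le_succ k) b₀.src y)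
    · refine (hblk y).trans ?_
      rw [mesh_rpow_mul_inv_pow_eq]
      exact top_bump_le_majorant_succ hCb0 y x'
  calc ‖covDeriv C B (propagatorK C Finset.univ B msq a k (avgSrc C A B k w)) b₀‖
      ≤ ∑ y : HiggsLattice.Site P 0, (m * (2 + m) * (((P.L : ℝ) ^ (k * P.d))⁻¹ * ∑ x ∈ blockK k (blockIter k y), ‖w x‖)) *
          dcol C msq a k B B b₀ y := by
        refine step1.trans (le_of_eq (Finset.sum_congr rfl fun y _ => ?_))
        rw [dcol]
    _ = m * (2 + m) * ∑ y : HiggsLattice.Site P 0, dcol C msq a k B B b₀ y *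
          (((P.L : ℝ) ^ (k * P.d))⁻¹ * ∑ x ∈ blockK k (blockIter k y), ‖w x‖) := by
        rw [Finset.mul_sum]; exact Finset.sum_congr rfl fun y _ => by ring
    _ ≤ _ := mul_le_mul_of_nonneg_left step2 (mul_nonneg hm0 (by linarith))

end Totals

/-! ## §5 Conversions: rate weakening, one exponent step costs `L^kε`, the constants -/

section Conversions

variable {k : ℕ}

/-- A constant-free majorant sum is nonnegative. [cite: Balaban1983Higgs3, (2.10) p.426] -/
theorem sumS_nonneg (e δ : ℝ) (u v : HiggsLattice.Site P 0) :
    0 ≤ ∑ j ∈ Finset.range k, P.mesh j ^ e * Real.exp (-(δ * (P.mesh j)⁻¹ * (P.mesh 0 * (HiggsLattice.Site.tdist u v : ℝ)))) :=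
  Finset.sum_nonneg fun j _ => mul_nonneg (Real.rpow_nonneg (P.mesh_pos j).le e) (Real.exp_nonneg _)

/-- Rate weakening of a constant-free majorant sum (`δ′ ≤ δ`). [cite: Balaban1983Higgs3, (2.10) p.426] -/
theorem sumS_rate_mono {e δ δ' : ℝ} (hδ : δ' ≤ δ) (u v : HiggsLattice.Site P 0) :
    ∑ j ∈ Finset.range k, P.mesh j ^ e * Real.exp (-(δ * (P.mesh j)⁻¹ * (P.mesh 0 * (HiggsLattice.Site.tdist u v : ℝ))))
      ≤ ∑ j ∈ Finset.range k, P.mesh j ^ e * Real.exp (-(δ' * (P.mesh j)⁻¹ * (P.mesh 0 * (HiggsLattice.Site.tdist u v : ℝ)))) :=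
  Finset.sum_le_sum fun j _ => mul_le_mul_of_nonneg_left (bump_mono_rate hδ j u v) (Real.rpow_nonneg (P.mesh_pos j).le e)

/-- **One unit of exponent costs at most the top scale**: `Σ_{j<k}(L^jε)^{e+1−d}e_j ≤ (L^kε)·Σ_{j<k}(L^jε)^{e−d}e_j` (`L^jε ≤ L^kε` for `j < k`).
[cite: Balaban1983Higgs3, (2.6) p.424, (2.10) p.426] -/
theorem sumS_succ_le (e δ : ℝ) (u v : HiggsLattice.Site P 0) :
    ∑ j ∈ Finset.range k, P.mesh j ^ (e + 1 - (P.d : ℝ)) * Real.exp (-(δ * (P.mesh j)⁻¹ * (P.mesh 0 * (HiggsLattice.Site.tdist u v : ℝ))))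
      ≤ P.mesh k * ∑ j ∈ Finset.range k, P.mesh j ^ (e - (P.d : ℝ)) *
          Real.exp (-(δ * (P.mesh j)⁻¹ * (P.mesh 0 * (HiggsLattice.Site.tdist u v : ℝ)))) := by
  rw [Finset.mul_sum]
  refine Finset.sum_le_sum fun j hj => ?_
  have hjk : P.mesh j ≤ P.mesh k := B3Ineq210RegularTorus.mesh_mono P (Finset.mem_range.1 hj).le
  have hsplit : P.mesh j ^ (e + 1 - (P.d : ℝ)) = P.mesh j * P.mesh j ^ (e - (P.d : ℝ)) := by
    rw [show e + 1 - (P.d : ℝ) = 1 + (e - (P.d : ℝ)) by ring, ← mesh_rpow_add, Real.rpow_one]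
  rw [hsplit, mul_assoc, mul_assoc]
  exact mul_le_mul_of_nonneg_right hjk (mul_nonneg (Real.rpow_nonneg (P.mesh_pos j).le _) (Real.exp_nonneg _))

/-- The same over the range `k + 1` with the factor `(L^kε)^{−1}` on the left: `(L^kε)^{−1}Σ_{j≤k}c(L^jε)^{1+e−d}e_j ≤ Σ_{j≤k}c(L^jε)^{e−d}e_j`.
[cite: Balaban1983Higgs3, (2.6) p.424, (2.10) p.426] -/
theorem inv_mesh_mul_sum_succ_le {c : ℝ} (hc : 0 ≤ c) (e δ : ℝ) (u v : HiggsLattice.Site P 0) :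
    (P.mesh k)⁻¹ * ∑ j ∈ Finset.range (k + 1), c * P.mesh j ^ ((1 : ℝ) + e - (P.d : ℝ)) *
        Real.exp (-(δ * (P.mesh j)⁻¹ * (P.mesh 0 * (HiggsLattice.Site.tdist u v : ℝ))))
      ≤ ∑ j ∈ Finset.range (k + 1), c * P.mesh j ^ (e - (P.d : ℝ)) *
          Real.exp (-(δ * (P.mesh j)⁻¹ * (P.mesh 0 * (HiggsLattice.Site.tdist u v : ℝ)))) := by
  have hk0 := P.mesh_pos k
  rw [Finset.mul_sum]
  refine Finset.sum_le_sum fun j hj => ?_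
  have hjk : P.mesh j ≤ P.mesh k := B3Ineq210RegularTorus.mesh_mono P (by have := Finset.mem_range.1 hj; omega)
  have hsplit : P.mesh j ^ ((1 : ℝ) + e - (P.d : ℝ)) = P.mesh j * P.mesh j ^ (e - (P.d : ℝ)) := by
    rw [show (1 : ℝ) + e - (P.d : ℝ) = 1 + (e - (P.d : ℝ)) by ring, ← mesh_rpow_add, Real.rpow_one]
  have hratio : (P.mesh k)⁻¹ * P.mesh j ≤ 1 := by rw [inv_mul_le_iff₀ hk0]; linarith
  have hrest : 0 ≤ c * P.mesh j ^ (e - (P.d : ℝ)) * Real.exp (-(δ * (P.mesh j)⁻¹ * (P.mesh 0 * (HiggsLattice.Site.tdist u v : ℝ)))) :=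
    mul_nonneg (mul_nonneg hc (Real.rpow_nonneg (P.mesh_pos j).le _)) (Real.exp_nonneg _)
  rw [hsplit]
  calc (P.mesh k)⁻¹ * (c * (P.mesh j * P.mesh j ^ (e - (P.d : ℝ))) *
          Real.exp (-(δ * (P.mesh j)⁻¹ * (P.mesh 0 * (HiggsLattice.Site.tdist u v : ℝ)))))
      = ((P.mesh k)⁻¹ * P.mesh j) * (c * P.mesh j ^ (e - (P.d : ℝ)) *
          Real.exp (-(δ * (P.mesh j)⁻¹ * (P.mesh 0 * (HiggsLattice.Site.tdist u v : ℝ))))) := by ring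
    _ ≤ 1 * (c * P.mesh j ^ (e - (P.d : ℝ)) * Real.exp (-(δ * (P.mesh j)⁻¹ * (P.mesh 0 * (HiggsLattice.Site.tdist u v : ℝ))))) :=
        mul_le_mul_of_nonneg_right hratio hrest
    _ = _ := one_mul _

/-- `ε⁻¹·(L^kε) = L^k`. [cite: Balaban1982Higgs1, (1.19) p.607] -/
theorem inv_mesh_zero_mul_mesh (k : ℕ) : (P.mesh 0)⁻¹ * P.mesh k = (P.L : ℝ) ^ k := by
  rw [B3Ineq210RegularTorus.mesh_eq_pow_mul P k, mul_comm ((P.L : ℝ) ^ k), ← mul_assoc, inv_mul_cancel₀ (P.mesh_pos 0).ne', one_mul]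

/-- The size `m = |e|sεd(L^k − 1)` of the averaging difference `F_{2,k}` is at most `d·(L^kε)|e|s`. [cite: Balaban1982Higgs1, (3.15) p.614] -/
theorem mF2_le {s : ℝ} (hs : 0 ≤ s) (C : ChargeData N) (k : ℕ) :
    |C.e| * s * P.mesh 0 * (P.d * ((P.L : ℝ) ^ k - 1)) ≤ (P.d : ℝ) * (P.mesh k * (|C.e| * s)) := by
  have hε := P.mesh_pos 0
  have hes : 0 ≤ |C.e| * s := mul_nonneg (abs_nonneg _) hs
  rw [B3Ineq210RegularTorus.mesh_eq_pow_mul P k]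
  have h1 : (P.L : ℝ) ^ k - 1 ≤ (P.L : ℝ) ^ k := by linarith
  have h2 : 0 ≤ |C.e| * s * P.mesh 0 * (P.d : ℝ) := by positivity
  nlinarith [mul_le_mul_of_nonneg_left h1 h2]

end Conversions

/-! ## §6 THE ROW THEOREM: `D^ε_BG_k(T_ε,B)V_k(A,B)` on a multi-scale field is `(|e|s·K₁ + L^k|e|δ_A·K₂)`× an exponent-`a_w` majorant -/

section RowTheorem

/-- The lattice-sum constant `N(8d/δ)^d` of the two-scale convolution (p33's `conv2_scales_le`). [cite: Balaban1983Higgs3, (2.10) p.426] -/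
def kC (P : HiggsLattice.Params) (N : ℕ) (δ : ℝ) : ℝ := (nCol N : ℝ) * (8 * P.d / δ) ^ P.d

/-- The geometric constant `L^e/(L^e − 1)` of the finer-index sum (FILE E `sum_mesh_rpow_le`). [cite: Balaban1983Higgs3, (2.6) p.424] -/
def gE (P : HiggsLattice.Params) (e : ℝ) : ℝ := (P.L : ℝ) ^ e / ((P.L : ℝ) ^ e - 1)

/-- **The constant `K₂` of the row theorem** (coefficient of `L^k|e|δ_A`: the `N`-terms of the two Leibniz forms).
[cite: Balaban1983Higgs3, (1.16) p.414] [cite: Balaban1982Higgs1, (2.23) p.610, (3.16) p.615] -/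
def seedK2 (P : HiggsLattice.Params) (N : ℕ) (δ₁ Cst aw cw : ℝ) : ℝ :=
  (gE P aw + gE P 1) * ((P.d : ℝ) * (Cst * cw * kC P N δ₁))

/-- **The constant `K₁` of the row theorem** (coefficient of `|e|s`: the four pair families, the `M^*M` sources, the averaging sources).
[cite: Balaban1983Higgs3, (1.16) p.414] [cite: Balaban1982Higgs1, (3.14)–(3.16) pp.614–615] -/
def seedK1 (P : HiggsLattice.Params) (N : ℕ) (δ₁ Cst CM a aw cw cw' : ℝ) : ℝ :=
  gE P 1 * ((P.d : ℝ) * (Real.exp 1 * Cst * cw' * kC P N δ₁)) + gE P aw * ((P.d : ℝ) * (CM * cw * kC P N δ₁))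
  + (gE P aw * ((P.d : ℝ) * (CM * Real.exp 1 * cw * kC P N δ₁)) + gE P 1 * ((P.d : ℝ) * (Cst * cw' * kC P N δ₁)))
  + (P.d : ℝ) * (Real.exp 1 * Cst * (Real.exp 1 * cw) * (kC P N δ₁ * (gE P 1 + gE P aw)))
  + a * ((P.d : ℝ) * (2 + P.d)) * (1 + (P.L : ℝ) ^ (aw - (P.d : ℝ))) *
      (Cst * ((Real.exp (δ₁ / 2) * ((nCol N : ℝ) * (4 * P.d / (δ₁ / 2)) ^ P.d) / ((P.L : ℝ) ^ aw - 1)) * cw) *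
        (kC P N (δ₁ / 2) * (gE P 1 + gE P aw)))

variable {C : ChargeData N} {A B : HiggsLattice.VecField P 0} {msq a : ℝ} {k K₀ : ℕ} {hL1 : 1 < P.L} {δ₁ Cst CM s δA : ℝ}

/-! ### §6.1 Arithmetic of the assembly (pure real-number lemmas: each of the four bounds against the target majorant sum)

The four conversions are kept OUT of the main proof on purpose: their `positivity`/`field_simp` steps scan the local context, which
in the main theorem holds the four operator bounds. -/

/-- MD conversion: `A·S(a_w,δ₁/2) + B·S(a_w+1,δ₁/2) ≤ (|e|s·α_MD + L^k|e|δ_A·β_MD)·S(a_w,δ₁/(4L))` (`ε^d·(ε^d)⁻¹ = 1`, one exponent unit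
`≤ L^kε`, `ε⁻¹L^kε = L^k`, rate weakening). [cite: Balaban1983Higgs3, (2.6) p.424, (2.10) p.426] -/
theorem md_arith (hL1 : 1 < P.L) {aw cw cw' X : ℝ} (haw : 0 < aw) (hCst : 0 ≤ Cst) (hCM : 0 ≤ CM) (hcw : 0 ≤ cw) (hcw' : 0 ≤ cw')
    (hs : 0 ≤ s) (hδA : 0 ≤ δA) (hδ₁ : 0 < δ₁) (u v : HiggsLattice.Site P 0)
    (hX : X ≤ ((P.L : ℝ) ^ (1 : ℝ) / ((P.L : ℝ) ^ (1 : ℝ) - 1) *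
            ((P.d : ℝ) * ((Real.exp 1 * (P.mesh 0 ^ P.d * Cst)) * (|C.e| * s * cw') *
              ((nCol N : ℝ) * (8 * P.d / δ₁) ^ P.d * (P.mesh 0 ^ P.d)⁻¹)))
          + (P.L : ℝ) ^ aw / ((P.L : ℝ) ^ aw - 1) *
            ((P.d : ℝ) * ((P.mesh 0 ^ P.d * CM) * (|C.e| * s * cw) *
              ((nCol N : ℝ) * (8 * P.d / δ₁) ^ P.d * (P.mesh 0 ^ P.d)⁻¹)))) *
          ∑ j ∈ Finset.range k, P.mesh j ^ (aw - (P.d : ℝ)) *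
            Real.exp (-(δ₁ / 2 * (P.mesh j)⁻¹ * (P.mesh 0 * (HiggsLattice.Site.tdist u v : ℝ))))
        + (P.L : ℝ) ^ aw / ((P.L : ℝ) ^ aw - 1) *
            ((P.d : ℝ) * ((P.mesh 0 ^ P.d * Cst) * ((P.mesh 0)⁻¹ * (|C.e| * δA) * cw) *
              ((nCol N : ℝ) * (8 * P.d / δ₁) ^ P.d * (P.mesh 0 ^ P.d)⁻¹))) *
          ∑ j ∈ Finset.range k, P.mesh j ^ (aw + 1 - (P.d : ℝ)) *
            Real.exp (-(δ₁ / 2 * (P.mesh j)⁻¹ * (P.mesh 0 * (HiggsLattice.Site.tdist u v : ℝ))))) :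
    X ≤ (|C.e| * s * (gE P 1 * ((P.d : ℝ) * (Real.exp 1 * Cst * cw' * kC P N δ₁)) + gE P aw * ((P.d : ℝ) * (CM * cw * kC P N δ₁)))
          + (P.L : ℝ) ^ k * (|C.e| * δA) * (gE P aw * ((P.d : ℝ) * (Cst * cw * kC P N δ₁)))) *
        ∑ j ∈ Finset.range k, P.mesh j ^ (aw - (P.d : ℝ)) *
          Real.exp (-(δ₁ / 2 / 2 / P.L * (P.mesh j)⁻¹ * (P.mesh 0 * (HiggsLattice.Site.tdist u v : ℝ)))) := by
  have hL1' : (1 : ℝ) < (P.L : ℝ) := by exact_mod_cast hL1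
  have hL0 : (0 : ℝ) < (P.L : ℝ) := by linarith
  have hε := P.mesh_pos 0
  have hmk := P.mesh_pos k
  have hG1d : (P.L : ℝ) ^ (1 : ℝ) - 1 ≠ 0 := by rw [Real.rpow_one]; linarith
  have hGad : (P.L : ℝ) ^ aw - 1 ≠ 0 := by have := Real.one_lt_rpow hL1' haw; linarith
  have hG10 : 0 ≤ (P.L : ℝ) ^ (1 : ℝ) / ((P.L : ℝ) ^ (1 : ℝ) - 1) := by
    rw [Real.rpow_one]; exact div_nonneg hL0.le (by linarith)
  have hGa0 : 0 ≤ (P.L : ℝ) ^ aw / ((P.L : ℝ) ^ aw - 1) := by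
    have := Real.one_lt_rpow hL1' haw; exact div_nonneg (by linarith) (by linarith)
  set U0 : ℝ := P.mesh 0 ^ P.d with hU0
  have hU00 : 0 < U0 := by rw [hU0]; positivity
  set D : ℝ := P.mesh 0 * (HiggsLattice.Site.tdist u v : ℝ) with hD
  set S' : ℝ := ∑ j ∈ Finset.range k, P.mesh j ^ (aw - (P.d : ℝ)) * Real.exp (-(δ₁ / 2 / 2 / P.L * (P.mesh j)⁻¹ * D)) with hS'
  set S2 : ℝ := ∑ j ∈ Finset.range k, P.mesh j ^ (aw - (P.d : ℝ)) * Real.exp (-(δ₁ / 2 * (P.mesh j)⁻¹ * D)) with hS2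
  set S2p : ℝ := ∑ j ∈ Finset.range k, P.mesh j ^ (aw + 1 - (P.d : ℝ)) * Real.exp (-(δ₁ / 2 * (P.mesh j)⁻¹ * D)) with hS2p
  have hrate : δ₁ / 2 / 2 / P.L ≤ δ₁ / 2 := by
    rw [div_div, div_le_iff₀ (by positivity)]
    have : 0 ≤ δ₁ / 2 := by positivity
    nlinarith
  have hS2S' : S2 ≤ S' := sumS_rate_mono hrate u v
  have hS2pS' : S2p ≤ P.mesh k * S' := (sumS_succ_le aw (δ₁ / 2) u v).trans (mul_le_mul_of_nonneg_left hS2S' hmk.le)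
  set G1 : ℝ := (P.L : ℝ) ^ (1 : ℝ) / ((P.L : ℝ) ^ (1 : ℝ) - 1) with hG1
  set Ga : ℝ := (P.L : ℝ) ^ aw / ((P.L : ℝ) ^ aw - 1) with hGa
  set K0 : ℝ := (nCol N : ℝ) * (8 * P.d / δ₁) ^ P.d with hK0
  have hU0i : 0 ≤ U0⁻¹ := inv_nonneg.mpr hU00.le
  have hεi : 0 ≤ (P.mesh 0)⁻¹ := inv_nonneg.mpr hε.le
  have hA1 : 0 ≤ G1 * ((P.d : ℝ) * ((Real.exp 1 * (U0 * Cst)) * (|C.e| * s * cw') * (K0 * U0⁻¹)))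
      + Ga * ((P.d : ℝ) * ((U0 * CM) * (|C.e| * s * cw) * (K0 * U0⁻¹))) := by positivity
  have hB1 : 0 ≤ Ga * ((P.d : ℝ) * ((U0 * Cst) * ((P.mesh 0)⁻¹ * (|C.e| * δA) * cw) * (K0 * U0⁻¹))) := by positivity
  refine hX.trans ((add_le_add (mul_le_mul_of_nonneg_left hS2S' hA1) (mul_le_mul_of_nonneg_left hS2pS' hB1)).trans (le_of_eq ?_))
  simp only [gE, kC]
  rw [← hG1, ← hGa, ← hK0, ← inv_mesh_zero_mul_mesh k]
  field_simp

/-- DM conversion (the mirror of `md_arith`). [cite: Balaban1983Higgs3, (2.6) p.424, (2.10) p.426] -/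
theorem dm_arith (hL1 : 1 < P.L) {aw cw cw' X : ℝ} (haw : 0 < aw) (hCst : 0 ≤ Cst) (hCM : 0 ≤ CM) (hcw : 0 ≤ cw) (hcw' : 0 ≤ cw')
    (hs : 0 ≤ s) (hδA : 0 ≤ δA) (hδ₁ : 0 < δ₁) (u v : HiggsLattice.Site P 0)
    (hX : X ≤ ((P.L : ℝ) ^ aw / ((P.L : ℝ) ^ aw - 1) *
            ((P.d : ℝ) * ((P.mesh 0 ^ P.d * CM) * (Real.exp 1 * (|C.e| * s * cw)) *
              ((nCol N : ℝ) * (8 * P.d / δ₁) ^ P.d * (P.mesh 0 ^ P.d)⁻¹)))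
          + (P.L : ℝ) ^ (1 : ℝ) / ((P.L : ℝ) ^ (1 : ℝ) - 1) *
            ((P.d : ℝ) * ((P.mesh 0 ^ P.d * Cst) * (|C.e| * s * cw') *
              ((nCol N : ℝ) * (8 * P.d / δ₁) ^ P.d * (P.mesh 0 ^ P.d)⁻¹)))) *
          ∑ j ∈ Finset.range k, P.mesh j ^ (aw - (P.d : ℝ)) *
            Real.exp (-(δ₁ / 2 * (P.mesh j)⁻¹ * (P.mesh 0 * (HiggsLattice.Site.tdist u v : ℝ))))
        + (P.L : ℝ) ^ (1 : ℝ) / ((P.L : ℝ) ^ (1 : ℝ) - 1) *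
            ((P.d : ℝ) * ((P.mesh 0 ^ P.d * Cst) * ((P.mesh 0)⁻¹ * (|C.e| * δA) * cw) *
              ((nCol N : ℝ) * (8 * P.d / δ₁) ^ P.d * (P.mesh 0 ^ P.d)⁻¹))) *
          ∑ j ∈ Finset.range k, P.mesh j ^ (aw + 1 - (P.d : ℝ)) *
            Real.exp (-(δ₁ / 2 * (P.mesh j)⁻¹ * (P.mesh 0 * (HiggsLattice.Site.tdist u v : ℝ))))) :
    X ≤ (|C.e| * s * (gE P aw * ((P.d : ℝ) * (CM * Real.exp 1 * cw * kC P N δ₁)) + gE P 1 * ((P.d : ℝ) * (Cst * cw' * kC P N δ₁)))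
          + (P.L : ℝ) ^ k * (|C.e| * δA) * (gE P 1 * ((P.d : ℝ) * (Cst * cw * kC P N δ₁)))) *
        ∑ j ∈ Finset.range k, P.mesh j ^ (aw - (P.d : ℝ)) *
          Real.exp (-(δ₁ / 2 / 2 / P.L * (P.mesh j)⁻¹ * (P.mesh 0 * (HiggsLattice.Site.tdist u v : ℝ)))) := by
  have hL1' : (1 : ℝ) < (P.L : ℝ) := by exact_mod_cast hL1
  have hL0 : (0 : ℝ) < (P.L : ℝ) := by linarith
  have hε := P.mesh_pos 0
  have hmk := P.mesh_pos k
  have hG1d : (P.L : ℝ) ^ (1 : ℝ) - 1 ≠ 0 := by rw [Real.rpow_one]; linarith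
  have hGad : (P.L : ℝ) ^ aw - 1 ≠ 0 := by have := Real.one_lt_rpow hL1' haw; linarith
  have hG10 : 0 ≤ (P.L : ℝ) ^ (1 : ℝ) / ((P.L : ℝ) ^ (1 : ℝ) - 1) := by
    rw [Real.rpow_one]; exact div_nonneg hL0.le (by linarith)
  have hGa0 : 0 ≤ (P.L : ℝ) ^ aw / ((P.L : ℝ) ^ aw - 1) := by
    have := Real.one_lt_rpow hL1' haw; exact div_nonneg (by linarith) (by linarith)
  set U0 : ℝ := P.mesh 0 ^ P.d with hU0
  have hU00 : 0 < U0 := by rw [hU0]; positivity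
  set D : ℝ := P.mesh 0 * (HiggsLattice.Site.tdist u v : ℝ) with hD
  set S' : ℝ := ∑ j ∈ Finset.range k, P.mesh j ^ (aw - (P.d : ℝ)) * Real.exp (-(δ₁ / 2 / 2 / P.L * (P.mesh j)⁻¹ * D)) with hS'
  set S2 : ℝ := ∑ j ∈ Finset.range k, P.mesh j ^ (aw - (P.d : ℝ)) * Real.exp (-(δ₁ / 2 * (P.mesh j)⁻¹ * D)) with hS2
  set S2p : ℝ := ∑ j ∈ Finset.range k, P.mesh j ^ (aw + 1 - (P.d : ℝ)) * Real.exp (-(δ₁ / 2 * (P.mesh j)⁻¹ * D)) with hS2p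
  have hrate : δ₁ / 2 / 2 / P.L ≤ δ₁ / 2 := by
    rw [div_div, div_le_iff₀ (by positivity)]
    have : 0 ≤ δ₁ / 2 := by positivity
    nlinarith
  have hS2S' : S2 ≤ S' := sumS_rate_mono hrate u v
  have hS2pS' : S2p ≤ P.mesh k * S' := (sumS_succ_le aw (δ₁ / 2) u v).trans (mul_le_mul_of_nonneg_left hS2S' hmk.le)
  set G1 : ℝ := (P.L : ℝ) ^ (1 : ℝ) / ((P.L : ℝ) ^ (1 : ℝ) - 1) with hG1
  set Ga : ℝ := (P.L : ℝ) ^ aw / ((P.L : ℝ) ^ aw - 1) with hGa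
  set K0 : ℝ := (nCol N : ℝ) * (8 * P.d / δ₁) ^ P.d with hK0
  have hU0i : 0 ≤ U0⁻¹ := inv_nonneg.mpr hU00.le
  have hεi : 0 ≤ (P.mesh 0)⁻¹ := inv_nonneg.mpr hε.le
  have hA1 : 0 ≤ Ga * ((P.d : ℝ) * ((U0 * CM) * (Real.exp 1 * (|C.e| * s * cw)) * (K0 * U0⁻¹)))
      + G1 * ((P.d : ℝ) * ((U0 * Cst) * (|C.e| * s * cw') * (K0 * U0⁻¹))) := by positivity
  have hB1 : 0 ≤ G1 * ((P.d : ℝ) * ((U0 * Cst) * ((P.mesh 0)⁻¹ * (|C.e| * δA) * cw) * (K0 * U0⁻¹))) := by positivity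
  refine hX.trans ((add_le_add (mul_le_mul_of_nonneg_left hS2S' hA1) (mul_le_mul_of_nonneg_left hS2pS' hB1)).trans (le_of_eq ?_))
  simp only [gE, kC]
  rw [← hG1, ← hGa, ← hK0, ← inv_mesh_zero_mul_mesh k]
  field_simp

/-- `M^*M` conversion: `d·Σ_j c₃(L^jε)^{1+a_w−d}e_j ≤ |e|s·α_MM·S(a_w,δ₁/(4L))` using `(|e|s)²·L^kε ≤ |e|s` (`t ≤ 1`).
[cite: Balaban1983Higgs3, (2.6) p.424, (2.10) p.426] -/
theorem mm_arith (hL1 : 1 < P.L) {aw cw X : ℝ} (haw : 0 < aw) (hCst : 0 ≤ Cst) (hcw : 0 ≤ cw) (hs : 0 ≤ s) (hδ₁ : 0 < δ₁)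
    (ht1 : P.mesh k * (|C.e| * s) ≤ 1) (u v : HiggsLattice.Site P 0)
    (hX : X ≤ (P.d : ℝ) * ∑ j ∈ Finset.range k, ((Real.exp 1 * (P.mesh 0 ^ P.d * Cst)) * (Real.exp 1 * ((|C.e| * s) ^ 2 * cw)) *
            ((nCol N : ℝ) * (8 * P.d / δ₁) ^ P.d * (P.mesh 0 ^ P.d)⁻¹ *
              ((P.L : ℝ) ^ (1 : ℝ) / ((P.L : ℝ) ^ (1 : ℝ) - 1) + (P.L : ℝ) ^ aw / ((P.L : ℝ) ^ aw - 1)))) *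
          P.mesh j ^ ((1 : ℝ) + aw - (P.d : ℝ)) *
          Real.exp (-(δ₁ / 2 * (P.mesh j)⁻¹ * (P.mesh 0 * (HiggsLattice.Site.tdist u v : ℝ))))) :
    X ≤ |C.e| * s * ((P.d : ℝ) * (Real.exp 1 * Cst * (Real.exp 1 * cw) * (kC P N δ₁ * (gE P 1 + gE P aw)))) *
        ∑ j ∈ Finset.range k, P.mesh j ^ (aw - (P.d : ℝ)) *
          Real.exp (-(δ₁ / 2 / 2 / P.L * (P.mesh j)⁻¹ * (P.mesh 0 * (HiggsLattice.Site.tdist u v : ℝ)))) := by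
  have hL1' : (1 : ℝ) < (P.L : ℝ) := by exact_mod_cast hL1
  have hL0 : (0 : ℝ) < (P.L : ℝ) := by linarith
  have hε := P.mesh_pos 0
  have hmk := P.mesh_pos k
  have hG10 : 0 ≤ (P.L : ℝ) ^ (1 : ℝ) / ((P.L : ℝ) ^ (1 : ℝ) - 1) := by
    rw [Real.rpow_one]; exact div_nonneg hL0.le (by linarith)
  have hGa0 : 0 ≤ (P.L : ℝ) ^ aw / ((P.L : ℝ) ^ aw - 1) := by
    have := Real.one_lt_rpow hL1' haw; exact div_nonneg (by linarith) (by linarith)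
  set U0 : ℝ := P.mesh 0 ^ P.d with hU0
  have hU00 : 0 < U0 := by rw [hU0]; positivity
  set D : ℝ := P.mesh 0 * (HiggsLattice.Site.tdist u v : ℝ) with hD
  set S' : ℝ := ∑ j ∈ Finset.range k, P.mesh j ^ (aw - (P.d : ℝ)) * Real.exp (-(δ₁ / 2 / 2 / P.L * (P.mesh j)⁻¹ * D)) with hS'
  set S2 : ℝ := ∑ j ∈ Finset.range k, P.mesh j ^ (aw - (P.d : ℝ)) * Real.exp (-(δ₁ / 2 * (P.mesh j)⁻¹ * D)) with hS2
  set S2p : ℝ := ∑ j ∈ Finset.range k, P.mesh j ^ (aw + 1 - (P.d : ℝ)) * Real.exp (-(δ₁ / 2 * (P.mesh j)⁻¹ * D)) with hS2p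
  have hS'0 : 0 ≤ S' := sumS_nonneg _ _ u v
  have hrate : δ₁ / 2 / 2 / P.L ≤ δ₁ / 2 := by
    rw [div_div, div_le_iff₀ (by positivity)]
    have : 0 ≤ δ₁ / 2 := by positivity
    nlinarith
  have hS2S' : S2 ≤ S' := sumS_rate_mono hrate u v
  have hS2pS' : S2p ≤ P.mesh k * S' := (sumS_succ_le aw (δ₁ / 2) u v).trans (mul_le_mul_of_nonneg_left hS2S' hmk.le)
  set G1 : ℝ := (P.L : ℝ) ^ (1 : ℝ) / ((P.L : ℝ) ^ (1 : ℝ) - 1) with hG1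
  set Ga : ℝ := (P.L : ℝ) ^ aw / ((P.L : ℝ) ^ aw - 1) with hGa
  set K0 : ℝ := (nCol N : ℝ) * (8 * P.d / δ₁) ^ P.d with hK0
  set c : ℝ := |C.e| * s with hc
  have hc0 : 0 ≤ c := by rw [hc]; positivity
  have hU0i : 0 ≤ U0⁻¹ := inv_nonneg.mpr hU00.le
  set M3 : ℝ := (Real.exp 1 * (U0 * Cst)) * (Real.exp 1 * (c ^ 2 * cw)) * (K0 * U0⁻¹ * (G1 + Ga)) with hM3
  have hM30 : 0 ≤ M3 := by rw [hM3]; positivity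
  have hexp : ∀ j, P.mesh j ^ ((1 : ℝ) + aw - (P.d : ℝ)) = P.mesh j ^ (aw + 1 - (P.d : ℝ)) := fun j => by rw [add_comm (1 : ℝ) aw]
  have h1 : X ≤ (P.d : ℝ) * (M3 * S2p) := by
    refine hX.trans (le_of_eq ?_)
    simp only [hS2p, hM3, Finset.mul_sum, hexp]
    exact Finset.sum_congr rfl fun j _ => by ring
  have h2 : (P.d : ℝ) * (M3 * S2p) ≤ (P.d : ℝ) * (M3 * (P.mesh k * S')) :=
    mul_le_mul_of_nonneg_left (mul_le_mul_of_nonneg_left hS2pS' hM30) (Nat.cast_nonneg _)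
  have hid3 : (P.d : ℝ) * (M3 * (P.mesh k * S'))
      = (P.mesh k * c) * (c * ((P.d : ℝ) * (Real.exp 1 * Cst * (Real.exp 1 * cw) * (K0 * (G1 + Ga)))) * S') := by
    rw [hM3]; field_simp
  have hY : 0 ≤ c * ((P.d : ℝ) * (Real.exp 1 * Cst * (Real.exp 1 * cw) * (K0 * (G1 + Ga)))) * S' := by positivity
  refine h1.trans (h2.trans ?_)
  rw [hid3]
  simp only [gE, kC]
  rw [← hG1, ← hGa, ← hK0]
  calc (P.mesh k * c) * (c * ((P.d : ℝ) * (Real.exp 1 * Cst * (Real.exp 1 * cw) * (K0 * (G1 + Ga)))) * S')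
      ≤ 1 * (c * ((P.d : ℝ) * (Real.exp 1 * Cst * (Real.exp 1 * cw) * (K0 * (G1 + Ga)))) * S') :=
        mul_le_mul_of_nonneg_right ht1 hY
    _ = _ := one_mul _

/-- Averaging conversion: `|a_k(L^kε)^{−2}|·m(2+m)·Σ_{j≤k}c₄(L^jε)^{1+a_w−d}e^{δ₁/4}_j ≤ |e|s·α_AVG·S(a_w,δ₁/(4L))`, using `a_k ≤ a`,
`m ≤ d(L^kε)|e|s ≤ d`, `(L^kε)^{−1}(L^jε)^{1+a_w−d} ≤ (L^jε)^{a_w−d}` and the top bump `j = k` folded into the range at rate `/L`.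
[cite: Balaban1982Higgs1, (3.14)–(3.16) pp.614–615] [cite: Balaban1983Higgs3, (2.6) p.424] -/
theorem avg_arith (hL1 : 1 < P.L) {aw cw X : ℝ} (ha : 0 < a) (hk : 1 ≤ k) (haw : 0 < aw) (hCst : 0 ≤ Cst) (hcw : 0 ≤ cw)
    (hs : 0 ≤ s) (hδ₁ : 0 < δ₁) (ht1 : P.mesh k * (|C.e| * s) ≤ 1) (u v : HiggsLattice.Site P 0) (hX0 : 0 ≤ X)
    (hX : X ≤ ((|C.e| * s * P.mesh 0 * (P.d * ((P.L : ℝ) ^ k - 1))) * (2 + |C.e| * s * P.mesh 0 * (P.d * ((P.L : ℝ) ^ k - 1)))) *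
        ∑ j ∈ Finset.range (k + 1), ((P.mesh 0 ^ P.d * Cst) *
            ((Real.exp (δ₁ / 2) * ((nCol N : ℝ) * (4 * P.d / (δ₁ / 2)) ^ P.d) / ((P.L : ℝ) ^ aw - 1)) * cw) *
            ((nCol N : ℝ) * (8 * P.d / (δ₁ / 2)) ^ P.d * (P.mesh 0 ^ P.d)⁻¹ *
              ((P.L : ℝ) ^ (1 : ℝ) / ((P.L : ℝ) ^ (1 : ℝ) - 1) + (P.L : ℝ) ^ aw / ((P.L : ℝ) ^ aw - 1)))) *
          P.mesh j ^ ((1 : ℝ) + aw - (P.d : ℝ)) *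
          Real.exp (-(δ₁ / 2 / 2 * (P.mesh j)⁻¹ * (P.mesh 0 * (HiggsLattice.Site.tdist u v : ℝ))))) :
    |B1.aSeq a P.L k * (P.mesh k)⁻¹ ^ 2| * X
      ≤ |C.e| * s * (a * ((P.d : ℝ) * (2 + P.d)) * (1 + (P.L : ℝ) ^ (aw - (P.d : ℝ))) *
          (Cst * ((Real.exp (δ₁ / 2) * ((nCol N : ℝ) * (4 * P.d / (δ₁ / 2)) ^ P.d) / ((P.L : ℝ) ^ aw - 1)) * cw) *
            (kC P N (δ₁ / 2) * (gE P 1 + gE P aw)))) *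
        ∑ j ∈ Finset.range k, P.mesh j ^ (aw - (P.d : ℝ)) *
          Real.exp (-(δ₁ / 2 / 2 / P.L * (P.mesh j)⁻¹ * (P.mesh 0 * (HiggsLattice.Site.tdist u v : ℝ)))) := by
  have hL1' : (1 : ℝ) < (P.L : ℝ) := by exact_mod_cast hL1
  have hL0 : (0 : ℝ) < (P.L : ℝ) := by linarith
  have hε := P.mesh_pos 0
  have hmk := P.mesh_pos k
  have hG10 : 0 ≤ (P.L : ℝ) ^ (1 : ℝ) / ((P.L : ℝ) ^ (1 : ℝ) - 1) := by
    rw [Real.rpow_one]; exact div_nonneg hL0.le (by linarith)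
  have hGa1 : 0 < (P.L : ℝ) ^ aw - 1 := by have := Real.one_lt_rpow hL1' haw; linarith
  have hGa0 : 0 ≤ (P.L : ℝ) ^ aw / ((P.L : ℝ) ^ aw - 1) := by
    have := Real.one_lt_rpow hL1' haw; exact div_nonneg (by linarith) (by linarith)
  set U0 : ℝ := P.mesh 0 ^ P.d with hU0
  have hU00 : 0 < U0 := by rw [hU0]; positivity
  set D : ℝ := P.mesh 0 * (HiggsLattice.Site.tdist u v : ℝ) with hD
  set S' : ℝ := ∑ j ∈ Finset.range k, P.mesh j ^ (aw - (P.d : ℝ)) * Real.exp (-(δ₁ / 2 / 2 / P.L * (P.mesh j)⁻¹ * D)) with hS'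
  have hS'0 : 0 ≤ S' := sumS_nonneg _ _ u v
  set G1 : ℝ := (P.L : ℝ) ^ (1 : ℝ) / ((P.L : ℝ) ^ (1 : ℝ) - 1) with hG1
  set Ga : ℝ := (P.L : ℝ) ^ aw / ((P.L : ℝ) ^ aw - 1) with hGa
  set K0h : ℝ := (nCol N : ℝ) * (8 * P.d / (δ₁ / 2)) ^ P.d with hK0h
  set Cb0 : ℝ := Real.exp (δ₁ / 2) * ((nCol N : ℝ) * (4 * P.d / (δ₁ / 2)) ^ P.d) / ((P.L : ℝ) ^ aw - 1) with hCb0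
  have hCb00 : 0 ≤ Cb0 := by
    have h2 : 0 ≤ (4 * (P.d : ℝ) / (δ₁ / 2)) ^ P.d := pow_nonneg (by positivity) _
    rw [hCb0]; positivity
  set c : ℝ := |C.e| * s with hc
  have hc0 : 0 ≤ c := by rw [hc]; positivity
  have hU0i : 0 ≤ U0⁻¹ := inv_nonneg.mpr hU00.le
  set Cav : ℝ := (U0 * Cst) * (Cb0 * cw) * (K0h * U0⁻¹ * (G1 + Ga)) with hCav
  have hCav0 : 0 ≤ Cav := by rw [hCav]; positivity
  set mm : ℝ := c * P.mesh 0 * (P.d * ((P.L : ℝ) ^ k - 1)) with hmm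
  have hmm_le : mm ≤ (P.d : ℝ) * (P.mesh k * c) := by rw [hmm, hc]; exact mF2_le hs C k
  have hmm0 : 0 ≤ mm := by
    have : (0 : ℝ) ≤ (P.L : ℝ) ^ k - 1 := by have := one_le_pow₀ (M₀ := ℝ) hL1'.le (n := k); linarith
    rw [hmm]; positivity
  have hmkc1 : P.mesh k * c ≤ 1 := by rw [hc]; exact ht1
  have hmm_le' : mm ≤ (P.d : ℝ) := by
    refine hmm_le.trans ?_
    have := mul_le_mul_of_nonneg_left hmkc1 (Nat.cast_nonneg P.d : (0:ℝ) ≤ P.d)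
    simpa using this
  have h1mm : mm * (2 + mm) ≤ (P.d : ℝ) * (P.mesh k * c) * (2 + P.d) :=
    mul_le_mul hmm_le (by linarith) (by linarith) (by positivity)
  set T : ℝ := ∑ j ∈ Finset.range (k + 1), Cav * P.mesh j ^ ((1 : ℝ) + aw - (P.d : ℝ)) *
      Real.exp (-(δ₁ / 2 / 2 * (P.mesh j)⁻¹ * D)) with hT
  have hT0 : 0 ≤ T :=
    Finset.sum_nonneg fun j _ => mul_nonneg (mul_nonneg hCav0 (Real.rpow_nonneg (P.mesh_pos j).le _)) (Real.exp_nonneg _)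
  -- (L^kε)^{−1}·Σ_{j≤k} … ≤ Σ_{j≤k} with one exponent less, then the top bump folded into the range `k` at rate `/L`
  have hfold : (P.mesh k)⁻¹ * T ≤ (1 + (P.L : ℝ) ^ (aw - (P.d : ℝ))) * (Cav * S') := by
    have hδ0 : 0 ≤ δ₁ / 2 / 2 := by positivity
    refine (inv_mesh_mul_sum_succ_le hCav0 aw (δ₁ / 2 / 2) u v).trans ?_
    refine (majorant_succ_le hk hCav0 hδ0 u v).trans (le_of_eq ?_)
    simp only [hS', hD, Finset.mul_sum]
    exact Finset.sum_congr rfl fun j _ => by ring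
  have haS0 : 0 ≤ B1.aSeq a P.L k := (B1.aSeq_pos ha hL1' hk).le
  have haSa : B1.aSeq a P.L k ≤ a := B1.aSeq_le ha hL1' k hk
  rw [abs_of_nonneg (mul_nonneg haS0 (pow_nonneg (inv_nonneg.mpr hmk.le) 2))]
  have hX' : X ≤ mm * (2 + mm) * T := by simpa only [hmm, hT, hCav, hc] using hX
  have idC : Cst * (Cb0 * cw) * (kC P N (δ₁ / 2) * (gE P 1 + gE P aw)) = Cav := by
    simp only [kC, gE]
    rw [← hG1, ← hGa, ← hK0h, hCav]
    field_simp
  rw [idC]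
  calc B1.aSeq a P.L k * (P.mesh k)⁻¹ ^ 2 * X
      ≤ (a * (P.mesh k)⁻¹ ^ 2) * (((P.d : ℝ) * (P.mesh k * c) * (2 + P.d)) * T) :=
        mul_le_mul (mul_le_mul_of_nonneg_right haSa (pow_nonneg (inv_nonneg.mpr hmk.le) 2))
          (hX'.trans (mul_le_mul_of_nonneg_right h1mm hT0)) hX0 (by positivity)
    _ = c * (a * ((P.d : ℝ) * (2 + P.d))) * ((P.mesh k)⁻¹ * P.mesh k) * ((P.mesh k)⁻¹ * T) := by ring
    _ = c * (a * ((P.d : ℝ) * (2 + P.d))) * ((P.mesh k)⁻¹ * T) := by rw [inv_mul_cancel₀ hmk.ne', mul_one]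
    _ ≤ c * (a * ((P.d : ℝ) * (2 + P.d))) * ((1 + (P.L : ℝ) ^ (aw - (P.d : ℝ))) * (Cav * S')) :=
        mul_le_mul_of_nonneg_left hfold (by positivity)
    _ = _ := by ring

/-- **THE ROW THEOREM (engine form of the mixed seed).**  On the torus `T_ε`, for backgrounds `A` (small: `sup_b|A_b| ≤ s`, and
(I.2.23)-regular: `|A_{⟨z+εe_ν,μ⟩} − A_{⟨z,μ⟩}| ≤ δ_A`) and `B` (the (2.10) bounds of `G_k(T_ε,B)`: r15's `Ineq210 δ₁ C` on r14's torus carrier,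
and the twice-differentiated (2.10) of its pieces in p33's `mixedTermR` shape with constant `C_M`), `m² > 0`, `a > 0`, `1 ≤ k ≤ K`, `0 < δ₁ ≤ 1`,
`t = (L^kε)|e|s ≤ 1`, and for EVERY field `w = Σ_{j<k}w_j` whose pieces obey single-scale bounds of exponents `a_w > 0` (value) and `a_w − 1`
(`D^ε_B`-derivative) anchored at `x′` with constants `c_w, c_w′`:
`‖(D^ε_B G_k(T_ε,B) V_k(A,B) w)(b₀)‖ ≤ (|e|s·K₁ + L^k|e|δ_A·K₂)·Σ_{j<k}(L^jε)^{a_w−d}exp(−(δ₁/(4L))(L^jε)^{−1}ε|b₀₋ − x′|)`,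
`K₁ = seedK1(d,L,N,δ₁,C,C_M,a,a_w,c_w,c_w′)`, `K₂ = seedK2(d,L,N,δ₁,C,a_w,c_w)` — uniformly in `k`, the volume and the position; every `d ≥ 1`,
`L ≥ 2`.  THEOREM A separates the sources; the `M^*D`/`D^*M` sources go through §3 (scale pairs, the second derivative always on the
coarser piece: directly or by the Leibniz forms A″/A′), the `M^*M` and averaging sources through §4; one unit of exponent above `a_w` is
traded for `L^kε` (`ε⁻¹·L^kε = L^k` in front of `δ_A`, `(|e|s)²L^kε ≤ |e|s`). [cite: Balaban1983Higgs3, (1.16) p.414, (2.6) p.424, (2.10) p.426] [cite: Balaban1982Higgs1, (2.23) p.610, (3.14)–(3.16) pp.614–615] -/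
theorem phi_row_srcV_le (hmsq : 0 < msq) (ha : 0 < a) (hk : 1 ≤ k) (hkK : k ≤ P.K) (hδ₁ : 0 < δ₁) (hδ₁1 : δ₁ ≤ 1) (hCst : 0 ≤ Cst)
    (hCM : 0 ≤ CM) (hs : 0 ≤ s) (hδA : 0 ≤ δA) (ht1 : P.mesh k * (|C.e| * s) ≤ 1)
    (h210B : (regRegionKernels hL1 C Finset.univ B msq a k K₀).Ineq210 δ₁ Cst)
    (hmixB : ∀ (j : ℕ) (μ ν : Fin P.d) (x x' : HiggsLattice.Site P 0),
      B3Ineq210MixedRegularRegion.mixedTermR C Finset.univ B msq a k j μ ν x x'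
        ≤ CM * (P.mesh j ^ P.d)⁻¹ * Real.exp (-(δ₁ * ((HiggsLattice.Site.tdist x x' : ℝ) / (P.L : ℝ) ^ j))))
    (hA : ∀ b : HiggsLattice.PBond P 0, |A b| ≤ s)
    (hreg : ∀ (z : HiggsLattice.Site P 0) (μ ν : Fin P.d), |A ⟨z.shift ν, μ⟩ - A ⟨z, μ⟩| ≤ δA)
    (i₀ : Ix N) (b₀ : HiggsLattice.PBond P 0) (x' : HiggsLattice.Site P 0)
    (w : ScalarField P 0 N) (wp : ℕ → ScalarField P 0 N) (hw : ∑ j ∈ Finset.range k, wp j = w) {aw cw cw' : ℝ} (haw : 0 < aw)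
    (hcw : 0 ≤ cw) (hcw' : 0 ≤ cw')
    (hwv : ∀ (j : ℕ) (y : HiggsLattice.Site P 0), ‖wp j y‖ ≤ cw * P.mesh j ^ (aw - (P.d : ℝ)) *
      Real.exp (-(δ₁ * (P.mesh j)⁻¹ * (P.mesh 0 * (HiggsLattice.Site.tdist y x' : ℝ)))))
    (hwd : ∀ (j : ℕ) (b : HiggsLattice.PBond P 0), ‖covDeriv C B (wp j) b‖ ≤ cw' * P.mesh j ^ (aw - 1 - (P.d : ℝ)) *
      Real.exp (-(δ₁ * (P.mesh j)⁻¹ * (P.mesh 0 * (HiggsLattice.Site.tdist b.src x' : ℝ))))) :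
    ‖covDeriv C B (propagatorK C Finset.univ B msq a k (srcV C A B k Finset.univ a w)) b₀‖
      ≤ (|C.e| * s * seedK1 P N δ₁ Cst CM a aw cw cw' + (P.L : ℝ) ^ k * (|C.e| * δA) * seedK2 P N δ₁ Cst aw cw) *
          ∑ j ∈ Finset.range k, P.mesh j ^ (aw - (P.d : ℝ)) *
            Real.exp (-(δ₁ / 2 / 2 / P.L * (P.mesh j)⁻¹ * (P.mesh 0 * (HiggsLattice.Site.tdist b₀.src x' : ℝ)))) := by
  -- the four operator bounds (§3, §4)
  have hMD := md_sum_le hmsq ha hk hkK hδ₁ hδ₁1 hCst hCM hs hδA h210B hmixB hA hreg i₀ b₀ x' w wp hw haw hcw hcw' hwv hwd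
  have hDM := dm_sum_le hmsq ha hk hkK hδ₁ hδ₁1 hCst hCM hs hδA h210B hmixB hA hreg i₀ b₀ x' w wp hw haw hcw hcw' hwv hwd
  have hMM := mm_le hmsq ha hk hkK hδ₁ hδ₁1 hCst hs h210B hA i₀ b₀ x' w wp hw haw hcw hwv
  have hAV := avg_le hmsq ha hk hkK hδ₁ hδ₁1 hCst hs h210B hA i₀ b₀ x' w wp hw haw hcw hwv
  -- THEOREM A through the row functional `D^ε_B(·)(b₀)∘G_k(T_ε,B)`, then norms
  have hid := map_srcV_univ C A B k a (covDerivAt C B b₀ ∘ₗ propagatorK C Finset.univ B msq a k) w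
  simp only [LinearMap.coe_comp, Function.comp_apply, covDerivAt_apply] at hid
  have htot : ‖covDeriv C B (propagatorK C Finset.univ B msq a k (srcV C A B k Finset.univ a w)) b₀‖
      ≤ ‖covDeriv C B (propagatorK C Finset.univ B msq a k (∑ b : HiggsLattice.PBond P 0, srcMD C A B b w)) b₀‖
        + ‖covDeriv C B (propagatorK C Finset.univ B msq a k ((P.mesh 0)⁻¹ • ∑ b : HiggsLattice.PBond P 0, srcDM C A B b w)) b₀‖
        + ∑ b : HiggsLattice.PBond P 0, ‖covDeriv C B (propagatorK C Finset.univ B msq a k (srcMM C A B b w)) b₀‖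
        + |B1.aSeq a P.L k * (P.mesh k)⁻¹ ^ 2| *
          ‖covDeriv C B (propagatorK C Finset.univ B msq a k (avgSrc C A B k w)) b₀‖ := by
    rw [hid]
    refine (norm_sub_le _ _).trans (add_le_add ?_ ?_)
    · rw [norm_neg]
      exact (norm_add_le _ _).trans (add_le_add ((norm_add_le _ _).trans le_rfl) (norm_sum_le _ _))
    · rw [norm_smul, Real.norm_eq_abs]
  -- the four conversions (§6.1) and the bookkeeping of `K₁`, `K₂`
  refine htot.trans ((add_le_add (add_le_add (add_le_add
    (md_arith hL1 haw hCst hCM hcw hcw' hs hδA hδ₁ b₀.src x' hMD) (dm_arith hL1 haw hCst hCM hcw hcw' hs hδA hδ₁ b₀.src x' hDM))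
    (mm_arith hL1 haw hCst hcw hs hδ₁ ht1 b₀.src x' hMM))
    (avg_arith hL1 ha hk haw hCst hcw hs hδ₁ ht1 b₀.src x' (norm_nonneg _) hAV)).trans (le_of_eq ?_))
  simp only [seedK1, seedK2]
  ring

end RowTheorem

/-! ## §7 The instances: `W = G_k(T_ε,A+B) − G_k(T_ε,B)` on a dipole through one row derivative (THE MIXED SEED, value exponent 1),
`W` on a point source through one row derivative (exponent 2), and the value of `W` on a dipole (by the symmetry of `W`) -/

section Instances

variable {C : ChargeData N} {A B : HiggsLattice.VecField P 0} {msq a : ℝ} {k K₀ K₀' : ℕ} {hL1 : 1 < P.L} {δ₁ Cst CM s δA : ℝ}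

/-- `dip^B_bY = dip^{A+B}_bY + δ_{b₊}(U(ε,−B_b)Y − U(ε,−(A+B)_b)Y)`: the two dipoles differ at the far end only. [cite: Balaban1982Higgs1, (1.7) p.605] -/
theorem dip_eq_dip_add_single (b : HiggsLattice.PBond P 0) (Y : E N) :
    dip C B b Y = dip C (A + B) b Y
      + Pi.single b.tgt (C.U (P.mesh 0) (-(B b)) Y - C.U (P.mesh 0) (-((A + B) b)) Y) := by
  simp only [dip, Pi.single_sub]
  abel

/-- `‖U(ε,−B_b)Y − U(ε,−(A+B)_b)Y‖ ≤ ε|e|s‖Y‖` (`U(−(A+B)_b) = U(−A_b)U(−B_b)`, (I.3.14) `U(a) = 1 + εF₁(a)`, `‖F₁(−A_b)‖ ≤ |e|s`,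
unitarity). [cite: Balaban1982Higgs1, (1.7) p.605, (3.14) p.614] -/
theorem norm_U_sub_U_add_le {b : HiggsLattice.PBond P 0} (hA : |A b| ≤ s) (Y : E N) :
    ‖C.U (P.mesh 0) (-(B b)) Y - C.U (P.mesh 0) (-((A + B) b)) Y‖ ≤ P.mesh 0 * (|C.e| * s) * ‖Y‖ := by
  have hε := P.mesh_pos 0
  have h1 : C.U (P.mesh 0) (-((A + B) b)) Y = C.U (P.mesh 0) (-(A b)) (C.U (P.mesh 0) (-(B b)) Y) := by
    rw [Pi.add_apply, neg_add, C.U_add, mul_apply_eq_comp]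
  rw [h1, B3Op116Pieces.U_apply_eq_add_smul_fOne C hε.ne' (-(A b)) (C.U (P.mesh 0) (-(B b)) Y), sub_add_cancel_left, norm_neg,
    norm_smul, Real.norm_eq_abs, abs_of_pos hε, mul_assoc]
  refine mul_le_mul_of_nonneg_left ((B3Op116LeibnizRows.norm_fOne_neg_apply_le C A hA _).trans (le_of_eq ?_)) hε.le
  rw [norm_U_apply]

/-- **The `D^ε_B`-differentiated column of a piece of `G_k(T_ε,A+B)` through the split `D^ε_B = D^ε_{A+B} − M`**:
`pdcol j B (A+B) b y ≤ pdcol j (A+B) (A+B) b y + |e|s·pcol j (A+B) b₊ y`. [cite: Balaban1982Higgs1, (3.14) p.614] [cite: Balaban1983Higgs3, (2.6) p.424] -/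
theorem pdcol_cross_le (j : ℕ) (hA : ∀ b : HiggsLattice.PBond P 0, |A b| ≤ s) (b : HiggsLattice.PBond P 0) (y : HiggsLattice.Site P 0) :
    pdcol C msq a k j B (A + B) b y ≤ pdcol C msq a k j (A + B) (A + B) b y + |C.e| * s * pcol C msq a k j (A + B) b.tgt y := by
  unfold pdcol pcol
  rw [Finset.mul_sum, ← Finset.sum_add_distrib]
  exact Finset.sum_le_sum fun i _ => B3Op116KernelRegularTorus.norm_covDeriv_le_add_split C A B (hA b) _

/-- **(2.10) for the `D^ε_B`-differentiated column of a piece of `G_k(T_ε,A+B)`, `j < k`**: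
`pdcol j B (A+B) b y ≤ ε^dC(1 + e)(L^jε)^{1−d}e^{−δ₁(L^jε)^{−1}ε|b₋ − y|}` (the `M`-part has the exponent 2, one unit of which is `≤ L^kε`,
and `(L^kε)|e|s ≤ 1`; its bump sits at `b₊`, one step from `b₋`: factor `e`). [cite: Balaban1983Higgs3, (2.6) p.424, (2.10) p.426] [cite: Balaban1982Higgs1, (3.14) p.614] -/
theorem pdcol_cross_bound {j : ℕ} (hjk : j < k) (hδ₁ : 0 < δ₁) (hδ₁1 : δ₁ ≤ 1) (hCst : 0 ≤ Cst) (hs : 0 ≤ s)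
    (ht1 : P.mesh k * (|C.e| * s) ≤ 1) (h210AB : (regRegionKernels hL1 C Finset.univ (A + B) msq a k K₀').Ineq210 δ₁ Cst)
    (hA : ∀ b : HiggsLattice.PBond P 0, |A b| ≤ s) (b : HiggsLattice.PBond P 0) (y : HiggsLattice.Site P 0) :
    pdcol C msq a k j B (A + B) b y ≤ (P.mesh 0 ^ P.d * Cst) * (1 + Real.exp 1) * P.mesh j ^ ((1 : ℝ) - (P.d : ℝ)) *
        Real.exp (-(δ₁ * (P.mesh j)⁻¹ * (P.mesh 0 * (HiggsLattice.Site.tdist b.src y : ℝ)))) := by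
  have hes : 0 ≤ |C.e| * s := mul_nonneg (abs_nonneg _) hs
  have hc : 0 ≤ P.mesh 0 ^ P.d * Cst := mul_nonneg (pow_nonneg (P.mesh_pos 0).le _) hCst
  have hm1 : 0 ≤ P.mesh j ^ ((1 : ℝ) - (P.d : ℝ)) := Real.rpow_nonneg (P.mesh_pos j).le _
  have hm2 : 0 ≤ P.mesh j ^ ((2 : ℝ) - (P.d : ℝ)) := Real.rpow_nonneg (P.mesh_pos j).le _
  have hshift : Real.exp (-(δ₁ * (P.mesh j)⁻¹ * (P.mesh 0 * (HiggsLattice.Site.tdist b.tgt y : ℝ))))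
      ≤ Real.exp 1 * Real.exp (-(δ₁ * (P.mesh j)⁻¹ * (P.mesh 0 * (HiggsLattice.Site.tdist b.src y : ℝ)))) :=
    bump_shift_le' hδ₁.le hδ₁1 j b.src y b.dir
  have hmesh : P.mesh j ^ ((2 : ℝ) - (P.d : ℝ)) = P.mesh j * P.mesh j ^ ((1 : ℝ) - (P.d : ℝ)) := by
    rw [show (2 : ℝ) - (P.d : ℝ) = 1 + ((1 : ℝ) - (P.d : ℝ)) by ring, ← mesh_rpow_add, Real.rpow_one]
  have hjle : P.mesh j * (|C.e| * s) ≤ 1 :=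
    (mul_le_mul_of_nonneg_right (B3Ineq210RegularTorus.mesh_mono P hjk.le) hes).trans ht1
  set Ex : ℝ := Real.exp (-(δ₁ * (P.mesh j)⁻¹ * (P.mesh 0 * (HiggsLattice.Site.tdist b.src y : ℝ)))) with hEx
  have hE0 : 0 ≤ Ex := Real.exp_nonneg _
  calc pdcol C msq a k j B (A + B) b y
      ≤ pdcol C msq a k j (A + B) (A + B) b y + |C.e| * s * pcol C msq a k j (A + B) b.tgt y := pdcol_cross_le j hA b y
    _ ≤ (P.mesh 0 ^ P.d * Cst) * P.mesh j ^ ((1 : ℝ) - (P.d : ℝ)) * Ex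
        + |C.e| * s * ((P.mesh 0 ^ P.d * Cst) * P.mesh j ^ ((2 : ℝ) - (P.d : ℝ)) * (Real.exp 1 * Ex)) :=
        add_le_add (pdcol_le h210AB b y)
          (mul_le_mul_of_nonneg_left ((pcol_le h210AB b.tgt y).trans (mul_le_mul_of_nonneg_left hshift (mul_nonneg hc hm2))) hes)
    _ = (P.mesh 0 ^ P.d * Cst) * P.mesh j ^ ((1 : ℝ) - (P.d : ℝ)) * Ex * (1 + (P.mesh j * (|C.e| * s)) * Real.exp 1) := by
        rw [hmesh]; ring
    _ ≤ (P.mesh 0 ^ P.d * Cst) * P.mesh j ^ ((1 : ℝ) - (P.d : ℝ)) * Ex * (1 + 1 * Real.exp 1) :=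
        mul_le_mul_of_nonneg_left (add_le_add le_rfl (mul_le_mul_of_nonneg_right hjle (Real.exp_nonneg 1)))
          (mul_nonneg (mul_nonneg hc hm1) hE0)
    _ = _ := by ring

/-- **The VALUE of a piece of `G_k(T_ε,A+B)` on the `B`-dipole `dip^B_{b′}Y`, `j < k`** (piece symmetry `norm_pieceR_dip_apply_le` +
`pdcol_cross_bound`): `‖(G^η_{(j)}(A+B)dip^B_{b′}Y)(y)‖ ≤ ε‖Y‖ε^dC(1+e)(L^jε)^{1−d}e^{−δ₁(L^jε)^{−1}ε|y − b′₋|}` — exponent `a_w = 1`, anchor `b′₋`.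
[cite: Balaban1983Higgs3, (2.6) p.424, (2.10) p.426] [cite: Balaban1982Higgs1, (1.7) p.605, (3.14) p.614] -/
theorem norm_pieceR_dipB_le {j : ℕ} (hjk : j < k) (hδ₁ : 0 < δ₁) (hδ₁1 : δ₁ ≤ 1) (hCst : 0 ≤ Cst) (hs : 0 ≤ s)
    (ht1 : P.mesh k * (|C.e| * s) ≤ 1) (h210AB : (regRegionKernels hL1 C Finset.univ (A + B) msq a k K₀').Ineq210 δ₁ Cst)
    (hA : ∀ b : HiggsLattice.PBond P 0, |A b| ≤ s) (b' : HiggsLattice.PBond P 0) (Y : E N) (y : HiggsLattice.Site P 0) :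
    ‖pieceR C Finset.univ (A + B) msq a k j (dip C B b' Y) y‖
      ≤ (P.mesh 0 * ‖Y‖ * ((P.mesh 0 ^ P.d * Cst) * (1 + Real.exp 1))) * P.mesh j ^ ((1 : ℝ) - (P.d : ℝ)) *
          Real.exp (-(δ₁ * (P.mesh j)⁻¹ * (P.mesh 0 * (HiggsLattice.Site.tdist y b'.src : ℝ)))) := by
  have h := norm_pieceR_dip_apply_le C Finset.univ (A + B) msq a B k j b' Y y
  have h2 := pdcol_cross_bound hjk hδ₁ hδ₁1 hCst hs ht1 h210AB hA b' y
  rw [tdist_comm y b'.src]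
  calc ‖pieceR C Finset.univ (A + B) msq a k j (dip C B b' Y) y‖
      ≤ P.mesh 0 * ‖Y‖ * pdcol C msq a k j B (A + B) b' y := h
    _ ≤ P.mesh 0 * ‖Y‖ * ((P.mesh 0 ^ P.d * Cst) * (1 + Real.exp 1) * P.mesh j ^ ((1 : ℝ) - (P.d : ℝ)) *
          Real.exp (-(δ₁ * (P.mesh j)⁻¹ * (P.mesh 0 * (HiggsLattice.Site.tdist b'.src y : ℝ))))) :=
        mul_le_mul_of_nonneg_left h2 (mul_nonneg (P.mesh_pos 0).le (norm_nonneg _))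
    _ = _ := by ring

/-- **The `D^ε_B`-DERIVATIVE of a piece of `G_k(T_ε,A+B)` on the `B`-dipole, `j < k`**:
`‖(D^ε_BG^η_{(j)}(A+B)dip^B_{b′}Y)(b)‖ ≤ ε‖Y‖(ε^dC_M + ε^dC·e + ε^dC(1+e)e)(L^jε)^{−d}e^{−δ₁(L^jε)^{−1}ε|b₋ − b′₋|}` — exponent `a_w − 1 = 0`:
`D^ε_B = D^ε_{A+B} − M` (the `M`-part is `|e|s`× the value at `b₊`), `dip^B = dip^{A+B} + δ_{b′₊}v` with `‖v‖ ≤ ε|e|s‖Y‖` (a differentiated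
column at `b′₊`), and the twice-differentiated piece in its own background (`pmix`, p33's `mixedTermR` bound); the two correction terms carry
one unit of exponent more, traded against `(L^kε)|e|s ≤ 1`. [cite: Balaban1983Higgs3, (2.6) p.424, (2.10) p.426] [cite: Balaban1982Higgs1, (1.7) p.605, (3.14) p.614] -/
theorem norm_covDeriv_pieceR_dipB_le {j : ℕ} (hjk : j < k) (hδ₁ : 0 < δ₁) (hδ₁1 : δ₁ ≤ 1) (hCst : 0 ≤ Cst)
    (hs : 0 ≤ s) (ht1 : P.mesh k * (|C.e| * s) ≤ 1)
    (h210AB : (regRegionKernels hL1 C Finset.univ (A + B) msq a k K₀').Ineq210 δ₁ Cst)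
    (hmixAB : ∀ (j : ℕ) (μ ν : Fin P.d) (x x' : HiggsLattice.Site P 0),
      B3Ineq210MixedRegularRegion.mixedTermR C Finset.univ (A + B) msq a k j μ ν x x'
        ≤ CM * (P.mesh j ^ P.d)⁻¹ * Real.exp (-(δ₁ * ((HiggsLattice.Site.tdist x x' : ℝ) / (P.L : ℝ) ^ j))))
    (hA : ∀ b : HiggsLattice.PBond P 0, |A b| ≤ s) (b' : HiggsLattice.PBond P 0) (Y : E N) (b : HiggsLattice.PBond P 0) :
    ‖covDeriv C B (pieceR C Finset.univ (A + B) msq a k j (dip C B b' Y)) b‖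
      ≤ (P.mesh 0 * ‖Y‖ * (P.mesh 0 ^ P.d * CM + (P.mesh 0 ^ P.d * Cst) * Real.exp 1
            + (P.mesh 0 ^ P.d * Cst) * (1 + Real.exp 1) * Real.exp 1)) * P.mesh j ^ ((1 : ℝ) - 1 - (P.d : ℝ)) *
          Real.exp (-(δ₁ * (P.mesh j)⁻¹ * (P.mesh 0 * (HiggsLattice.Site.tdist b.src b'.src : ℝ)))) := by
  have hε := P.mesh_pos 0
  have hes : 0 ≤ |C.e| * s := mul_nonneg (abs_nonneg _) hs
  have hc : 0 ≤ P.mesh 0 ^ P.d * Cst := mul_nonneg (pow_nonneg hε.le _) hCst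
  have hm1 : 0 ≤ P.mesh j ^ ((1 : ℝ) - (P.d : ℝ)) := Real.rpow_nonneg (P.mesh_pos j).le _
  have hjle : P.mesh j * (|C.e| * s) ≤ 1 :=
    (mul_le_mul_of_nonneg_right (B3Ineq210RegularTorus.mesh_mono P hjk.le) hes).trans ht1
  set Ex : ℝ := Real.exp (-(δ₁ * (P.mesh j)⁻¹ * (P.mesh 0 * (HiggsLattice.Site.tdist b.src b'.src : ℝ)))) with hEx
  have hE0 : 0 ≤ Ex := Real.exp_nonneg _
  set v : E N := C.U (P.mesh 0) (-(B b')) Y - C.U (P.mesh 0) (-((A + B) b')) Y with hv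
  have hvn : ‖v‖ ≤ P.mesh 0 * (|C.e| * s) * ‖Y‖ := norm_U_sub_U_add_le (hA b') Y
  -- the split `D^ε_B = D^ε_{A+B} − M`
  have h1 := B3Op116KernelRegularTorus.norm_covDeriv_le_add_split C A B (hA b) (pieceR C Finset.univ (A + B) msq a k j (dip C B b' Y))
  -- `dip^B = dip^{A+B} + δ_{b′₊}v`
  have h2 : pieceR C Finset.univ (A + B) msq a k j (dip C B b' Y)
      = pieceR C Finset.univ (A + B) msq a k j (dip C (A + B) b' Y) + pieceR C Finset.univ (A + B) msq a k j (Pi.single b'.tgt v) := by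
    rw [dip_eq_dip_add_single, map_add]
  -- the twice-differentiated piece in its own background
  have h3 : ‖covDeriv C (A + B) (pieceR C Finset.univ (A + B) msq a k j (dip C (A + B) b' Y)) b‖
      ≤ ‖Y‖ * (P.mesh 0 * ((P.mesh 0 ^ P.d * CM) * P.mesh j ^ ((0 : ℝ) - (P.d : ℝ)) * Ex)) := by
    have h := norm_mapE_dip_le (C := C) (B := A + B) (covDerivAt C (A + B) b ∘ₗ pieceR C Finset.univ (A + B) msq a k j) b' Y
    simp only [LinearMap.coe_comp, Function.comp_apply, covDerivAt_apply] at h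
    refine h.trans (mul_le_mul_of_nonneg_left ?_ (norm_nonneg _))
    have h' : ∑ i : Ix N, ‖covDeriv C (A + B) (pieceR C Finset.univ (A + B) msq a k j (dip C (A + B) b' (onb N i))) b‖
        = P.mesh 0 * pmix C msq a k j (A + B) (A + B) b b' := by
      rw [pmix, ← mul_assoc, mul_inv_cancel₀ hε.ne', one_mul]
    rw [h']
    exact mul_le_mul_of_nonneg_left (pmix_le hmixAB b b') hε.le
  -- the differentiated column at `b′₊`, shifted back to `b′₋`
  have h4 : ‖covDeriv C (A + B) (pieceR C Finset.univ (A + B) msq a k j (Pi.single b'.tgt v)) b‖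
      ≤ (P.mesh 0 * (|C.e| * s) * ‖Y‖) * ((P.mesh 0 ^ P.d * Cst) * P.mesh j ^ ((1 : ℝ) - (P.d : ℝ)) * (Real.exp 1 * Ex)) := by
    refine (B3Ineq210MixedRegularTorus.norm_covDeriv_apply_single_le C (A + B) (pieceR C Finset.univ (A + B) msq a k j) b'.tgt v b).trans ?_
    refine mul_le_mul hvn ?_ (pdcol_nonneg (C := C) (msq := msq) (a := a) (k := k) (j := j) (A + B) (A + B) b b'.tgt) (by positivity)
    refine (pdcol_le h210AB b b'.tgt).trans ?_
    exact mul_le_mul_of_nonneg_left (bump_shift_le hδ₁.le hδ₁1 j b.src b'.src b'.dir) (mul_nonneg hc hm1)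
  -- the value at `b₊`, shifted back to `b₋`
  have h5 : ‖pieceR C Finset.univ (A + B) msq a k j (dip C B b' Y) b.tgt‖
      ≤ (P.mesh 0 * ‖Y‖ * ((P.mesh 0 ^ P.d * Cst) * (1 + Real.exp 1))) * P.mesh j ^ ((1 : ℝ) - (P.d : ℝ)) * (Real.exp 1 * Ex) := by
    refine (norm_pieceR_dipB_le hjk hδ₁ hδ₁1 hCst hs ht1 h210AB hA b' Y b.tgt).trans ?_
    exact mul_le_mul_of_nonneg_left (bump_shift_le' hδ₁.le hδ₁1 j b.src b'.src b.dir) (by positivity)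
  have h6 : ‖covDeriv C (A + B) (pieceR C Finset.univ (A + B) msq a k j (dip C B b' Y)) b‖
      ≤ ‖Y‖ * (P.mesh 0 * ((P.mesh 0 ^ P.d * CM) * P.mesh j ^ ((0 : ℝ) - (P.d : ℝ)) * Ex))
        + (P.mesh 0 * (|C.e| * s) * ‖Y‖) * ((P.mesh 0 ^ P.d * Cst) * P.mesh j ^ ((1 : ℝ) - (P.d : ℝ)) * (Real.exp 1 * Ex)) := by
    rw [h2, B3Ineq210RegularTorus.covDeriv_add'']
    exact (norm_add_le _ _).trans (add_le_add h3 h4)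
  -- exponents: `(L^jε)^{1−d} = (L^jε)·(L^jε)^{0−d}`
  have hm10 : P.mesh j ^ ((1 : ℝ) - (P.d : ℝ)) = P.mesh j * P.mesh j ^ ((1 : ℝ) - 1 - (P.d : ℝ)) := by
    rw [show (1 : ℝ) - (P.d : ℝ) = 1 + ((1 : ℝ) - 1 - (P.d : ℝ)) by ring, ← mesh_rpow_add, Real.rpow_one]
  have hm00 : P.mesh j ^ ((0 : ℝ) - (P.d : ℝ)) = P.mesh j ^ ((1 : ℝ) - 1 - (P.d : ℝ)) := by norm_num
  have hm0 : 0 ≤ P.mesh j ^ ((1 : ℝ) - 1 - (P.d : ℝ)) := Real.rpow_nonneg (P.mesh_pos j).le _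
  calc ‖covDeriv C B (pieceR C Finset.univ (A + B) msq a k j (dip C B b' Y)) b‖
      ≤ ‖covDeriv C (A + B) (pieceR C Finset.univ (A + B) msq a k j (dip C B b' Y)) b‖
        + |C.e| * s * ‖pieceR C Finset.univ (A + B) msq a k j (dip C B b' Y) b.tgt‖ := h1
    _ ≤ ‖Y‖ * (P.mesh 0 * ((P.mesh 0 ^ P.d * CM) * P.mesh j ^ ((0 : ℝ) - (P.d : ℝ)) * Ex))
        + (P.mesh 0 * (|C.e| * s) * ‖Y‖) * ((P.mesh 0 ^ P.d * Cst) * P.mesh j ^ ((1 : ℝ) - (P.d : ℝ)) * (Real.exp 1 * Ex))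
        + |C.e| * s * ((P.mesh 0 * ‖Y‖ * ((P.mesh 0 ^ P.d * Cst) * (1 + Real.exp 1))) * P.mesh j ^ ((1 : ℝ) - (P.d : ℝ)) *
          (Real.exp 1 * Ex)) := add_le_add h6 (mul_le_mul_of_nonneg_left h5 hes)
    _ = P.mesh 0 * ‖Y‖ * P.mesh j ^ ((1 : ℝ) - 1 - (P.d : ℝ)) * Ex *
          (P.mesh 0 ^ P.d * CM + (P.mesh j * (|C.e| * s)) * ((P.mesh 0 ^ P.d * Cst) * Real.exp 1
            + (P.mesh 0 ^ P.d * Cst) * (1 + Real.exp 1) * Real.exp 1)) := by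
        rw [hm10, hm00]; ring
    _ ≤ P.mesh 0 * ‖Y‖ * P.mesh j ^ ((1 : ℝ) - 1 - (P.d : ℝ)) * Ex *
          (P.mesh 0 ^ P.d * CM + 1 * ((P.mesh 0 ^ P.d * Cst) * Real.exp 1
            + (P.mesh 0 ^ P.d * Cst) * (1 + Real.exp 1) * Real.exp 1)) :=
        mul_le_mul_of_nonneg_left (add_le_add le_rfl (mul_le_mul_of_nonneg_right hjle
          (by positivity : (0 : ℝ) ≤ (P.mesh 0 ^ P.d * Cst) * Real.exp 1 + (P.mesh 0 ^ P.d * Cst) * (1 + Real.exp 1) * Real.exp 1)))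
          (by positivity)
    _ = _ := by ring

/-- **THE MIXED SEED (row side).**  On `T_ε`, for `A` small and regular and `B`, `A+B` carrying the (2.10) bounds and their twice-differentiated
form, `m² > 0`, `a > 0`, `1 ≤ k ≤ K`, `0 < δ₁ ≤ 1`, `(L^kε)|e|s ≤ 1`, every row bond `b₀`, dipole bond `b′` and charge `Y`:
`‖(D^ε_B[G_k(T_ε,A+B) − G_k(T_ε,B)]dip^B_{b′}Y)(b₀)‖ ≤ (|e|s·K₁ + L^k|e|δ_A·K₂)·Σ_{j<k}(L^jε)^{1−d}exp(−(δ₁/(4L))(L^jε)^{−1}ε|b₀₋ − b′₋|)`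
with `K₁ = seedK1(…, a_w = 1, c_w, c_w′)`, `K₂ = seedK2(…, 1, c_w)`, `c_w = ε‖Y‖ε^dC(1+e)`, `c_w′ = ε‖Y‖(ε^dC_M + ε^dCe + ε^dC(1+e)e)` — i.e.
`ε^{d+1}‖Y‖`× constants depending on `d, L, N, δ₁, C, C_M, a` only: the `n = n′ = … ` seed of the induction over (1.16), one factor `|e|s` (resp.
`L^k|e|δ_A`) better than the crude bound.  `W = G_BV_kG_{A+B}` ((I.3.44) `eq344_model`), THEOREM A (`opV_apply_eq_srcV`), the row theorem on
`w = G_{A+B}dip^B_{b′}Y = Σ_{j<k}G^η_{(j)}dip^B_{b′}Y` with the piece bounds `norm_pieceR_dipB_le`, `norm_covDeriv_pieceR_dipB_le`.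
[cite: Balaban1983Higgs3, (1.16) p.414, (2.6) p.424, (2.10) p.426] [cite: Balaban1982Higgs1, (3.16) p.615, (3.44) p.619] -/
theorem mixed_seed_le (hmsq : 0 < msq) (ha : 0 < a) (hk : 1 ≤ k) (hkK : k ≤ P.K) (hδ₁ : 0 < δ₁) (hδ₁1 : δ₁ ≤ 1) (hCst : 0 ≤ Cst)
    (hCM : 0 ≤ CM) (hs : 0 ≤ s) (hδA : 0 ≤ δA) (ht1 : P.mesh k * (|C.e| * s) ≤ 1)
    (h210B : (regRegionKernels hL1 C Finset.univ B msq a k K₀).Ineq210 δ₁ Cst)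
    (hmixB : ∀ (j : ℕ) (μ ν : Fin P.d) (x x' : HiggsLattice.Site P 0),
      B3Ineq210MixedRegularRegion.mixedTermR C Finset.univ B msq a k j μ ν x x'
        ≤ CM * (P.mesh j ^ P.d)⁻¹ * Real.exp (-(δ₁ * ((HiggsLattice.Site.tdist x x' : ℝ) / (P.L : ℝ) ^ j))))
    (h210AB : (regRegionKernels hL1 C Finset.univ (A + B) msq a k K₀').Ineq210 δ₁ Cst)
    (hmixAB : ∀ (j : ℕ) (μ ν : Fin P.d) (x x' : HiggsLattice.Site P 0),
      B3Ineq210MixedRegularRegion.mixedTermR C Finset.univ (A + B) msq a k j μ ν x x'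
        ≤ CM * (P.mesh j ^ P.d)⁻¹ * Real.exp (-(δ₁ * ((HiggsLattice.Site.tdist x x' : ℝ) / (P.L : ℝ) ^ j))))
    (hA : ∀ b : HiggsLattice.PBond P 0, |A b| ≤ s)
    (hreg : ∀ (z : HiggsLattice.Site P 0) (μ ν : Fin P.d), |A ⟨z.shift ν, μ⟩ - A ⟨z, μ⟩| ≤ δA)
    (i₀ : Ix N) (b₀ b' : HiggsLattice.PBond P 0) (Y : E N) :
    ‖covDeriv C B ((propagatorK C Finset.univ (A + B) msq a k - propagatorK C Finset.univ B msq a k) (dip C B b' Y)) b₀‖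
      ≤ (|C.e| * s * seedK1 P N δ₁ Cst CM a 1 (P.mesh 0 * ‖Y‖ * ((P.mesh 0 ^ P.d * Cst) * (1 + Real.exp 1)))
              (P.mesh 0 * ‖Y‖ * (P.mesh 0 ^ P.d * CM + (P.mesh 0 ^ P.d * Cst) * Real.exp 1
                + (P.mesh 0 ^ P.d * Cst) * (1 + Real.exp 1) * Real.exp 1))
          + (P.L : ℝ) ^ k * (|C.e| * δA) * seedK2 P N δ₁ Cst 1 (P.mesh 0 * ‖Y‖ * ((P.mesh 0 ^ P.d * Cst) * (1 + Real.exp 1)))) *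
        ∑ j ∈ Finset.range k, P.mesh j ^ ((1 : ℝ) - (P.d : ℝ)) *
          Real.exp (-(δ₁ / 2 / 2 / P.L * (P.mesh j)⁻¹ * (P.mesh 0 * (HiggsLattice.Site.tdist b₀.src b'.src : ℝ)))) := by
  have hL1' : (1 : ℝ) < (P.L : ℝ) := by exact_mod_cast hL1
  have hε := P.mesh_pos 0
  have hak : 0 ≤ B1.aSeq a P.L k := (B1.aSeq_pos ha hL1' hk).le
  have hcw0 : 0 ≤ P.mesh 0 * ‖Y‖ * ((P.mesh 0 ^ P.d * Cst) * (1 + Real.exp 1)) := by positivity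
  have hcw0' : 0 ≤ P.mesh 0 * ‖Y‖ * (P.mesh 0 ^ P.d * CM + (P.mesh 0 ^ P.d * Cst) * Real.exp 1
      + (P.mesh 0 ^ P.d * Cst) * (1 + Real.exp 1) * Real.exp 1) := by positivity
  -- (I.3.44) and THEOREM A: `(G_{A+B} − G_B)φ = G_B V_k (G_{A+B}φ) = G_B srcV(G_{A+B}φ)`
  have hW : (propagatorK C Finset.univ (A + B) msq a k - propagatorK C Finset.univ B msq a k) (dip C B b' Y)
      = propagatorK C Finset.univ B msq a k
          (srcV C A B k Finset.univ a (propagatorK C Finset.univ (A + B) msq a k (dip C B b' Y))) := by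
    rw [sub_eq_iff_eq_add'.mpr (B3Eq116TwoSidedExpansion.eq344_model C Finset.univ A B a k hmsq hak), Module.End.mul_apply,
      Module.End.mul_apply, B3Op116SourceForm.opV_apply_eq_srcV]
  rw [hW]
  -- the pieces (2.6) of `w = G_{A+B}φ`
  have hw : ∑ j ∈ Finset.range k, (fun j => if j < k then pieceR C Finset.univ (A + B) msq a k j (dip C B b' Y) else 0) j
      = propagatorK C Finset.univ (A + B) msq a k (dip C B b' Y) := by
    rw [propagatorK_apply_eq_sum_pieces C msq a k (A + B) hmsq ha hL1 hk hkK]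
    exact Finset.sum_congr rfl fun j hj => if_pos (Finset.mem_range.1 hj)
  refine phi_row_srcV_le hmsq ha hk hkK hδ₁ hδ₁1 hCst hCM hs hδA ht1 h210B hmixB hA hreg i₀ b₀ b'.src _ _ hw one_pos hcw0 hcw0'
    (fun j y => ?_) (fun j b => ?_)
  · by_cases hjk : j < k
    · simp only [if_pos hjk]
      exact norm_pieceR_dipB_le hjk hδ₁ hδ₁1 hCst hs ht1 h210AB hA b' Y y
    · simp only [if_neg hjk, Pi.zero_apply, norm_zero]
      exact mul_nonneg (mul_nonneg hcw0 (Real.rpow_nonneg (P.mesh_pos j).le _)) (Real.exp_nonneg _)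
  · by_cases hjk : j < k
    · simp only [if_pos hjk]
      exact norm_covDeriv_pieceR_dipB_le hjk hδ₁ hδ₁1 hCst hs ht1 h210AB hmixAB hA b' Y b
    · simp only [if_neg hjk, B3Ineq210RegularTorus.covDeriv_zero'', norm_zero]
      exact mul_nonneg (mul_nonneg hcw0' (Real.rpow_nonneg (P.mesh_pos j).le _)) (Real.exp_nonneg _)

/-- **The row of `W = G_k(T_ε,A+B) − G_k(T_ε,B)` on a point source through `D^ε_B`** (value exponent `a_w = 2`):
`‖(D^ε_BWe_{(y,i)})(b₀)‖ ≤ (|e|s·K₁ + L^k|e|δ_A·K₂)·Σ_{j<k}(L^jε)^{2−d}exp(−(δ₁/(4L))(L^jε)^{−1}ε|b₀₋ − y|)`, `K₁ = seedK1(…, 2, ε^dC, ε^dC(1+e))`,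
`K₂ = seedK2(…, 2, ε^dC)` — the pieces of `w = G_{A+B}e_{(y,i)}` are single columns (`pcol_le`) with `D^ε_B`-differentiated columns
`pdcol_cross_bound`. [cite: Balaban1983Higgs3, (1.16) p.414, (2.6) p.424, (2.10) p.426] [cite: Balaban1982Higgs1, (3.16) p.615, (3.44) p.619] -/
theorem deriv_W_single_le (hmsq : 0 < msq) (ha : 0 < a) (hk : 1 ≤ k) (hkK : k ≤ P.K) (hδ₁ : 0 < δ₁) (hδ₁1 : δ₁ ≤ 1) (hCst : 0 ≤ Cst)
    (hCM : 0 ≤ CM) (hs : 0 ≤ s) (hδA : 0 ≤ δA) (ht1 : P.mesh k * (|C.e| * s) ≤ 1)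
    (h210B : (regRegionKernels hL1 C Finset.univ B msq a k K₀).Ineq210 δ₁ Cst)
    (hmixB : ∀ (j : ℕ) (μ ν : Fin P.d) (x x' : HiggsLattice.Site P 0),
      B3Ineq210MixedRegularRegion.mixedTermR C Finset.univ B msq a k j μ ν x x'
        ≤ CM * (P.mesh j ^ P.d)⁻¹ * Real.exp (-(δ₁ * ((HiggsLattice.Site.tdist x x' : ℝ) / (P.L : ℝ) ^ j))))
    (h210AB : (regRegionKernels hL1 C Finset.univ (A + B) msq a k K₀').Ineq210 δ₁ Cst)
    (hA : ∀ b : HiggsLattice.PBond P 0, |A b| ≤ s)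
    (hreg : ∀ (z : HiggsLattice.Site P 0) (μ ν : Fin P.d), |A ⟨z.shift ν, μ⟩ - A ⟨z, μ⟩| ≤ δA)
    (i₀ : Ix N) (b₀ : HiggsLattice.PBond P 0) (y : HiggsLattice.Site P 0) (i : Ix N) :
    ‖covDeriv C B ((propagatorK C Finset.univ (A + B) msq a k - propagatorK C Finset.univ B msq a k) (cb P N 0 (y, i))) b₀‖
      ≤ (|C.e| * s * seedK1 P N δ₁ Cst CM a 2 (P.mesh 0 ^ P.d * Cst) ((P.mesh 0 ^ P.d * Cst) * (1 + Real.exp 1))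
          + (P.L : ℝ) ^ k * (|C.e| * δA) * seedK2 P N δ₁ Cst 2 (P.mesh 0 ^ P.d * Cst)) *
        ∑ j ∈ Finset.range k, P.mesh j ^ ((2 : ℝ) - (P.d : ℝ)) *
          Real.exp (-(δ₁ / 2 / 2 / P.L * (P.mesh j)⁻¹ * (P.mesh 0 * (HiggsLattice.Site.tdist b₀.src y : ℝ)))) := by
  have hL1' : (1 : ℝ) < (P.L : ℝ) := by exact_mod_cast hL1
  have hε := P.mesh_pos 0
  have hak : 0 ≤ B1.aSeq a P.L k := (B1.aSeq_pos ha hL1' hk).le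
  have hcw0 : 0 ≤ P.mesh 0 ^ P.d * Cst := by positivity
  have hcw0' : 0 ≤ (P.mesh 0 ^ P.d * Cst) * (1 + Real.exp 1) := by positivity
  have hW : (propagatorK C Finset.univ (A + B) msq a k - propagatorK C Finset.univ B msq a k) (cb P N 0 (y, i))
      = propagatorK C Finset.univ B msq a k
          (srcV C A B k Finset.univ a (propagatorK C Finset.univ (A + B) msq a k (cb P N 0 (y, i)))) := by
    rw [sub_eq_iff_eq_add'.mpr (B3Eq116TwoSidedExpansion.eq344_model C Finset.univ A B a k hmsq hak), Module.End.mul_apply,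
      Module.End.mul_apply, B3Op116SourceForm.opV_apply_eq_srcV]
  rw [hW]
  have hw : ∑ j ∈ Finset.range k, (fun j => if j < k then pieceR C Finset.univ (A + B) msq a k j (cb P N 0 (y, i)) else 0) j
      = propagatorK C Finset.univ (A + B) msq a k (cb P N 0 (y, i)) := by
    rw [propagatorK_apply_eq_sum_pieces C msq a k (A + B) hmsq ha hL1 hk hkK]
    exact Finset.sum_congr rfl fun j hj => if_pos (Finset.mem_range.1 hj)
  refine phi_row_srcV_le hmsq ha hk hkK hδ₁ hδ₁1 hCst hCM hs hδA ht1 h210B hmixB hA hreg i₀ b₀ y _ _ hw two_pos hcw0 hcw0'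
    (fun j x => ?_) (fun j b => ?_)
  · by_cases hjk : j < k
    · simp only [if_pos hjk]
      refine le_trans ?_ (pcol_le h210AB x y)
      exact Finset.single_le_sum (f := fun i' : Ix N => ‖pieceR C Finset.univ (A + B) msq a k j (cb P N 0 (y, i')) x‖)
        (fun _ _ => norm_nonneg _) (Finset.mem_univ i)
    · simp only [if_neg hjk, Pi.zero_apply, norm_zero]
      exact mul_nonneg (mul_nonneg hcw0 (Real.rpow_nonneg (P.mesh_pos j).le _)) (Real.exp_nonneg _)
  · by_cases hjk : j < k
    · simp only [if_pos hjk]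
      rw [show (2 : ℝ) - 1 - (P.d : ℝ) = (1 : ℝ) - (P.d : ℝ) by ring]
      refine le_trans ?_ (pdcol_cross_bound hjk hδ₁ hδ₁1 hCst hs ht1 h210AB hA b y)
      exact Finset.single_le_sum (f := fun i' : Ix N => ‖covDeriv C B (pieceR C Finset.univ (A + B) msq a k j (cb P N 0 (y, i'))) b‖)
        (fun _ _ => norm_nonneg _) (Finset.mem_univ i)
    · simp only [if_neg hjk, B3Ineq210RegularTorus.covDeriv_zero'', norm_zero]
      exact mul_nonneg (mul_nonneg hcw0' (Real.rpow_nonneg (P.mesh_pos j).le _)) (Real.exp_nonneg _)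

/-- **`W` is symmetric, so its value on a dipole is `ε`× a row derivative**: `⟨(Wdip^{X′}_bY)(x), v⟩ = ε⟨Y, (D^ε_{X′}Wδ_xv)(b)⟩`
(r14's `inner_propagatorK_dip_apply` for both propagators). [cite: Balaban1982Higgs1, (1.7) p.605, (2.20) p.610] -/
theorem inner_W_dip_apply (X' : HiggsLattice.VecField P 0) (b : HiggsLattice.PBond P 0) (Y v : E N) (x : HiggsLattice.Site P 0) :
    ⟪(propagatorK C Finset.univ (A + B) msq a k - propagatorK C Finset.univ B msq a k) (dip C X' b Y) x, v⟫_ℝ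
      = P.mesh 0 * ⟪Y, covDeriv C X'
          ((propagatorK C Finset.univ (A + B) msq a k - propagatorK C Finset.univ B msq a k) (Pi.single x v)) b⟫_ℝ := by
  -- `D^ε_X(u − v) = D^ε_Xu − D^ε_Xv` (r13's `B1Ineq226RegularRegion.covDeriv_sub'`, not in this file's import cone)
  have covDeriv_sub : ∀ (u v : ScalarField P 0 N), covDeriv C X' (u - v) b = covDeriv C X' u b - covDeriv C X' v b := by
    intro u v
    unfold covDeriv
    rw [Pi.sub_apply, Pi.sub_apply, map_sub, ← smul_sub]
    congr 1
    abel
  rw [LinearMap.sub_apply, LinearMap.sub_apply, Pi.sub_apply, inner_sub_left, B3Op116SourceForm.inner_propagatorK_dip_apply,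
    B3Op116SourceForm.inner_propagatorK_dip_apply, ← mul_sub, ← inner_sub_right, ← covDeriv_sub]

/-- `⟨z, z⟩ ≤ ‖z‖·c`, `c ≥ 0` ⟹ `‖z‖ ≤ c`. [folklore] -/
private theorem norm_le_of_inner_self_le'' {z : E N} {c : ℝ} (hc : 0 ≤ c) (h : ⟪z, z⟫_ℝ ≤ ‖z‖ * c) : ‖z‖ ≤ c := by
  rw [real_inner_self_eq_norm_sq, pow_two] at h
  by_cases hz0 : ‖z‖ = 0
  · rw [hz0]; exact hc
  · exact le_of_mul_le_mul_left h (lt_of_le_of_ne (norm_nonneg z) (Ne.symm hz0))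

/-- **The value of `W` on a dipole through the rows of `W`**: `‖(Wdip^{X′}_bY)(x)‖ ≤ ε‖Y‖Σ_i‖(D^ε_{X′}We_{(x,i)})(b)‖`.
[cite: Balaban1982Higgs1, (1.7) p.605, (2.20) p.610] -/
theorem norm_W_dip_apply_le (X' : HiggsLattice.VecField P 0) (b : HiggsLattice.PBond P 0) (Y : E N) (x : HiggsLattice.Site P 0) :
    ‖(propagatorK C Finset.univ (A + B) msq a k - propagatorK C Finset.univ B msq a k) (dip C X' b Y) x‖
      ≤ P.mesh 0 * ‖Y‖ * ∑ i : Ix N, ‖covDeriv C X'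
          ((propagatorK C Finset.univ (A + B) msq a k - propagatorK C Finset.univ B msq a k) (cb P N 0 (x, i))) b‖ := by
  have hS0 : 0 ≤ ∑ i : Ix N, ‖covDeriv C X'
      ((propagatorK C Finset.univ (A + B) msq a k - propagatorK C Finset.univ B msq a k) (cb P N 0 (x, i))) b‖ :=
    Finset.sum_nonneg fun _ _ => norm_nonneg _
  have hε : 0 < P.mesh 0 := P.mesh_pos 0
  refine norm_le_of_inner_self_le'' (by positivity) ?_
  rw [inner_W_dip_apply]
  calc P.mesh 0 * ⟪Y, covDeriv C X' ((propagatorK C Finset.univ (A + B) msq a k - propagatorK C Finset.univ B msq a k)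
          (Pi.single x ((propagatorK C Finset.univ (A + B) msq a k - propagatorK C Finset.univ B msq a k) (dip C X' b Y) x))) b⟫_ℝ
      ≤ P.mesh 0 * (‖Y‖ * ‖covDeriv C X' ((propagatorK C Finset.univ (A + B) msq a k - propagatorK C Finset.univ B msq a k)
          (Pi.single x ((propagatorK C Finset.univ (A + B) msq a k - propagatorK C Finset.univ B msq a k) (dip C X' b Y) x))) b‖) :=
        mul_le_mul_of_nonneg_left (real_inner_le_norm _ _) hε.le
    _ ≤ P.mesh 0 * (‖Y‖ * (‖(propagatorK C Finset.univ (A + B) msq a k - propagatorK C Finset.univ B msq a k) (dip C X' b Y) x‖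
          * ∑ i : Ix N, ‖covDeriv C X'
              ((propagatorK C Finset.univ (A + B) msq a k - propagatorK C Finset.univ B msq a k) (cb P N 0 (x, i))) b‖)) :=
        mul_le_mul_of_nonneg_left (mul_le_mul_of_nonneg_left
          (B3Ineq210MixedRegularTorus.norm_covDeriv_apply_single_le C X'
            (propagatorK C Finset.univ (A + B) msq a k - propagatorK C Finset.univ B msq a k) x _ b) (norm_nonneg _)) hε.le
    _ = _ := by ring

/-- **THE MIXED SEED, column side (value of `W` on the `B`-dipole).**  `‖([G_k(T_ε,A+B) − G_k(T_ε,B)]dip^B_{b′}Y)(x)‖ ≤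
ε‖Y‖·#Ix·(|e|s·K₁ + L^k|e|δ_A·K₂)·Σ_{j<k}(L^jε)^{2−d}exp(−(δ₁/(4L))(L^jε)^{−1}ε|b′₋ − x|)` with the constants of `deriv_W_single_le` — by the
symmetry of `W` (`norm_W_dip_apply_le`) and the row bound `deriv_W_single_le` at the row bond `b′`. [cite: Balaban1983Higgs3, (1.16) p.414, (2.10) p.426] [cite: Balaban1982Higgs1, (2.20) p.610, (3.44) p.619] -/
theorem value_W_dip_le (hmsq : 0 < msq) (ha : 0 < a) (hk : 1 ≤ k) (hkK : k ≤ P.K) (hδ₁ : 0 < δ₁) (hδ₁1 : δ₁ ≤ 1) (hCst : 0 ≤ Cst)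
    (hCM : 0 ≤ CM) (hs : 0 ≤ s) (hδA : 0 ≤ δA) (ht1 : P.mesh k * (|C.e| * s) ≤ 1)
    (h210B : (regRegionKernels hL1 C Finset.univ B msq a k K₀).Ineq210 δ₁ Cst)
    (hmixB : ∀ (j : ℕ) (μ ν : Fin P.d) (x x' : HiggsLattice.Site P 0),
      B3Ineq210MixedRegularRegion.mixedTermR C Finset.univ B msq a k j μ ν x x'
        ≤ CM * (P.mesh j ^ P.d)⁻¹ * Real.exp (-(δ₁ * ((HiggsLattice.Site.tdist x x' : ℝ) / (P.L : ℝ) ^ j))))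
    (h210AB : (regRegionKernels hL1 C Finset.univ (A + B) msq a k K₀').Ineq210 δ₁ Cst)
    (hA : ∀ b : HiggsLattice.PBond P 0, |A b| ≤ s)
    (hreg : ∀ (z : HiggsLattice.Site P 0) (μ ν : Fin P.d), |A ⟨z.shift ν, μ⟩ - A ⟨z, μ⟩| ≤ δA)
    (i₀ : Ix N) (b' : HiggsLattice.PBond P 0) (Y : E N) (x : HiggsLattice.Site P 0) :
    ‖(propagatorK C Finset.univ (A + B) msq a k - propagatorK C Finset.univ B msq a k) (dip C B b' Y) x‖
      ≤ P.mesh 0 * ‖Y‖ * ((Fintype.card (Ix N) : ℝ) *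
        ((|C.e| * s * seedK1 P N δ₁ Cst CM a 2 (P.mesh 0 ^ P.d * Cst) ((P.mesh 0 ^ P.d * Cst) * (1 + Real.exp 1))
            + (P.L : ℝ) ^ k * (|C.e| * δA) * seedK2 P N δ₁ Cst 2 (P.mesh 0 ^ P.d * Cst)) *
          ∑ j ∈ Finset.range k, P.mesh j ^ ((2 : ℝ) - (P.d : ℝ)) *
            Real.exp (-(δ₁ / 2 / 2 / P.L * (P.mesh j)⁻¹ * (P.mesh 0 * (HiggsLattice.Site.tdist b'.src x : ℝ)))))) := by
  refine (norm_W_dip_apply_le B b' Y x).trans (mul_le_mul_of_nonneg_left ?_ (mul_nonneg (P.mesh_pos 0).le (norm_nonneg _)))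
  refine (Finset.sum_le_sum fun i _ =>
    deriv_W_single_le hmsq ha hk hkK hδ₁ hδ₁1 hCst hCM hs hδA ht1 h210B hmixB h210AB hA hreg i₀ b' x i).trans (le_of_eq ?_)
  rw [Finset.sum_const, nsmul_eq_mul, Finset.card_univ]

/-- A constant times a constant-free majorant sum IS p35's currency `𝔪_k(c,a;δ)(x,y)` (`B3Op116MajorantStep.maj`). [cite: Balaban1983Higgs3, (2.10) p.426] -/
theorem mul_sumS_eq_maj (K aexp δ : ℝ) (x y : HiggsLattice.Site P 0) :
    K * ∑ j ∈ Finset.range k, P.mesh j ^ (aexp - (P.d : ℝ)) * Real.exp (-(δ * (P.mesh j)⁻¹ * (P.mesh 0 * (HiggsLattice.Site.tdist x y : ℝ))))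
      = B3Op116MajorantStep.maj P k K aexp δ x y := by
  unfold B3Op116MajorantStep.maj
  rw [Finset.mul_sum]
  exact Finset.sum_congr rfl fun j _ => by ring

/-- **THE MIXED SEED AS A STATE of p35's induction** (`B3Op116DKernelRegularTorus.step_state`, state `J = 0`): the field
`φ = [G_k(T_ε,A+B) − G_k(T_ε,B)]dip^B_{b′}Y` has VALUES below `𝔪_k(cv₀, 2; δ₀)(·, b′₋)` and `D^ε_B`-DERIVATIVES below `𝔪_k(cd₀, 1; δ₀)(b₋, b′₋)` with
`δ₀ = δ₁/(4L)`, `cd₀ = |e|s·K₁⁽¹⁾ + L^k|e|δ_A·K₂⁽¹⁾` (`mixed_seed_le`), `cv₀ = ε‖Y‖·#Ix·(|e|s·K₁⁽²⁾ + L^k|e|δ_A·K₂⁽²⁾)` (`value_W_dip_le`) — both one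
factor `|e|s + L^k|e|δ_A` (times `ε^{d+1}‖Y‖` inside the constants) better than the crude dipole bound, which is what makes the chains of (1.16)
with a dipole at both ends summable (p35 DESIGN-FILE4 §9(d)). [cite: Balaban1983Higgs3, (1.16) p.414, (2.6) p.424, (2.10) p.426] [cite: Balaban1982Higgs1, (3.16) p.615, (3.44) p.619] -/
theorem mixed_seed_state (hmsq : 0 < msq) (ha : 0 < a) (hk : 1 ≤ k) (hkK : k ≤ P.K) (hδ₁ : 0 < δ₁) (hδ₁1 : δ₁ ≤ 1) (hCst : 0 ≤ Cst)
    (hCM : 0 ≤ CM) (hs : 0 ≤ s) (hδA : 0 ≤ δA) (ht1 : P.mesh k * (|C.e| * s) ≤ 1)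
    (h210B : (regRegionKernels hL1 C Finset.univ B msq a k K₀).Ineq210 δ₁ Cst)
    (hmixB : ∀ (j : ℕ) (μ ν : Fin P.d) (x x' : HiggsLattice.Site P 0),
      B3Ineq210MixedRegularRegion.mixedTermR C Finset.univ B msq a k j μ ν x x'
        ≤ CM * (P.mesh j ^ P.d)⁻¹ * Real.exp (-(δ₁ * ((HiggsLattice.Site.tdist x x' : ℝ) / (P.L : ℝ) ^ j))))
    (h210AB : (regRegionKernels hL1 C Finset.univ (A + B) msq a k K₀').Ineq210 δ₁ Cst)
    (hmixAB : ∀ (j : ℕ) (μ ν : Fin P.d) (x x' : HiggsLattice.Site P 0),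
      B3Ineq210MixedRegularRegion.mixedTermR C Finset.univ (A + B) msq a k j μ ν x x'
        ≤ CM * (P.mesh j ^ P.d)⁻¹ * Real.exp (-(δ₁ * ((HiggsLattice.Site.tdist x x' : ℝ) / (P.L : ℝ) ^ j))))
    (hA : ∀ b : HiggsLattice.PBond P 0, |A b| ≤ s)
    (hreg : ∀ (z : HiggsLattice.Site P 0) (μ ν : Fin P.d), |A ⟨z.shift ν, μ⟩ - A ⟨z, μ⟩| ≤ δA)
    (i₀ : Ix N) (b' : HiggsLattice.PBond P 0) (Y : E N) :
    (∀ x : HiggsLattice.Site P 0,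
      ‖(propagatorK C Finset.univ (A + B) msq a k - propagatorK C Finset.univ B msq a k) (dip C B b' Y) x‖
        ≤ B3Op116MajorantStep.maj P k
            (P.mesh 0 * ‖Y‖ * (Fintype.card (Ix N) : ℝ) *
              (|C.e| * s * seedK1 P N δ₁ Cst CM a 2 (P.mesh 0 ^ P.d * Cst) ((P.mesh 0 ^ P.d * Cst) * (1 + Real.exp 1))
                + (P.L : ℝ) ^ k * (|C.e| * δA) * seedK2 P N δ₁ Cst 2 (P.mesh 0 ^ P.d * Cst)))
            2 (δ₁ / 2 / 2 / P.L) x b'.src) ∧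
    (∀ b₀ : HiggsLattice.PBond P 0,
      ‖covDeriv C B ((propagatorK C Finset.univ (A + B) msq a k - propagatorK C Finset.univ B msq a k) (dip C B b' Y)) b₀‖
        ≤ B3Op116MajorantStep.maj P k
            (|C.e| * s * seedK1 P N δ₁ Cst CM a 1 (P.mesh 0 * ‖Y‖ * ((P.mesh 0 ^ P.d * Cst) * (1 + Real.exp 1)))
                (P.mesh 0 * ‖Y‖ * (P.mesh 0 ^ P.d * CM + (P.mesh 0 ^ P.d * Cst) * Real.exp 1
                  + (P.mesh 0 ^ P.d * Cst) * (1 + Real.exp 1) * Real.exp 1))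
              + (P.L : ℝ) ^ k * (|C.e| * δA) * seedK2 P N δ₁ Cst 1 (P.mesh 0 * ‖Y‖ * ((P.mesh 0 ^ P.d * Cst) * (1 + Real.exp 1))))
            1 (δ₁ / 2 / 2 / P.L) b₀.src b'.src) := by
  constructor
  · intro x
    refine (value_W_dip_le hmsq ha hk hkK hδ₁ hδ₁1 hCst hCM hs hδA ht1 h210B hmixB h210AB hA hreg i₀ b' Y x).trans (le_of_eq ?_)
    rw [← mul_sumS_eq_maj, tdist_comm x b'.src]
    ring
  · intro b₀
    refine (mixed_seed_le hmsq ha hk hkK hδ₁ hδ₁1 hCst hCM hs hδA ht1 h210B hmixB h210AB hmixAB hA hreg i₀ b₀ b' Y).trans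
      (le_of_eq ?_)
    rw [← mul_sumS_eq_maj]

end Instances


end Literature.MathematicalPhysics.QuantumFieldTheory.Balaban1983to89.B3Op116MixedSeed

end
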